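import Literature.Geometry.Symplectic.FoldFormsFourFoldsProofs
import Literature.Geometry.Symplectic.SteinLevelTransport
import Literature.Geometry.Symplectic.SteinSeamForms
import Literature.Geometry.Kaehler.ManifoldFormsFunSmulProofs
import Literature.Topology.FourManifolds.OpenCollarExistence
import HarnessLib

/-!
# Folding two Stein domains along their contact boundaries, I: transport along the Liouville
# collar

Proofs file towards the named fact `Literature.Geometry.Symplectic.CannasDaSilva2010_foldedForm_of_orientable`
(`FoldFormsFourFolds.lean`; Cannas da Silva 2010, Thm. 2) along its second published route:
Baykur, *Kähler decomposition of 4-manifolds* (2006), Thm. 6.1 — a closed oriented 4-manifold,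
decomposed into two compact Stein domains with matching contact boundaries (Thm. 5.1, the tree's
named fact `Literature.Geometry.Symplectic.baykur_kahlerDecomposition`), carries a folded symplectic
form obtained by folding the two Kähler forms along the seam in collars of the two boundaries
("We begin with adding collars … the folding operation provides us with the desired local model
on `N`, that is, `(N, ω|_N)` is folded symplectomorphic to `([-1, 1] × H, d((t² + 1) π^*α))`",
loc. cit., proof of Thm. 6.1; Cannas da Silva 2010, §2: "Doubles of symplectic manifolds with
`ω`-convex boundary are easy examples of manifolds with folded symplectic forms").

The collars used are the flow-outs of the normalised Liouville field of a Stein domain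
(`SteinStructure.liouvilleFlowout`, `SteinLiouvilleField.lean`; Cieliebak–Eliashberg 2012, §2),
along which the Liouville form `λ = -dφ ∘ J` is transported conformally and the levels of `φ`
to levels (`SteinLevelTransport.lean`, chart-box form).  This file assembles the chart-box
statements into the global statement along the flow-out `Γ.Fl` of a cover `Γ`
(`BoundaryFlowout.lean`), which is what the collar identity `Fl^*λ = m · π^*(λ|_{∂W})` needs:

* `SteinStructure.exists_hasMFDerivAt_Fl_transport` — for `z` with `f z < a` and `t ∈ [0, a]`
  the time-`t` flow-out map `Fl(·, t)` is differentiable at `z`, its differential preserves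
  `dφ` and rescales the contact form `λ` by a positive factor.
* Section `SeamModel` — the seam piece `H × ℝ` of the gluing (`H` a `3`-manifold, the common
  boundary): the slice form `π^*β` (`sliceForm`) and the **seam primitive** `Λ = Φ · π^*β`
  (`seamPrimitive`; Baykur's `(t² + 1) π^*α` near the fold), its smoothness, and the
  identification of `Λ` and `dΛ`, read in a product chart `κ = consCLE ∘ (chart × id)`, with the
  general fold model `Φ̂ b̂`, `d(Φ̂ b̂)` of `FoldFormsFourFoldsProofs.lean`
  (`seamPrimitive_eq_pullback_seamChart`, `mextDeriv_seamPrimitive_eq_pullback`), the flat data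
  `Φ̂ = flatProfile`, `b̂ = flatSliceCovector` being `C^∞` over the chart target with `b̂(e₀) = 0`,
  `∂₀ b̂ = 0`.
* Section `LiouvilleCollar` — the long open collar `CM = Γ.openCollar b` of the Liouville
  flow-out (`OpenCollarExistence.lean`), `(x, s) ↦ Fl (incl x) (a s/(1+s))`, read on the seam
  piece `∂W × ℝ`: its slice and ray differentials (`exists_hasMFDerivAt_openCollar_slice`,
  `hasMFDerivAt_openCollar_ray`, `exists_mfderiv_uncurry_openCollar`), the collar identity
  `(CM^*λ)_{(x,s)}(v, r) = m · (incl^*λ)_x(v)`, `m > 0`, for `s > 0`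
  (`exists_liouvilleForm_pullback_openCollar_apply`: no `ds`-component since `λ(ξ) = 0`,
  positive proportionality by the conformal transport), injectivity of the collar differential
  (`injective_mfderiv_uncurry_openCollar`, via the smooth left inverse `(proj, height)`) and
  non-degeneracy of `d(CM^*λ) = CM^*ω` for `s > 0`
  (`exists_mextDeriv_liouvilleForm_pullback_openCollar_ne_zero`).
* Section `FlatRep` — any form `α` on `H × ℝ` equals, over a chart domain, the pull-back along
  the product chart of its flat representative `flatRep α h₀ = (κ⁻¹)^*α` on `ℝ⁴`
  (`eq_pullback_flatRep`; inverse chart `seamChartInv`, its differential, smoothness and the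
  naturality `mextDeriv_flatRep`).
* Section `CollarFlat` — the boundary contact form `β₀ = incl^*λ` (`boundaryContactForm`,
  nowhere zero) and the collar Liouville form `CM^*λ` (`collarLiouvilleForm`); read flat, the
  latter is pointwise a positive multiple of the flat slice covector of `β₀`
  (`exists_flatRep_collarLiouvilleForm_eq_smul`) and locally the general fold primitive `m̂ b̂`
  with a `C^∞` positive factor (`exists_flatRep_collarLiouvilleForm_eq_genFoldPrimitive`).
* Section `CollarFlatDeriv` — non-degeneracy of `d(flatRep (CM^*λ))` for `u₀ > 0` and, via the
  Pfaffian of the model, `∂₀ m̂ ≠ 0` and `(b̂ ∧ db̂)(e₁,e₂,e₃) ≠ 0`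
  (`exists_collar_genFoldPrimitive_data`).
* Sections `ExplicitFactor`, `CollarFactor`, `CollarFactorFlat` — the factor is
  `exp (∫₀ᵗ cutCoef (Fl z τ) dτ)` (`contactForm_mfderiv_curve_eq_exp_mul`,
  `exists_hasMFDerivAt_Fl_transport_exp`), the coefficient is negative along the collar
  (`cutCoef_Fl_neg`), whence the **collar factor** `collarFactor` decreases strictly
  (`collarFactor_lt_collarFactor`); `(CM^*λ)_{(x,s)}(v,r) = m(x,s) β₀_x(v)`
  (`collarLiouvilleForm_apply_eq`), the flat version (`flatRep_collarLiouvilleForm_eq`), the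
  identification `m̂ = m ∘ κ⁻¹` (`mhat_eq_collarFactor`) and the sign tool
  `fderiv_stdVec_zero_neg_of_antitone` (`∂₀ m̂ < 0`).
* Section `FlatCollarFactor` — the global flat factor `flatCollarFactor h₀ u = m(chart⁻¹ (tail u), u₀)`:
  over `U⁺ = {tail u ∈ chart target, u₀ > 0}` it is `C^∞` (`contDiffOn_flatCollarFactor`, via the
  generic `contDiffOn_factor_of_flatRep_eq`), positive, `≤ 1`, strictly decreasing in `u₀` with
  `∂₀ < 0` (`fderiv_flatCollarFactor_stdVec_zero_neg`), `flatRep (CM^*λ) = genFoldPrimitive (…) b̂`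
  (`flatRep_collarLiouvilleForm_eq_genFoldPrimitive`); `flatRep (π^*β) = b̂` (`flatRep_sliceForm`)
  and the slice contact volume of `b̂` is non-zero over the whole chart target
  (`sliceContactVolume_flatSliceCovector_ne_zero`).
* Sections `Reflection`, `FlippedCollar` — the second piece enters the seam time-reversed: the
  reversal `seamFlip (x, s) = (x, -s)`, its flat counterpart `flatFlip u = u - 2u₀e₀`,
  `flatRep (ν^*α) = R₀^*(flatRep α)` (`flatRep_pullback_seamFlip`); the sign-corrected reversed
  collar form `flippedCollarForm ε = ε · ν^*(CN^*λ)` reads flat as `n̂ b̂₁` with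
  `n̂ = ε g · m(R₀ ·)` (`flatRep_flippedCollarForm_eq`, for a conformal relation
  `incl'^*λ = g β₁`), `n̂ > 0`, `n̂ ≤ G`, `C^∞` on `U⁻` and `∂₀ n̂ > 0`
  (`fderiv_flatFlippedFactor_stdVec_zero_pos`).
* Section `Profile` — the cut-off `cutPlus δ` and the flat profile
  `gluedProfile δ K F₁ F₂ u = ρ₊(u₀) F₁ u + ρ₀(u₀) (K - u₀²) + ρ₊(-u₀) F₂ u`: `C^∞` on a slab when
  `F₁`/`F₂` are `C^∞` on its positive/negative halves (`contDiffOn_gluedProfile`), the seam data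
  `∂₀Φ̂ = 0`, `Φ̂ = K`, `∂₀∂₀Φ̂ = -2` at `u₀ = 0` (`gluedProfile_seam`), and `Φ̂ > 0` with
  `∂₀Φ̂ < 0` for `u₀ > 0` / `∂₀Φ̂ > 0` for `u₀ < 0` when `K > B + 4δ²` bounds the factors
  (`gluedProfile_pos_side`, `gluedProfile_neg_side`).

Everything is proved; the definitions are explicit constructions (no notions, no named facts).

## References

* R. İ. Baykur, *Kähler decomposition of 4-manifolds*, Algebr. Geom. Topol. 6 (2006)
  1239–1265, Thm. 6.1 and its proof. [Baykur2006]
* A. Cannas da Silva, *Fold-forms for four-folds*, J. Symplectic Geom. 8 (2010), §2.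
  [Cannasdasilva2010]
* K. Cieliebak, Ya. Eliashberg, *From Stein to Weinstein and Back*, AMS Colloquium Publ. 59
  (2012), §2, §11.1 (Liouville fields of `J`-convex functions; Gray stability along levels).
  [CieliebakEliashberg2012]
-/

noncomputable section

open scoped Manifold ContDiff Topology
open Set Function Filter Metric

namespace Literature.Geometry.Symplectic

namespace SteinStructure

open Literature.Topology.FourManifolds

variable {W : Type*} [TopologicalSpace W] [ChartedSpace (EuclideanHalfSpace 4) W]
  [IsManifold (𝓡∂ 4) ∞ W] [CompactSpace W] [T2Space W] (S : SteinStructure W)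

/-- **Transport along the Liouville flow-out, global form.**  Let `D = S.liouvilleFlowout` be
the flow-out input of the normalised (cut-off) Liouville field of a compact Stein domain and
`Γ` a cover (`BoundaryFlowout.lean`).  For a point `z` of the collar `{f < a}` (`f = max φ - φ`)
and a time `t ∈ [0, a]`, the flow-out map `Fl(·, t)` is differentiable at `z`, and its
differential `L` maps the levels of `φ` to levels (`dφ ∘ L = dφ`) and the contact form
conformally with a positive factor (`λ ∘ L = m · λ`, `m > 0`): the chart-box statements
`dφ_mfderiv_curve`, `exists_pos_contactForm_mfderiv_curve` of `SteinLevelTransport.lean` in the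
box of the chosen centre of `z`, where `Fl = curve` near `z` (`Fl_eq_of_mem_dom`).
[cite: CieliebakEliashberg2012, §2 and §11.1] -/
theorem exists_hasMFDerivAt_Fl_transport {c₀ c₁ : ℝ} {hc : c₀ < c₁}
    {hc₁ : c₁ < sSup (range S.φ)} {hreg : ∀ x, c₀ ≤ S.φ x → S.dφ x ≠ 0}
    {D : FlowoutInput 3 W} (hD : D = S.liouvilleFlowout hc hc₁ hreg) (Γ : D.Cover)
    {z : W} (hz : D.f z < Γ.a) {t : ℝ} (ht : t ∈ Icc 0 Γ.a) :
    ∃ L : EuclideanSpace ℝ (Fin 4) →L[ℝ] EuclideanSpace ℝ (Fin 4),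
      HasMFDerivAt (𝓡∂ 4) (𝓡∂ 4) (fun z' => Γ.Fl z' t) z L ∧
      (∀ v, S.dφ (Γ.Fl z t) (L v) = S.dφ z v) ∧
      ∃ m : ℝ, 0 < m ∧ ∀ v, S.contactForm (Γ.Fl z t) (L v) = m * S.contactForm z v := by
  obtain ⟨hy, hzd⟩ := Γ.centre_spec hz.le
  set C := Γ.bx (Γ.centre z) hy with hC
  have htε : t ∈ Icc 0 C.box.ε := ⟨ht.1, ht.2.trans (Γ.a_le_ε _ hy)⟩
  obtain ⟨J, -, -, hJd⟩ := C.exists_linearization_box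
  have hder := C.hasMFDerivAt_curve hJd hzd htε
  -- `Fl(·, t) = curve(·, t)` near `z`
  have hev : (fun z' => Γ.Fl z' t) =ᶠ[𝓝 z] fun z' => C.curve z' t := by
    have ho : IsOpen ({z' | D.f z' < Γ.a} ∩ C.dom) :=
      (isOpen_lt D.f_smooth.continuous continuous_const).inter C.isOpen_dom
    filter_upwards [ho.mem_nhds ⟨hz, hzd⟩] with z' hz'
    exact Γ.Fl_eq_of_mem_dom hy hz'.1.le hz'.2 ⟨by linarith [D.f_nonneg z', ht.1], ht.2⟩
  have hFl : Γ.Fl z t = C.curve z t :=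
    Γ.Fl_eq_of_mem_dom hy hz.le hzd ⟨by linarith [D.f_nonneg z, ht.1], ht.2⟩
  refine ⟨_, hder.congr_of_eventuallyEq hev, fun v => ?_, ?_⟩
  · have h := S.dφ_mfderiv_curve hD C hzd htε v
    rw [hder.mfderiv] at h
    rw [hFl]
    exact h
  · obtain ⟨m, hm, hmv⟩ := S.exists_pos_contactForm_mfderiv_curve hD C hzd htε
    refine ⟨m, hm, fun v => ?_⟩
    have h := hmv v
    rw [hder.mfderiv] at h
    rw [hFl]
    exact h

end SteinStructure

open Literature.Geometry.Kaehler Literature.Topology.FourManifolds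

/-! ### The seam model: `Λ = Φ · π^*β` on `H × ℝ` and its chart representative

In the proof of Baykur 2006, Thm. 6.1 the folded form near the seam `H = ∂X₊ ≅ ∂X₋` is
`d((t² + 1) π^*α)` on `[-1, 1] × H`; away from the fold the Kähler potentials' Liouville forms,
restricted to the Liouville collars, are of the same shape `m · π^*α`.  This section sets up such
forms on the product `H × ℝ` (model `(𝓡 3).prod 𝓘(ℝ, ℝ)`, the seam piece of
`Literature.Topology.FourManifolds.BoundaryGlueData`) and reads them in the product charts composed
with `consCLE : ℝ³ × ℝ ≅ ℝ⁴` (the identification used by the gluing construction, collar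
coordinate first), where they become the general fold model of `FoldFormsFourFoldsProofs.lean`. -/

section SeamModel

variable {H : Type*} [TopologicalSpace H] [ChartedSpace (EuclideanSpace ℝ (Fin 3)) H]

/-- The slice form `π^*β` on `H × ℝ` of a `1`-form `β` on `H`. [folklore] -/
def sliceForm (β : MForm (𝓡 3) H ℝ 1) : MForm ((𝓡 3).prod 𝓘(ℝ, ℝ)) (H × ℝ) ℝ 1 := fun p =>
  (β p.1).compContinuousLinearMap (ContinuousLinearMap.fst ℝ (EuclideanSpace ℝ (Fin 3)) ℝ)

/-- `π^*β (v) = β (v.1)`. [folklore] -/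
@[simp]
theorem sliceForm_apply (β : MForm (𝓡 3) H ℝ 1) (p : H × ℝ)
    (v : Fin 1 → EuclideanSpace ℝ (Fin 3) × ℝ) :
    sliceForm β p v = β p.1 (fun i => (v i).1) := rfl

/-- The slice form is the pull-back of `β` along `Prod.fst`. [folklore] -/
theorem sliceForm_eq_pullback (β : MForm (𝓡 3) H ℝ 1) :
    sliceForm β = β.pullback ((𝓡 3).prod 𝓘(ℝ, ℝ)) Prod.fst := by
  funext p
  show (β p.1).compContinuousLinearMap (ContinuousLinearMap.fst ℝ (EuclideanSpace ℝ (Fin 3)) ℝ) =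
    (β p.1).compContinuousLinearMap (mfderiv ((𝓡 3).prod 𝓘(ℝ, ℝ)) (𝓡 3) Prod.fst p)
  rw [mfderiv_fst]
  rfl

/-- **The seam primitive** `Λ = Φ · π^*β` on `H × ℝ`. [cite: Baykur2006, proof of Thm. 6.1] -/
def seamPrimitive (β : MForm (𝓡 3) H ℝ 1) (Φ : H × ℝ → ℝ) :
    MForm ((𝓡 3).prod 𝓘(ℝ, ℝ)) (H × ℝ) ℝ 1 :=
  Φ • sliceForm β

/-- `Λ (v) = Φ · β (v.1)`. [folklore] -/
@[simp]
theorem seamPrimitive_apply (β : MForm (𝓡 3) H ℝ 1) (Φ : H × ℝ → ℝ) (p : H × ℝ)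
    (v : Fin 1 → EuclideanSpace ℝ (Fin 3) × ℝ) :
    seamPrimitive β Φ p v = Φ p * β p.1 (fun i => (v i).1) := rfl

variable [IsManifold (𝓡 3) ∞ H]

/-- The seam primitive is smooth for smooth `β`, `Φ`. [folklore] -/
theorem isSmoothForm_seamPrimitive {β : MForm (𝓡 3) H ℝ 1} (hβ : IsSmoothForm β)
    {Φ : H × ℝ → ℝ} (hΦ : ContMDiff ((𝓡 3).prod 𝓘(ℝ, ℝ)) 𝓘(ℝ) ∞ Φ) :
    IsSmoothForm (seamPrimitive β Φ) := by
  have h1 : IsSmoothForm (sliceForm β) := by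
    rw [sliceForm_eq_pullback]
    exact fun p => MForm.SmoothAt.pullback (Eventually.of_forall fun q => contMDiff_fst q) (hβ _)
  exact IsSmoothForm.fun_smul' hΦ h1

/-! #### The flat model read in a product chart -/

/-- Dropping the collar coordinate: `ℝ⁴ → ℝ³`, `u ↦ (u₁, u₂, u₃)` (`consCLE⁻¹` then `fst`).
[folklore] -/
def sliceTail : EuclideanSpace ℝ (Fin 4) →L[ℝ] EuclideanSpace ℝ (Fin 3) :=
  (ContinuousLinearMap.fst ℝ (EuclideanSpace ℝ (Fin 3)) ℝ).comp
    (BoundaryManifold.consCLE 3).symm.toContinuousLinearMap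

/-- `tail (consCLE (y, t)) = y`. [folklore] -/
@[simp]
theorem sliceTail_consCLE (y : EuclideanSpace ℝ (Fin 3)) (t : ℝ) :
    sliceTail (BoundaryManifold.consCLE 3 (y, t)) = y := by
  simp [sliceTail]

/-- `consCLE (y, t) 0 = t`. [folklore] -/
theorem consCLE_apply_zero' (y : EuclideanSpace ℝ (Fin 3)) (t : ℝ) :
    BoundaryManifold.consCLE 3 (y, t) 0 = t := BoundaryManifold.consCLE_apply_zero 3 (y, t)

/-- `tail e₀ = 0`. [folklore] -/
@[simp]
theorem sliceTail_stdVec_zero : sliceTail (stdVec 0) = 0 := by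
  have h : stdVec 0 = BoundaryManifold.consCLE 3 ((0 : EuclideanSpace ℝ (Fin 3)), (1 : ℝ)) := by
    ext i
    refine Fin.cases ?_ (fun j => ?_) i
    · simp [stdVec]
    · rw [BoundaryManifold.consCLE_apply_succ]
      simp [stdVec, Fin.succ_ne_zero]
  rw [h, sliceTail_consCLE]

/-- The flat slice covector field: `b̂_u = β̂_{tail u} ∘ tail`, `β̂` the representative of `β` in
the chart at `h₀`. [folklore] -/
def flatSliceCovector (β : MForm (𝓡 3) H ℝ 1) (h₀ : H) (u : EuclideanSpace ℝ (Fin 4)) :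
    EuclideanSpace ℝ (Fin 4) →L[ℝ] ℝ :=
  (alt1ToCLM (β.inChart h₀ (sliceTail u))).comp sliceTail

/-- The flat profile: `Φ̂ u = Φ (chart⁻¹ (tail u), u₀)`. [folklore] -/
def flatProfile (Φ : H × ℝ → ℝ) (h₀ : H) (u : EuclideanSpace ℝ (Fin 4)) : ℝ :=
  Φ ((extChartAt (𝓡 3) h₀).symm (sliceTail u), u 0)

omit [IsManifold (𝓡 3) ∞ H] in
/-- `b̂_u (e₀) = 0`: the slice covector kills the collar direction. [folklore] -/
theorem flatSliceCovector_stdVec_zero (β : MForm (𝓡 3) H ℝ 1) (h₀ : H)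
    (u : EuclideanSpace ℝ (Fin 4)) : flatSliceCovector β h₀ u (stdVec 0) = 0 := by
  show alt1ToCLM (β.inChart h₀ (sliceTail u)) (sliceTail (stdVec 0)) = 0
  rw [sliceTail_stdVec_zero, map_zero]

omit [IsManifold (𝓡 3) ∞ H] in
/-- `b̂` is invariant under translation in the collar direction. [folklore] -/
theorem flatSliceCovector_add_smul (β : MForm (𝓡 3) H ℝ 1) (h₀ : H)
    (u : EuclideanSpace ℝ (Fin 4)) (r : ℝ) :
    flatSliceCovector β h₀ (u + r • stdVec 0) = flatSliceCovector β h₀ u := by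
  simp [flatSliceCovector]

omit [IsManifold (𝓡 3) ∞ H] in
/-- `∂₀ b̂ = 0`: the slice covector field is constant in the collar direction. [folklore] -/
theorem fderiv_flatSliceCovector_stdVec_zero (β : MForm (𝓡 3) H ℝ 1) (h₀ : H)
    (u : EuclideanSpace ℝ (Fin 4)) : fderiv ℝ (flatSliceCovector β h₀) u (stdVec 0) = 0 := by
  by_cases hd : DifferentiableAt ℝ (flatSliceCovector β h₀) u
  · have h1 : HasDerivAt (fun r : ℝ => flatSliceCovector β h₀ (u + r • stdVec 0))
        (fderiv ℝ (flatSliceCovector β h₀) u (stdVec 0)) 0 := by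
      have hl : HasDerivAt (fun r : ℝ => u + r • stdVec 0) (stdVec 0) 0 := by
        simpa using ((hasDerivAt_id (0 : ℝ)).smul_const (stdVec 0 : EuclideanSpace ℝ (Fin 4))).const_add u
      have h0 : HasFDerivAt (flatSliceCovector β h₀) (fderiv ℝ (flatSliceCovector β h₀) u)
          (u + (0 : ℝ) • stdVec 0) := by
        rw [zero_smul, add_zero]; exact hd.hasFDerivAt
      exact h0.comp_hasDerivAt 0 hl
    have h2 : HasDerivAt (fun r : ℝ => flatSliceCovector β h₀ (u + r • stdVec 0)) 0 0 := by
      simp_rw [flatSliceCovector_add_smul]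
      exact hasDerivAt_const 0 _
    exact h1.unique h2
  · rw [fderiv_zero_of_not_differentiableAt hd]
    rfl


/-- The flat seam primitive `Φ̂ · b̂` as a `1`-form on `ℝ⁴` (`genFoldPrimitive`). [folklore] -/
def flatSeamPrimitive (β : MForm (𝓡 3) H ℝ 1) (Φ : H × ℝ → ℝ) (h₀ : H) :
    MForm (𝓡 4) (EuclideanSpace ℝ (Fin 4)) ℝ 1 := fun u =>
  genFoldPrimitive (flatProfile Φ h₀) (flatSliceCovector β h₀) u

omit [IsManifold (𝓡 3) ∞ H] in
/-- Unfolding `flatSeamPrimitive`. [folklore] -/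
@[simp]
theorem flatSeamPrimitive_apply (β : MForm (𝓡 3) H ℝ 1) (Φ : H × ℝ → ℝ) (h₀ : H)
    (u : EuclideanSpace ℝ (Fin 4)) :
    flatSeamPrimitive β Φ h₀ u = genFoldPrimitive (flatProfile Φ h₀) (flatSliceCovector β h₀) u :=
  rfl

omit [IsManifold (𝓡 3) ∞ H] in
/-- `d` of the flat seam primitive is the general fold model. [folklore] -/
theorem mextDeriv_flatSeamPrimitive (β : MForm (𝓡 3) H ℝ 1) (Φ : H × ℝ → ℝ) (h₀ : H)
    (u : EuclideanSpace ℝ (Fin 4)) :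
    mextDeriv (flatSeamPrimitive β Φ h₀) u =
      genContactFoldForm (flatProfile Φ h₀) (flatSliceCovector β h₀) u :=
  mextDeriv_eq_extDeriv _ u

/-! #### The product chart and the representative of the seam primitive -/

/-- The product chart of `H × ℝ` at the slice through `h₀`, composed with `consCLE`:
`κ (h, t) = (t, chart_{h₀} h)`. [folklore] -/
def seamChart (h₀ : H) (p : H × ℝ) : EuclideanSpace ℝ (Fin 4) :=
  BoundaryManifold.consCLE 3 (extChartAt (𝓡 3) h₀ p.1, p.2)

/-- The differential of the product chart. [folklore] -/
theorem hasMFDerivAt_seamChart (h₀ : H) {p : H × ℝ}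
    (hp : p.1 ∈ (chartAt (EuclideanSpace ℝ (Fin 3)) h₀).source) :
    HasMFDerivAt ((𝓡 3).prod 𝓘(ℝ, ℝ)) 𝓘(ℝ, EuclideanSpace ℝ (Fin 4)) (seamChart h₀) p
      ((BoundaryManifold.consCLE 3 :
          (EuclideanSpace ℝ (Fin 3) × ℝ) →L[ℝ] EuclideanSpace ℝ (Fin 4)).comp
        (((mfderiv (𝓡 3) 𝓘(ℝ, EuclideanSpace ℝ (Fin 3)) (extChartAt (𝓡 3) h₀) p.1).comp
            (ContinuousLinearMap.fst ℝ (EuclideanSpace ℝ (Fin 3)) ℝ)).prod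
          (ContinuousLinearMap.snd ℝ (EuclideanSpace ℝ (Fin 3)) ℝ))) := by
  have h1 : HasMFDerivAt ((𝓡 3).prod 𝓘(ℝ, ℝ)) 𝓘(ℝ, EuclideanSpace ℝ (Fin 3))
      (fun q : H × ℝ => extChartAt (𝓡 3) h₀ q.1) p
      ((mfderiv (𝓡 3) 𝓘(ℝ, EuclideanSpace ℝ (Fin 3)) (extChartAt (𝓡 3) h₀) p.1).comp
        (ContinuousLinearMap.fst ℝ (EuclideanSpace ℝ (Fin 3)) ℝ)) :=
    (hasMFDerivAt_extChartAt (I := 𝓡 3) hp).comp p (hasMFDerivAt_fst p)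
  have h2 : HasMFDerivAt ((𝓡 3).prod 𝓘(ℝ, ℝ)) 𝓘(ℝ, ℝ) (fun q : H × ℝ => q.2) p
      (ContinuousLinearMap.snd ℝ (EuclideanSpace ℝ (Fin 3)) ℝ) := hasMFDerivAt_snd p
  have h3 : HasMFDerivAt ((𝓡 3).prod 𝓘(ℝ, ℝ)) 𝓘(ℝ, EuclideanSpace ℝ (Fin 3) × ℝ)
      (fun q : H × ℝ => (extChartAt (𝓡 3) h₀ q.1, q.2)) p
      (((mfderiv (𝓡 3) 𝓘(ℝ, EuclideanSpace ℝ (Fin 3)) (extChartAt (𝓡 3) h₀) p.1).comp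
          (ContinuousLinearMap.fst ℝ (EuclideanSpace ℝ (Fin 3)) ℝ)).prod
        (ContinuousLinearMap.snd ℝ (EuclideanSpace ℝ (Fin 3)) ℝ)) :=
    ⟨h1.1.prodMk h2.1, h1.2.prodMk h2.2⟩
  have h4 : HasMFDerivAt 𝓘(ℝ, EuclideanSpace ℝ (Fin 3) × ℝ) 𝓘(ℝ, EuclideanSpace ℝ (Fin 4))
      (BoundaryManifold.consCLE 3 : (EuclideanSpace ℝ (Fin 3) × ℝ) → EuclideanSpace ℝ (Fin 4))
      (extChartAt (𝓡 3) h₀ p.1, p.2)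
      (BoundaryManifold.consCLE 3 :
        (EuclideanSpace ℝ (Fin 3) × ℝ) →L[ℝ] EuclideanSpace ℝ (Fin 4)) :=
    hasMFDerivAt_iff_hasFDerivAt.2 (BoundaryManifold.consCLE 3).hasFDerivAt
  exact h4.comp p h3

omit [IsManifold (𝓡 3) ∞ H] in
/-- For the boundaryless model `𝓡 3` the extended chart is the chart. [folklore] -/
theorem extChartAt_R3_eq_chartAt (h₀ : H) :
    (extChartAt (𝓡 3) h₀ : H → EuclideanSpace ℝ (Fin 3)) = chartAt (EuclideanSpace ℝ (Fin 3)) h₀ := by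
  funext y
  rfl

/-- **The seam primitive read in a product chart is the general fold primitive**
`Φ̂ · b̂` (`genFoldPrimitive`): on the slices over the chart domain at `h₀`,
`Λ = κ^*(Φ̂ b̂)` with `κ` the product chart, `Φ̂ = Φ ∘ κ⁻¹` and `b̂` the flat slice covector
field. [cite: Baykur2006, proof of Thm. 6.1] -/
theorem seamPrimitive_eq_pullback_seamChart (β : MForm (𝓡 3) H ℝ 1) (Φ : H × ℝ → ℝ) (h₀ : H)
    {p : H × ℝ} (hp : p.1 ∈ (chartAt (EuclideanSpace ℝ (Fin 3)) h₀).source) :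
    seamPrimitive β Φ p =
      (flatSeamPrimitive β Φ h₀).pullback ((𝓡 3).prod 𝓘(ℝ, ℝ)) (seamChart h₀) p := by
  have hps : p.1 ∈ (extChartAt (𝓡 3) h₀).source := by rwa [extChartAt_source]
  have hκ : seamChart h₀ p = BoundaryManifold.consCLE 3 (extChartAt (𝓡 3) h₀ p.1, p.2) := rfl
  ext v
  rw [MForm.pullback_apply, (hasMFDerivAt_seamChart h₀ hp).mfderiv, seamPrimitive_apply]
  show _ = flatProfile Φ h₀ (seamChart h₀ p) *
    flatSliceCovector β h₀ (seamChart h₀ p)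
      (BoundaryManifold.consCLE 3
        ((mfderiv (𝓡 3) 𝓘(ℝ, EuclideanSpace ℝ (Fin 3)) (extChartAt (𝓡 3) h₀) p.1) (v 0).1,
          (v 0).2))
  have hΦ : flatProfile Φ h₀ (seamChart h₀ p) = Φ p := by
    rw [flatProfile, hκ, sliceTail_consCLE, BoundaryManifold.consCLE_apply_zero,
      (extChartAt (𝓡 3) h₀).left_inv hps]
  have hb : ∀ a : EuclideanSpace ℝ (Fin 3), ∀ r : ℝ,
      flatSliceCovector β h₀ (seamChart h₀ p) (BoundaryManifold.consCLE 3 (a, r)) =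
        β.inChart h₀ (extChartAt (𝓡 3) h₀ p.1) ![a] := fun a r => by
    rw [flatSliceCovector, hκ, sliceTail_consCLE, ContinuousLinearMap.comp_apply,
      sliceTail_consCLE, alt1ToCLM_apply]
  rw [hΦ, hb, inChart_apply_extChartAt β hp]
  have hmf : mfderiv (𝓡 3) 𝓘(ℝ, EuclideanSpace ℝ (Fin 3)) (extChartAt (𝓡 3) h₀) p.1 =
      tangentCoordChange (𝓡 3) p.1 h₀ p.1 := by
    rw [extChartAt_R3_eq_chartAt]
    exact mfderiv_chartAt_eq_tangentCoordChange (I := 𝓡 3) hp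
  have hp3 : p.1 ∈ (extChartAt (𝓡 3) p.1).source ∩ (extChartAt (𝓡 3) h₀).source ∩
      (extChartAt (𝓡 3) p.1).source :=
    ⟨⟨mem_extChartAt_source _, hps⟩, mem_extChartAt_source _⟩
  congr 2
  funext i
  rw [show i = 0 from Subsingleton.elim i 0]
  simp only [Matrix.cons_val_zero]
  have key : ∀ a : EuclideanSpace ℝ (Fin 3), tangentCoordChange (𝓡 3) h₀ p.1 p.1
      (tangentCoordChange (𝓡 3) p.1 h₀ p.1 a) = a := fun a => by
    rw [tangentCoordChange_comp hp3, tangentCoordChange_self (mem_extChartAt_source _)]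
  rw [hmf]
  exact (key _).symm


/-! #### Smoothness of the flat data -/

omit [IsManifold (𝓡 3) ∞ H] in
/-- The open set of `ℝ⁴` over the chart target. [folklore] -/
theorem isOpen_sliceTail_preimage_target (h₀ : H) :
    IsOpen {u : EuclideanSpace ℝ (Fin 4) | sliceTail u ∈ (extChartAt (𝓡 3) h₀).target} :=
  (isOpen_extChartAt_target (I := 𝓡 3) h₀).preimage sliceTail.continuous

omit [IsManifold (𝓡 3) ∞ H] in
/-- The product chart lands over the chart target. [folklore] -/
theorem seamChart_mem_preimage_target (h₀ : H) {p : H × ℝ}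
    (hp : p.1 ∈ (chartAt (EuclideanSpace ℝ (Fin 3)) h₀).source) :
    seamChart h₀ p ∈ {u : EuclideanSpace ℝ (Fin 4) | sliceTail u ∈ (extChartAt (𝓡 3) h₀).target} := by
  show sliceTail (BoundaryManifold.consCLE 3 (extChartAt (𝓡 3) h₀ p.1, p.2)) ∈
    (extChartAt (𝓡 3) h₀).target
  rw [sliceTail_consCLE]
  exact (extChartAt (𝓡 3) h₀).map_source (by rwa [extChartAt_source])

/-- The flat slice covector field of a smooth form is `C^∞` over the chart target. [folklore] -/
theorem contDiffOn_flatSliceCovector {β : MForm (𝓡 3) H ℝ 1} (hβ : IsSmoothForm β) (h₀ : H) :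
    ContDiffOn ℝ ∞ (flatSliceCovector β h₀)
      {u : EuclideanSpace ℝ (Fin 4) | sliceTail u ∈ (extChartAt (𝓡 3) h₀).target} := by
  intro u hu
  have hz : (extChartAt (𝓡 3) h₀).symm (sliceTail u) ∈ (extChartAt (𝓡 3) h₀).source :=
    (extChartAt (𝓡 3) h₀).map_target hu
  have h1 : ContDiffWithinAt ℝ ∞ (β.inChart h₀) (range (𝓡 3))
      (extChartAt (𝓡 3) h₀ ((extChartAt (𝓡 3) h₀).symm (sliceTail u))) :=
    ((isSmoothForm_iff_smoothAt β).1 hβ _).contDiffWithinAt_inChart hz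
  rw [(extChartAt (𝓡 3) h₀).right_inv hu] at h1
  have h2 : ContDiffAt ℝ ∞ (β.inChart h₀) (sliceTail u) := by
    have hr : range (𝓡 3) = univ := ModelWithCorners.Boundaryless.range_eq_univ
    rw [hr] at h1
    exact h1.contDiffAt univ_mem
  have h3 : ContDiffAt ℝ ∞ (fun u : EuclideanSpace ℝ (Fin 4) => β.inChart h₀ (sliceTail u)) u :=
    h2.comp u sliceTail.contDiff.contDiffAt
  have h4 : ContDiffAt ℝ ∞
      (fun u : EuclideanSpace ℝ (Fin 4) => alt1ToCLM (β.inChart h₀ (sliceTail u))) u :=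
    (alt1ToCLM (E := EuclideanSpace ℝ (Fin 3))).contDiff.contDiffAt.comp u h3
  exact (h4.clm_comp contDiffAt_const).contDiffWithinAt

/-- The flat profile of a smooth function is `C^∞` over the chart target. [folklore] -/
theorem contDiffOn_flatProfile {Φ : H × ℝ → ℝ} (hΦ : ContMDiff ((𝓡 3).prod 𝓘(ℝ, ℝ)) 𝓘(ℝ) ∞ Φ)
    (h₀ : H) :
    ContDiffOn ℝ ∞ (flatProfile Φ h₀)
      {u : EuclideanSpace ℝ (Fin 4) | sliceTail u ∈ (extChartAt (𝓡 3) h₀).target} := by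
  have h1 : ContMDiffOn 𝓘(ℝ, EuclideanSpace ℝ (Fin 4)) (𝓡 3) ∞
      (fun u : EuclideanSpace ℝ (Fin 4) => (extChartAt (𝓡 3) h₀).symm (sliceTail u))
      {u | sliceTail u ∈ (extChartAt (𝓡 3) h₀).target} :=
    (contMDiffOn_extChartAt_symm (I := 𝓡 3) (n := ∞) h₀).comp
      sliceTail.contDiff.contMDiff.contMDiffOn (fun u hu => hu)
  have h2 : ContMDiffOn 𝓘(ℝ, EuclideanSpace ℝ (Fin 4)) 𝓘(ℝ, ℝ) ∞
      (fun u : EuclideanSpace ℝ (Fin 4) => u 0) {u | sliceTail u ∈ (extChartAt (𝓡 3) h₀).target} :=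
    ((EuclideanSpace.proj (0 : Fin 4) : EuclideanSpace ℝ (Fin 4) →L[ℝ] ℝ).contDiff.contMDiff).contMDiffOn
  have h3 : ContMDiffOn 𝓘(ℝ, EuclideanSpace ℝ (Fin 4)) ((𝓡 3).prod 𝓘(ℝ, ℝ)) ∞
      (fun u : EuclideanSpace ℝ (Fin 4) => ((extChartAt (𝓡 3) h₀).symm (sliceTail u), u 0))
      {u | sliceTail u ∈ (extChartAt (𝓡 3) h₀).target} := h1.prodMk h2
  have h4 := hΦ.comp_contMDiffOn h3
  exact contMDiffOn_iff_contDiffOn.1 h4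

/-- The product chart is `C^∞` over the chart domain. [folklore] -/
theorem contMDiffAt_seamChart (h₀ : H) {p : H × ℝ}
    (hp : p.1 ∈ (chartAt (EuclideanSpace ℝ (Fin 3)) h₀).source) :
    ContMDiffAt ((𝓡 3).prod 𝓘(ℝ, ℝ)) 𝓘(ℝ, EuclideanSpace ℝ (Fin 4)) ∞ (seamChart h₀) p := by
  have h1 : ContMDiffAt ((𝓡 3).prod 𝓘(ℝ, ℝ)) 𝓘(ℝ, EuclideanSpace ℝ (Fin 3)) ∞
      (fun q : H × ℝ => extChartAt (𝓡 3) h₀ q.1) p :=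
    (contMDiffAt_extChartAt' (I := 𝓡 3) (n := ∞) hp).comp p contMDiffAt_fst
  have h2 : ContMDiffAt ((𝓡 3).prod 𝓘(ℝ, ℝ)) 𝓘(ℝ, ℝ) ∞ (fun q : H × ℝ => q.2) p :=
    contMDiffAt_snd
  have h3 : ContMDiffAt ((𝓡 3).prod 𝓘(ℝ, ℝ)) 𝓘(ℝ, EuclideanSpace ℝ (Fin 3) × ℝ) ∞
      (fun q : H × ℝ => (extChartAt (𝓡 3) h₀ q.1, q.2)) p := h1.prodMk_space h2
  exact (BoundaryManifold.consCLE 3).contDiff.contMDiff.contMDiffAt.comp p h3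

/-- The eventual form of the representative identity. [folklore] -/
theorem seamPrimitive_eventuallyEq_pullback (β : MForm (𝓡 3) H ℝ 1) (Φ : H × ℝ → ℝ) (h₀ : H)
    {p : H × ℝ} (hp : p.1 ∈ (chartAt (EuclideanSpace ℝ (Fin 3)) h₀).source) :
    ∀ᶠ q in 𝓝 p, seamPrimitive β Φ q =
      (flatSeamPrimitive β Φ h₀).pullback ((𝓡 3).prod 𝓘(ℝ, ℝ)) (seamChart h₀) q := by
  have ho : IsOpen ((chartAt (EuclideanSpace ℝ (Fin 3)) h₀).source ×ˢ (univ : Set ℝ)) :=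
    (chartAt _ h₀).open_source.prod isOpen_univ
  filter_upwards [ho.mem_nhds ⟨hp, mem_univ _⟩] with q hq
  exact seamPrimitive_eq_pullback_seamChart β Φ h₀ hq.1

/-- **The seam form `dΛ` read in a product chart is the general fold model `d(Φ̂ b̂)`**, pulled
back along the product chart. [cite: Baykur2006, proof of Thm. 6.1] -/
theorem mextDeriv_seamPrimitive_eq_pullback {β : MForm (𝓡 3) H ℝ 1} (hβ : IsSmoothForm β)
    {Φ : H × ℝ → ℝ} (hΦ : ContMDiff ((𝓡 3).prod 𝓘(ℝ, ℝ)) 𝓘(ℝ) ∞ Φ) (h₀ : H) {p : H × ℝ}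
    (hp : p.1 ∈ (chartAt (EuclideanSpace ℝ (Fin 3)) h₀).source) :
    mextDeriv (seamPrimitive β Φ) p =
      (genContactFoldForm (flatProfile Φ h₀) (flatSliceCovector β h₀)).pullback
        ((𝓡 3).prod 𝓘(ℝ, ℝ)) (seamChart h₀) p := by
  refine (Literature.Geometry.Kaehler.mextDeriv_congr_of_eventuallyEq
    (seamPrimitive_eventuallyEq_pullback β Φ h₀ hp)).trans ?_
  have hO := isOpen_sliceTail_preimage_target (H := H) h₀
  have hκ : ∀ᶠ q in 𝓝 p, ContMDiffAt ((𝓡 3).prod 𝓘(ℝ, ℝ)) (𝓡 4) ∞ (seamChart h₀) q := by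
    have ho : IsOpen ((chartAt (EuclideanSpace ℝ (Fin 3)) h₀).source ×ˢ (univ : Set ℝ)) :=
      (chartAt _ h₀).open_source.prod isOpen_univ
    filter_upwards [ho.mem_nhds ⟨hp, mem_univ _⟩] with q hq
    exact contMDiffAt_seamChart h₀ hq.1
  have hτ : (flatSeamPrimitive β Φ h₀).SmoothAt (seamChart h₀ p) := by
    refine (MForm.smoothAt_model_iff _ _).2 ?_
    have hlam : ContDiffOn ℝ ∞ (genFoldPrimitive (flatProfile Φ h₀) (flatSliceCovector β h₀))
        {u : EuclideanSpace ℝ (Fin 4) | sliceTail u ∈ (extChartAt (𝓡 3) h₀).target} :=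
      (contDiffOn_flatProfile hΦ h₀).smul
        (covectorToOneForm.toContinuousLinearEquiv.contDiff.comp_contDiffOn
          (contDiffOn_flatSliceCovector hβ h₀))
    exact hlam.contDiffAt (hO.mem_nhds (seamChart_mem_preimage_target h₀ hp))
  rw [mextDeriv_pullback_apply hκ hτ]
  congr 1
  funext u
  exact mextDeriv_flatSeamPrimitive β Φ h₀ u

end SeamModel


/-! ### The Liouville open collar of a Stein domain, read on the seam piece

For a compact Stein domain `W` with boundary datum `b` (`b.carrier ≅ ∂W`), the long open collar
`CM = Γ.openCollar b` of the Liouville flow-out (`OpenCollarExistence.lean`) is the map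
`(x, s) ↦ Fl (incl x) (a s / (1 + s))` on `∂W × [0, ∞)`.  Along it the Liouville form pulls
back to a form with no `ds`-component and proportional, with a positive factor, to the slice
form of `β₀ = incl^*λ`; and its exterior derivative (the pulled-back Kähler form) is
non-degenerate for `s > 0`. -/

section LiouvilleCollar

namespace SteinStructure

variable {W : Type*} [TopologicalSpace W] [ChartedSpace (EuclideanHalfSpace 4) W]
  [IsManifold (𝓡∂ 4) ∞ W] [CompactSpace W] [T2Space W] (S : SteinStructure W)
  {c₀ c₁ : ℝ} {hc : c₀ < c₁} {hc₁ : c₁ < sSup (range S.φ)}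
  {hreg : ∀ x, c₀ ≤ S.φ x → S.dφ x ≠ 0} {D : FlowoutInput 3 W}
  (hD : D = S.liouvilleFlowout hc hc₁ hreg) (Γ : D.Cover)
  (b : BoundaryData (𝓡∂ 4) W (𝓡 3)) [Nonempty b.carrier]

omit [CompactSpace W] in
/-- Unfolding the long open collar of a flow-out (definitional). [folklore] -/
theorem openCollar_toFun_apply (x : b.carrier) (s : ℝ) :
    (Γ.openCollar b).toFun x s = Γ.Fl (b.incl x) (collarStretch Γ.a s) := rfl

/-- The derivative of the stretching function `s ↦ a s / (1 + s)` at `s > -1` is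
`a / (1 + s)²`. [folklore] -/
theorem hasDerivAt_collarStretch (a : ℝ) {s : ℝ} (hs : -1 < s) :
    HasDerivAt (collarStretch a) (a / (1 + s) ^ 2) s := by
  have h1 : HasDerivAt (fun s : ℝ => a * s) a s := by simpa using (hasDerivAt_id s).const_mul a
  have h2 : HasDerivAt (fun s : ℝ => 1 + s) 1 s := by simpa using (hasDerivAt_id s).const_add 1
  have hne : (1 + s) ≠ 0 := by linarith
  have h := h1.div h2 hne
  have heq : (a * (1 + s) - a * s * 1) / (1 + s) ^ 2 = a / (1 + s) ^ 2 := by ring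
  rw [heq] at h
  exact h

include hD in
/-- **The slices of the Liouville collar**: for fixed `s ≥ 0` the map `x ↦ CM (x, s)` is
differentiable, with differential `L ∘ d(incl)` where `L` (the differential of the flow-out
`Fl(·, a s/(1+s))` at `incl x`) preserves `dφ` and rescales the contact form by a positive
factor. [cite: CieliebakEliashberg2012, §2 and §11.1] -/
theorem exists_hasMFDerivAt_openCollar_slice (x : b.carrier) {s : ℝ} (hs : 0 ≤ s) :
    ∃ L : EuclideanSpace ℝ (Fin 4) →L[ℝ] EuclideanSpace ℝ (Fin 4),
      HasMFDerivAt (𝓡 3) (𝓡∂ 4) (fun x' => (Γ.openCollar b).toFun x' s) x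
        (L.comp (mfderiv (𝓡 3) (𝓡∂ 4) b.incl x)) ∧
      (∀ v, S.dφ ((Γ.openCollar b).toFun x s) (L v) = S.dφ (b.incl x) v) ∧
      ∃ m : ℝ, 0 < m ∧
        ∀ v, S.contactForm ((Γ.openCollar b).toFun x s) (L v) = m * S.contactForm (b.incl x) v := by
  have hz : D.f (b.incl x) < Γ.a := by rw [D.f_incl b x]; exact Γ.a_pos
  have ht : collarStretch Γ.a s ∈ Icc 0 Γ.a := collarStretch_mem_Icc Γ.a_pos hs
  obtain ⟨L, hL, hdφ, m, hm, hlam⟩ := S.exists_hasMFDerivAt_Fl_transport hD Γ hz ht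
  have hincl : HasMFDerivAt (𝓡 3) (𝓡∂ 4) b.incl x (mfderiv (𝓡 3) (𝓡∂ 4) b.incl x) :=
    (b.isSmoothEmbedding.contMDiff.mdifferentiableAt (by simp) (x := x)).hasMFDerivAt
  exact ⟨L, hL.comp x hincl, hdφ, m, hm, hlam⟩

omit [CompactSpace W] in
/-- **The rays of the Liouville collar**: for fixed `x` the map `s ↦ CM (x, s)` is, at `s > 0`,
differentiable with velocity a multiple of the flow-out field `ξ` (an integral curve,
reparametrised by the stretching function). [folklore] -/
theorem hasMFDerivAt_openCollar_ray (x : b.carrier) {s : ℝ} (hs : 0 < s) :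
    HasMFDerivAt 𝓘(ℝ, ℝ) (𝓡∂ 4) (fun s' => (Γ.openCollar b).toFun x s') s
      (((1 : ℝ →L[ℝ] ℝ).smulRight (D.ξ ((Γ.openCollar b).toFun x s))).comp
        ((1 : ℝ →L[ℝ] ℝ).smulRight (Γ.a / (1 + s) ^ 2))) := by
  have hz : D.f (b.incl x) ≤ Γ.a := by rw [D.f_incl b x]; exact Γ.a_pos.le
  have ht : collarStretch Γ.a s ∈ Icc (-D.f (b.incl x)) Γ.a := by
    rw [D.f_incl b x, neg_zero]; exact collarStretch_mem_Icc Γ.a_pos hs.le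
  have hint : Icc (-D.f (b.incl x)) Γ.a ∈ 𝓝 (collarStretch Γ.a s) := by
    rw [D.f_incl b x, neg_zero]
    refine Icc_mem_nhds ?_ (collarStretch_lt Γ.a_pos hs.le)
    have : 0 < Γ.a * s / (1 + s) := div_pos (mul_pos Γ.a_pos hs) (by linarith)
    exact this
  have h1 : HasMFDerivAt 𝓘(ℝ, ℝ) (𝓡∂ 4) (Γ.Fl (b.incl x)) (collarStretch Γ.a s)
      ((1 : ℝ →L[ℝ] ℝ).smulRight (D.ξ (Γ.Fl (b.incl x) (collarStretch Γ.a s)))) :=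
    (Γ.isMIntegralCurveOn_Fl hz _ ht).hasMFDerivAt hint
  have h2 : HasMFDerivAt 𝓘(ℝ, ℝ) 𝓘(ℝ, ℝ) (collarStretch Γ.a) s
      ((1 : ℝ →L[ℝ] ℝ).smulRight (Γ.a / (1 + s) ^ 2)) :=
    hasMFDerivAt_iff_hasFDerivAt.2 (hasDerivAt_collarStretch Γ.a (by linarith)).hasFDerivAt
  exact h1.comp s h2

omit [CompactSpace W] in
/-- The uncurried open collar is `C^∞` at the points of `∂W × (0, ∞)`. [folklore] -/
theorem contMDiffAt_uncurry_openCollar (x : b.carrier) {s : ℝ} (hs : 0 < s) :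
    ContMDiffAt ((𝓡 3).prod 𝓘(ℝ, ℝ)) (𝓡∂ 4) ∞ (uncurry (Γ.openCollar b).toFun) (x, s) := by
  have hmem : (univ : Set b.carrier) ×ˢ Ici (0 : ℝ) ∈ 𝓝 (x, s) :=
    prod_mem_nhds univ_mem (Ici_mem_nhds hs)
  exact ((Γ.openCollar b).contMDiffOn_toFun (x, s) ⟨mem_univ _, hs.le⟩).contMDiffAt hmem

include hD in
/-- **The differential of the Liouville collar** at a point `(x, s)`, `s > 0`, splits as the
slice differential on the `∂W`-component plus the ray velocity on the `ℝ`-component.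
[folklore] -/
theorem exists_mfderiv_uncurry_openCollar (x : b.carrier) {s : ℝ} (hs : 0 < s) :
    ∃ L : EuclideanSpace ℝ (Fin 4) →L[ℝ] EuclideanSpace ℝ (Fin 4),
      (∀ (v : EuclideanSpace ℝ (Fin 3)) (r : ℝ),
        mfderiv ((𝓡 3).prod 𝓘(ℝ, ℝ)) (𝓡∂ 4) (uncurry (Γ.openCollar b).toFun) (x, s) (v, r) =
          L (mfderiv (𝓡 3) (𝓡∂ 4) b.incl x v) +
            (r * (Γ.a / (1 + s) ^ 2)) •
              (ContinuousLinearMap.id ℝ (EuclideanSpace ℝ (Fin 4)))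
                (D.ξ ((Γ.openCollar b).toFun x s))) ∧
      (∀ v, S.dφ ((Γ.openCollar b).toFun x s) (L v) = S.dφ (b.incl x) v) ∧
      ∃ m : ℝ, 0 < m ∧
        ∀ v, S.contactForm ((Γ.openCollar b).toFun x s) (L v) = m * S.contactForm (b.incl x) v := by
  obtain ⟨L, hL, hdφ, m, hm, hlam⟩ := S.exists_hasMFDerivAt_openCollar_slice hD Γ b x hs.le
  have hray := hasMFDerivAt_openCollar_ray Γ b x hs
  have hdiff : MDifferentiableAt ((𝓡 3).prod 𝓘(ℝ, ℝ)) (𝓡∂ 4) (uncurry (Γ.openCollar b).toFun)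
      (x, s) := (contMDiffAt_uncurry_openCollar Γ b x hs).mdifferentiableAt (by simp)
  refine ⟨L, fun v r => ?_, hdφ, m, hm, hlam⟩
  rw [mfderiv_prod_eq_add_comp hdiff]
  have e1 : mfderiv (𝓡 3) (𝓡∂ 4) (fun z : b.carrier => uncurry (Γ.openCollar b).toFun (z, s)) x =
      L.comp (mfderiv (𝓡 3) (𝓡∂ 4) b.incl x) := hL.mfderiv
  have e2 : mfderiv 𝓘(ℝ, ℝ) (𝓡∂ 4) (fun s' : ℝ => uncurry (Γ.openCollar b).toFun (x, s')) s =
      (((1 : ℝ →L[ℝ] ℝ).smulRight (D.ξ ((Γ.openCollar b).toFun x s))).comp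
        ((1 : ℝ →L[ℝ] ℝ).smulRight (Γ.a / (1 + s) ^ 2))) :=
    hray.mfderiv
  show mfderiv (𝓡 3) (𝓡∂ 4) (fun z : b.carrier => uncurry (Γ.openCollar b).toFun (z, s)) x v +
      mfderiv 𝓘(ℝ, ℝ) (𝓡∂ 4) (fun s' : ℝ => uncurry (Γ.openCollar b).toFun (x, s')) s r = _
  rw [e1, e2]
  rfl

include hD in
/-- **The Liouville form along the collar**: for `s > 0` there is `m > 0` with
`(CM^*λ)_{(x,s)}(v, r) = m · (incl^*λ)_x(v)` — no `ds`-component (`λ(ξ) = 0`) and positively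
proportional to the slice form of `β₀ = incl^*λ` (conformal transport of `λ` along the
Liouville flow). [cite: CieliebakEliashberg2012, §2 and §11.1] -/
theorem exists_liouvilleForm_pullback_openCollar_apply (x : b.carrier) {s : ℝ} (hs : 0 < s) :
    ∃ m : ℝ, 0 < m ∧ ∀ (v : EuclideanSpace ℝ (Fin 3)) (r : ℝ),
      ((-dComplex S.J S.φ).pullback ((𝓡 3).prod 𝓘(ℝ, ℝ)) (uncurry (Γ.openCollar b).toFun))
          (x, s) ![(v, r)] =
        m * ((-dComplex S.J S.φ).pullback (𝓡 3) b.incl) x ![v] := by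
  obtain ⟨L, hL, -, m, hm, hlam⟩ := S.exists_mfderiv_uncurry_openCollar hD Γ b x hs
  refine ⟨m, hm, fun v r => ?_⟩
  have key1 : ((-dComplex S.J S.φ).pullback ((𝓡 3).prod 𝓘(ℝ, ℝ)) (uncurry (Γ.openCollar b).toFun))
      (x, s) ![(v, r)] = S.contactForm ((Γ.openCollar b).toFun x s)
        (mfderiv ((𝓡 3).prod 𝓘(ℝ, ℝ)) (𝓡∂ 4) (uncurry (Γ.openCollar b).toFun) (x, s) (v, r)) := by
    rw [MForm.pullback_apply, ← S.liouvilleForm_apply]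
    congr 1
    funext i
    fin_cases i
    rfl
  have key2 := (liouvilleForm_pullback S b.isSmoothEmbedding.contMDiff).2.1 x v
  rw [key1, key2]
  have hξ : S.contactForm ((Γ.openCollar b).toFun x s) (D.ξ ((Γ.openCollar b).toFun x s)) = 0 := by
    subst hD
    rw [liouvilleFlowout_ξ]
    exact S.contactForm_cutLiouvilleVF c₀ c₁ _
  have hsum : S.contactForm ((Γ.openCollar b).toFun x s)
      (L (mfderiv (𝓡 3) (𝓡∂ 4) b.incl x v) + (r * (Γ.a / (1 + s) ^ 2)) •
        (ContinuousLinearMap.id ℝ (EuclideanSpace ℝ (Fin 4))) (D.ξ ((Γ.openCollar b).toFun x s))) =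
      m * S.contactForm (b.incl x) (mfderiv (𝓡 3) (𝓡∂ 4) b.incl x v) := by
    rw [map_add, map_smul, hlam, ContinuousLinearMap.id_apply, hξ, smul_zero, add_zero]
  rw [← hsum]
  exact congrArg (S.contactForm ((Γ.openCollar b).toFun x s)) (hL v r)

omit [CompactSpace W] in
/-- **The differential of the open collar is injective** at the points of `∂W × (0, ∞)`: the
collar has the smooth left inverse `(proj, height)` on its (open) region. [folklore] -/
theorem injective_mfderiv_uncurry_openCollar (x : b.carrier) {s : ℝ} (hs : 0 < s) :
    Injective (mfderiv ((𝓡 3).prod 𝓘(ℝ, ℝ)) (𝓡∂ 4) (uncurry (Γ.openCollar b).toFun) (x, s)) := by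
  set C := Γ.openCollar b with hC
  have hF : ContMDiffAt ((𝓡 3).prod 𝓘(ℝ, ℝ)) (𝓡∂ 4) ∞ (uncurry C.toFun) (x, s) :=
    contMDiffAt_uncurry_openCollar Γ b x hs
  have hreg : C.toFun x s ∈ C.region := C.mem_region x s hs.le
  have hG : ContMDiffAt (𝓡∂ 4) ((𝓡 3).prod 𝓘(ℝ, ℝ)) ∞ C.projHeight (uncurry C.toFun (x, s)) :=
    (C.contMDiffOn_projHeight _ hreg).contMDiffAt (C.isOpen_region.mem_nhds hreg)
  have hev : (C.projHeight ∘ uncurry C.toFun) =ᶠ[𝓝 (x, s)] id := by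
    have ho : IsOpen ((univ : Set b.carrier) ×ˢ Ioi (0 : ℝ)) := isOpen_univ.prod isOpen_Ioi
    filter_upwards [ho.mem_nhds ⟨mem_univ _, hs⟩] with q hq
    exact C.projHeight_apply_toFun q.1 (le_of_lt hq.2)
  have hcomp : mfderiv ((𝓡 3).prod 𝓘(ℝ, ℝ)) ((𝓡 3).prod 𝓘(ℝ, ℝ)) (C.projHeight ∘ uncurry C.toFun)
      (x, s) = (mfderiv (𝓡∂ 4) ((𝓡 3).prod 𝓘(ℝ, ℝ)) C.projHeight (uncurry C.toFun (x, s))).comp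
        (mfderiv ((𝓡 3).prod 𝓘(ℝ, ℝ)) (𝓡∂ 4) (uncurry C.toFun) (x, s)) :=
    mfderiv_comp (x, s) (hG.mdifferentiableAt (by simp)) (hF.mdifferentiableAt (by simp))
  have hid : mfderiv ((𝓡 3).prod 𝓘(ℝ, ℝ)) ((𝓡 3).prod 𝓘(ℝ, ℝ)) (C.projHeight ∘ uncurry C.toFun)
      (x, s) = ContinuousLinearMap.id ℝ _ := by
    rw [hev.mfderiv_eq, mfderiv_id]
  intro V₁ V₂ h
  have h' := congrArg (mfderiv (𝓡∂ 4) ((𝓡 3).prod 𝓘(ℝ, ℝ)) C.projHeight (uncurry C.toFun (x, s))) h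
  have e : ∀ V, mfderiv (𝓡∂ 4) ((𝓡 3).prod 𝓘(ℝ, ℝ)) C.projHeight (uncurry C.toFun (x, s))
      (mfderiv ((𝓡 3).prod 𝓘(ℝ, ℝ)) (𝓡∂ 4) (uncurry C.toFun) (x, s) V) = V := fun V => by
    have := congrArg (fun T : (EuclideanSpace ℝ (Fin 3) × ℝ) →L[ℝ] (EuclideanSpace ℝ (Fin 3) × ℝ)
      => T V) (hcomp.symm.trans hid)
    exact this
  rwa [e, e] at h'

/-- **The pulled-back Kähler form along the collar is non-degenerate** at the points of
`∂W × (0, ∞)`: `d(CM^*λ) = CM^*ω` there (naturality of `d`), the differential of the collar is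
a linear isomorphism `ℝ³ × ℝ ≅ T_zW`, and `ω(u, Ju) > 0` for `u ≠ 0`. [folklore] -/
theorem exists_mextDeriv_liouvilleForm_pullback_openCollar_ne_zero (x : b.carrier) {s : ℝ}
    (hs : 0 < s) {V : EuclideanSpace ℝ (Fin 3) × ℝ} (hV : V ≠ 0) :
    ∃ V' : EuclideanSpace ℝ (Fin 3) × ℝ,
      mextDeriv ((-dComplex S.J S.φ).pullback ((𝓡 3).prod 𝓘(ℝ, ℝ)) (uncurry (Γ.openCollar b).toFun))
        (x, s) ![V, V'] ≠ 0 := by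
  set C := Γ.openCollar b with hC
  set DF : (EuclideanSpace ℝ (Fin 3) × ℝ) →L[ℝ] EuclideanSpace ℝ (Fin 4) :=
    mfderiv ((𝓡 3).prod 𝓘(ℝ, ℝ)) (𝓡∂ 4) (uncurry C.toFun) (x, s) with hDF
  have hinj : Injective DF := injective_mfderiv_uncurry_openCollar Γ b x hs
  -- `DF` is onto (injective between spaces of dimension `4`)
  have hsurj : Surjective DF := by
    have hdim : Module.finrank ℝ (EuclideanSpace ℝ (Fin 3) × ℝ) =
        Module.finrank ℝ (EuclideanSpace ℝ (Fin 4)) := by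
      rw [Module.finrank_prod, finrank_euclideanSpace, finrank_euclideanSpace, Module.finrank_self]
      simp
    have h := (LinearMap.injective_iff_surjective_of_finrank_eq_finrank hdim
      (f := DF.toLinearMap)).1 hinj
    exact h
  have hu : DF V ≠ 0 := fun h => hV (hinj (h.trans (map_zero DF).symm))
  obtain ⟨V', hV'⟩ := hsurj (S.J (C.toFun x s) (DF V))
  refine ⟨V', ?_⟩
  have hFev : ∀ᶠ q in 𝓝 (x, s), ContMDiffAt ((𝓡 3).prod 𝓘(ℝ, ℝ)) (𝓡∂ 4) ∞ (uncurry C.toFun) q := by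
    have ho : IsOpen ((univ : Set b.carrier) ×ˢ Ioi (0 : ℝ)) := isOpen_univ.prod isOpen_Ioi
    filter_upwards [ho.mem_nhds ⟨mem_univ _, hs⟩] with q hq
    exact contMDiffAt_uncurry_openCollar Γ b q.1 hq.2
  rw [mextDeriv_pullback_apply hFev (S.isSmoothForm_liouvilleForm _), MForm.pullback_apply]
  have hvec : (fun i => mfderiv ((𝓡 3).prod 𝓘(ℝ, ℝ)) (𝓡∂ 4) (uncurry C.toFun) (x, s)
      ((![V, V'] : Fin 2 → EuclideanSpace ℝ (Fin 3) × ℝ) i)) = ![DF V, DF V'] := by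
    funext i
    fin_cases i <;> rfl
  show mextDeriv (-dComplex S.J S.φ) (uncurry C.toFun (x, s)) (fun i => mfderiv ((𝓡 3).prod 𝓘(ℝ, ℝ))
    (𝓡∂ 4) (uncurry C.toFun) (x, s) ((![V, V'] : Fin 2 → EuclideanSpace ℝ (Fin 3) × ℝ) i)) ≠ 0
  rw [hvec]
  have hval : mextDeriv (-dComplex S.J S.φ) (C.toFun x s) ![DF V, DF V'] =
      S.kahlerForm (C.toFun x s) (DF V) (DF V') := S.mextDeriv_liouvilleForm_apply _ _ _
  refine hval.trans_ne ?_
  rw [hV']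
  exact (S.kahlerForm_self_J_pos (C.toFun x s) hu).ne'

end SteinStructure

end LiouvilleCollar


/-! ### Forms on the seam piece read in the product charts

Any form `α` on `H × ℝ` is, over the chart domain at `h₀`, the pull-back along the product
chart `κ = seamChart h₀` of its **flat representative** `flatRep α h₀ = (κ⁻¹)^*α`, a form on
`ℝ⁴`; smoothness and `d` are compatible with this passage. -/

section FlatRep

variable {H : Type*} [TopologicalSpace H] [ChartedSpace (EuclideanSpace ℝ (Fin 3)) H]

/-- The inverse product chart `κ⁻¹ u = (chart⁻¹ (tail u), u₀)`. [folklore] -/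
def seamChartInv (h₀ : H) (u : EuclideanSpace ℝ (Fin 4)) : H × ℝ :=
  ((extChartAt (𝓡 3) h₀).symm (sliceTail u), u 0)

/-- `consCLE (tail u, u₀) = u`. [folklore] -/
theorem consCLE_sliceTail (u : EuclideanSpace ℝ (Fin 4)) :
    BoundaryManifold.consCLE 3 (sliceTail u, u 0) = u := by
  have h : (sliceTail u, u 0) = (BoundaryManifold.consCLE 3).symm u := Prod.ext rfl rfl
  rw [h, ContinuousLinearEquiv.apply_symm_apply]

/-- `κ⁻¹ ∘ κ = id` over the chart domain. [folklore] -/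
theorem seamChartInv_seamChart (h₀ : H) {p : H × ℝ}
    (hp : p.1 ∈ (chartAt (EuclideanSpace ℝ (Fin 3)) h₀).source) :
    seamChartInv h₀ (seamChart h₀ p) = p := by
  have hps : p.1 ∈ (extChartAt (𝓡 3) h₀).source := by rwa [extChartAt_source]
  show ((extChartAt (𝓡 3) h₀).symm
      (sliceTail (BoundaryManifold.consCLE 3 (extChartAt (𝓡 3) h₀ p.1, p.2))),
    BoundaryManifold.consCLE 3 (extChartAt (𝓡 3) h₀ p.1, p.2) 0) = p
  rw [sliceTail_consCLE, BoundaryManifold.consCLE_apply_zero, (extChartAt (𝓡 3) h₀).left_inv hps]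

/-- `κ ∘ κ⁻¹ = id` over the chart target. [folklore] -/
theorem seamChart_seamChartInv (h₀ : H) {u : EuclideanSpace ℝ (Fin 4)}
    (hu : sliceTail u ∈ (extChartAt (𝓡 3) h₀).target) :
    seamChart h₀ (seamChartInv h₀ u) = u := by
  show BoundaryManifold.consCLE 3
    (extChartAt (𝓡 3) h₀ ((extChartAt (𝓡 3) h₀).symm (sliceTail u)), u 0) = u
  rw [(extChartAt (𝓡 3) h₀).right_inv hu, consCLE_sliceTail]

variable [IsManifold (𝓡 3) ∞ H]

/-- The inverse product chart is `C^∞` over the chart target. [folklore] -/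
theorem contMDiffOn_seamChartInv (h₀ : H) :
    ContMDiffOn 𝓘(ℝ, EuclideanSpace ℝ (Fin 4)) ((𝓡 3).prod 𝓘(ℝ, ℝ)) ∞ (seamChartInv h₀)
      {u : EuclideanSpace ℝ (Fin 4) | sliceTail u ∈ (extChartAt (𝓡 3) h₀).target} := by
  have h1 : ContMDiffOn 𝓘(ℝ, EuclideanSpace ℝ (Fin 4)) (𝓡 3) ∞
      (fun u : EuclideanSpace ℝ (Fin 4) => (extChartAt (𝓡 3) h₀).symm (sliceTail u))
      {u | sliceTail u ∈ (extChartAt (𝓡 3) h₀).target} :=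
    (contMDiffOn_extChartAt_symm (I := 𝓡 3) (n := ∞) h₀).comp
      sliceTail.contDiff.contMDiff.contMDiffOn (fun u hu => hu)
  have h2 : ContMDiffOn 𝓘(ℝ, EuclideanSpace ℝ (Fin 4)) 𝓘(ℝ, ℝ) ∞
      (fun u : EuclideanSpace ℝ (Fin 4) => u 0) {u | sliceTail u ∈ (extChartAt (𝓡 3) h₀).target} :=
    ((EuclideanSpace.proj (0 : Fin 4) : EuclideanSpace ℝ (Fin 4) →L[ℝ] ℝ).contDiff.contMDiff).contMDiffOn
  exact h1.prodMk h2

/-- `κ⁻¹` is `C^∞` near every point over the chart target (eventual form). [folklore] -/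
theorem eventually_contMDiffAt_seamChartInv (h₀ : H) {u : EuclideanSpace ℝ (Fin 4)}
    (hu : sliceTail u ∈ (extChartAt (𝓡 3) h₀).target) :
    ∀ᶠ u' in 𝓝 u, ContMDiffAt 𝓘(ℝ, EuclideanSpace ℝ (Fin 4)) ((𝓡 3).prod 𝓘(ℝ, ℝ)) ∞
      (seamChartInv h₀) u' := by
  have hO := isOpen_sliceTail_preimage_target (H := H) h₀
  filter_upwards [hO.mem_nhds hu] with u' hu'
  exact (contMDiffOn_seamChartInv h₀ u' hu').contMDiffAt (hO.mem_nhds hu')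

/-- The differential of the inverse product chart. [folklore] -/
theorem hasMFDerivAt_seamChartInv (h₀ : H) {u : EuclideanSpace ℝ (Fin 4)}
    (hu : sliceTail u ∈ (extChartAt (𝓡 3) h₀).target) :
    HasMFDerivAt 𝓘(ℝ, EuclideanSpace ℝ (Fin 4)) ((𝓡 3).prod 𝓘(ℝ, ℝ)) (seamChartInv h₀) u
      (((mfderivWithin 𝓘(ℝ, EuclideanSpace ℝ (Fin 3)) (𝓡 3) (extChartAt (𝓡 3) h₀).symm
            (range (𝓡 3)) (sliceTail u)).comp sliceTail).prod
        (EuclideanSpace.proj (0 : Fin 4) : EuclideanSpace ℝ (Fin 4) →L[ℝ] ℝ)) := by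
  have hr : range (𝓡 3) = univ := ModelWithCorners.Boundaryless.range_eq_univ
  have h0 : HasMFDerivAt 𝓘(ℝ, EuclideanSpace ℝ (Fin 3)) (𝓡 3) (extChartAt (𝓡 3) h₀).symm (sliceTail u)
      (mfderivWithin 𝓘(ℝ, EuclideanSpace ℝ (Fin 3)) (𝓡 3) (extChartAt (𝓡 3) h₀).symm
        (range (𝓡 3)) (sliceTail u)) := by
    have h := (mdifferentiableWithinAt_extChartAt_symm (I := 𝓡 3) hu).hasMFDerivWithinAt
    exact h.hasMFDerivAt (by rw [hr]; exact univ_mem)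
  have h1 : HasMFDerivAt 𝓘(ℝ, EuclideanSpace ℝ (Fin 4)) (𝓡 3)
      (fun u : EuclideanSpace ℝ (Fin 4) => (extChartAt (𝓡 3) h₀).symm (sliceTail u)) u
      ((mfderivWithin 𝓘(ℝ, EuclideanSpace ℝ (Fin 3)) (𝓡 3) (extChartAt (𝓡 3) h₀).symm
        (range (𝓡 3)) (sliceTail u)).comp sliceTail) :=
    h0.comp u (hasMFDerivAt_iff_hasFDerivAt.2 sliceTail.hasFDerivAt)
  have h2 : HasMFDerivAt 𝓘(ℝ, EuclideanSpace ℝ (Fin 4)) 𝓘(ℝ, ℝ) (fun u : EuclideanSpace ℝ (Fin 4) => u 0) u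
      (EuclideanSpace.proj (0 : Fin 4) : EuclideanSpace ℝ (Fin 4) →L[ℝ] ℝ) :=
    hasMFDerivAt_iff_hasFDerivAt.2
      (EuclideanSpace.proj (0 : Fin 4) : EuclideanSpace ℝ (Fin 4) →L[ℝ] ℝ).hasFDerivAt
  exact h1.prodMk h2

/-- **The flat representative** of a form on `H × ℝ` in the product chart at `h₀`:
`(κ⁻¹)^*α`, a form on `ℝ⁴`. [folklore] -/
def flatRep {k : ℕ} (α : MForm ((𝓡 3).prod 𝓘(ℝ, ℝ)) (H × ℝ) ℝ k) (h₀ : H) :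
    MForm (𝓡 4) (EuclideanSpace ℝ (Fin 4)) ℝ k := fun u =>
  (α.pullback 𝓘(ℝ, EuclideanSpace ℝ (Fin 4)) (seamChartInv h₀)) u

omit [IsManifold (𝓡 3) ∞ H] in
/-- Unfolding `flatRep`. [folklore] -/
theorem flatRep_apply {k : ℕ} (α : MForm ((𝓡 3).prod 𝓘(ℝ, ℝ)) (H × ℝ) ℝ k) (h₀ : H)
    (u : EuclideanSpace ℝ (Fin 4)) (w : Fin k → EuclideanSpace ℝ (Fin 4)) :
    flatRep α h₀ u w = α (seamChartInv h₀ u)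
      (fun i => mfderiv 𝓘(ℝ, EuclideanSpace ℝ (Fin 4)) ((𝓡 3).prod 𝓘(ℝ, ℝ)) (seamChartInv h₀) u (w i)) :=
  rfl

omit [IsManifold (𝓡 3) ∞ H] in
/-- `flatRep` is the pull-back along `κ⁻¹` (definitional). [folklore] -/
theorem flatRep_eq_pullback {k : ℕ} (α : MForm ((𝓡 3).prod 𝓘(ℝ, ℝ)) (H × ℝ) ℝ k) (h₀ : H) :
    flatRep α h₀ = α.pullback 𝓘(ℝ, EuclideanSpace ℝ (Fin 4)) (seamChartInv h₀) := rfl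

omit [ChartedSpace (EuclideanSpace ℝ (Fin 3)) H] [IsManifold (𝓡 3) ∞ H] in
/-- Evaluating a form at propositionally equal points. [folklore] -/
theorem MForm.apply_congr_point {E' M' : Type*} [NormedAddCommGroup E'] [NormedSpace ℝ E']
    {H' : Type*} [TopologicalSpace H'] {I' : ModelWithCorners ℝ E' H'} [TopologicalSpace M']
    [ChartedSpace H' M'] {k : ℕ} (α : MForm I' M' ℝ k) {y y' : M'} (e : y = y')
    (w : Fin k → E') : α y w = α y' w := by
  subst e
  rfl

/-- **A form on `H × ℝ` is the pull-back of its flat representative along the product chart**,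
over the chart domain at `h₀`. [folklore] -/
theorem eq_pullback_flatRep {k : ℕ} (α : MForm ((𝓡 3).prod 𝓘(ℝ, ℝ)) (H × ℝ) ℝ k) (h₀ : H)
    {p : H × ℝ} (hp : p.1 ∈ (chartAt (EuclideanSpace ℝ (Fin 3)) h₀).source) :
    α p = (flatRep α h₀).pullback ((𝓡 3).prod 𝓘(ℝ, ℝ)) (seamChart h₀) p := by
  have hps : p.1 ∈ (extChartAt (𝓡 3) h₀).source := by rwa [extChartAt_source]
  have hu : sliceTail (seamChart h₀ p) ∈ (extChartAt (𝓡 3) h₀).target :=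
    seamChart_mem_preimage_target h₀ hp
  have hst : sliceTail (seamChart h₀ p) = extChartAt (𝓡 3) h₀ p.1 := by
    show sliceTail (BoundaryManifold.consCLE 3 (extChartAt (𝓡 3) h₀ p.1, p.2)) = _
    rw [sliceTail_consCLE]
  ext V
  rw [MForm.pullback_apply]
  show α p V = flatRep α h₀ (seamChart h₀ p) (fun i => mfderiv ((𝓡 3).prod 𝓘(ℝ, ℝ))
    𝓘(ℝ, EuclideanSpace ℝ (Fin 4)) (seamChart h₀) p (V i))
  rw [flatRep_apply, MForm.apply_congr_point α (seamChartInv_seamChart h₀ hp)]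
  congr 1
  funext i
  rw [(hasMFDerivAt_seamChart h₀ hp).mfderiv, (hasMFDerivAt_seamChartInv h₀ hu).mfderiv]
  -- the composite of the two differentials is the identity
  set M₁ := mfderiv (𝓡 3) 𝓘(ℝ, EuclideanSpace ℝ (Fin 3)) (extChartAt (𝓡 3) h₀) p.1 with hM₁
  set M₂ := mfderivWithin 𝓘(ℝ, EuclideanSpace ℝ (Fin 3)) (𝓡 3) (extChartAt (𝓡 3) h₀).symm
    (range (𝓡 3)) (sliceTail (seamChart h₀ p)) with hM₂
  have hinv : ∀ v : EuclideanSpace ℝ (Fin 3), M₂ (M₁ v) = v := fun v => by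
    have h := mfderivWithin_extChartAt_symm_comp_mfderiv_extChartAt' (I := 𝓡 3) hps
    have h' := congrArg (fun T : EuclideanSpace ℝ (Fin 3) →L[ℝ] EuclideanSpace ℝ (Fin 3) => T v) h
    rw [hM₂, hst]
    exact h'
  show V i = ((M₂.comp sliceTail).prod (EuclideanSpace.proj (0 : Fin 4)))
    (BoundaryManifold.consCLE 3 ((M₁.comp (ContinuousLinearMap.fst ℝ _ ℝ)).prod
      (ContinuousLinearMap.snd ℝ _ ℝ) (V i)))
  refine Prod.ext ?_ ?_
  · show (V i).1 = M₂ (sliceTail (BoundaryManifold.consCLE 3 (M₁ (V i).1, (V i).2)))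
    rw [sliceTail_consCLE, hinv]
  · show (V i).2 = (BoundaryManifold.consCLE 3 (M₁ (V i).1, (V i).2)) 0
    rw [BoundaryManifold.consCLE_apply_zero]

/-- The flat representative of a form smooth at `κ⁻¹ u` is smooth at `u`. [folklore] -/
theorem smoothAt_flatRep {k : ℕ} {α : MForm ((𝓡 3).prod 𝓘(ℝ, ℝ)) (H × ℝ) ℝ k} (h₀ : H)
    {u : EuclideanSpace ℝ (Fin 4)} (hu : sliceTail u ∈ (extChartAt (𝓡 3) h₀).target)
    (hα : α.SmoothAt (seamChartInv h₀ u)) : (flatRep α h₀).SmoothAt u :=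
  MForm.SmoothAt.pullback (eventually_contMDiffAt_seamChartInv h₀ hu) hα

/-- `d` commutes with the flat representative (naturality of `d` along `κ⁻¹`). [folklore] -/
theorem mextDeriv_flatRep {k : ℕ} {α : MForm ((𝓡 3).prod 𝓘(ℝ, ℝ)) (H × ℝ) ℝ k} (h₀ : H)
    {u : EuclideanSpace ℝ (Fin 4)} (hu : sliceTail u ∈ (extChartAt (𝓡 3) h₀).target)
    (hα : α.SmoothAt (seamChartInv h₀ u)) :
    mextDeriv (flatRep α h₀) u = flatRep (mextDeriv α) h₀ u := by
  rw [flatRep_eq_pullback, flatRep_eq_pullback]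
  exact mextDeriv_pullback_apply (eventually_contMDiffAt_seamChartInv h₀ hu) hα

end FlatRep


/-! ### The Liouville collar in the product charts: a general fold primitive `m̂ · b̂`

Combining the two previous sections: the flat representative of `CM^*λ` over
`{u | tail u ∈ chart target, u₀ > 0}` is pointwise a positive multiple of the flat slice
covector field `b̂` of `β₀ = incl^*λ`; locally the factor is a `C^∞` positive function `m̂`,
so that `CM^*λ` reads as the general fold primitive `m̂ b̂` of `FoldFormsFourFoldsProofs.lean`. -/

section CollarFlat

/-- Evaluation of a `1`-form on `ℝ⁴` at a fixed vector is `C^∞` in the form. [folklore] -/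
theorem contDiff_alt_one_eval (v : Fin 1 → EuclideanSpace ℝ (Fin 4)) :
    ContDiff ℝ ∞ fun α : (EuclideanSpace ℝ (Fin 4)) [⋀^Fin 1]→L[ℝ] ℝ => α v := by
  have h : IsBoundedLinearMap ℝ fun α : (EuclideanSpace ℝ (Fin 4)) [⋀^Fin 1]→L[ℝ] ℝ => α v := by
    refine ⟨⟨fun a b => rfl, fun c a => rfl⟩, (∏ i, ‖v i‖) + 1, by positivity, fun α => ?_⟩
    calc ‖α v‖ ≤ ‖α‖ * ∏ i, ‖v i‖ := α.le_opNorm v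
      _ ≤ ((∏ i, ‖v i‖) + 1) * ‖α‖ := by
        nlinarith [norm_nonneg α,
          Finset.prod_nonneg fun i (_ : i ∈ Finset.univ) => norm_nonneg (v i)]
  exact h.contDiff

namespace SteinStructure

variable {W : Type*} [TopologicalSpace W] [ChartedSpace (EuclideanHalfSpace 4) W]
  [IsManifold (𝓡∂ 4) ∞ W] [CompactSpace W] [T2Space W] (S : SteinStructure W)
  {c₀ c₁ : ℝ} {hc : c₀ < c₁} {hc₁ : c₁ < sSup (range S.φ)}
  {hreg : ∀ x, c₀ ≤ S.φ x → S.dφ x ≠ 0} {D : FlowoutInput 3 W}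
  (hD : D = S.liouvilleFlowout hc hc₁ hreg) (Γ : D.Cover)
  (b : BoundaryData (𝓡∂ 4) W (𝓡 3)) [Nonempty b.carrier]

/-- The boundary contact form `β₀ = incl^*λ` on the boundary manifold. [folklore] -/
def boundaryContactForm : MForm (𝓡 3) b.carrier ℝ 1 :=
  (-dComplex S.J S.φ).pullback (𝓡 3) b.incl

/-- The Liouville form pulled back along the (uncurried) Liouville open collar, a `1`-form on
the seam piece `∂W × ℝ`. [folklore] -/
def collarLiouvilleForm : MForm ((𝓡 3).prod 𝓘(ℝ, ℝ)) (b.carrier × ℝ) ℝ 1 :=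
  (-dComplex S.J S.φ).pullback ((𝓡 3).prod 𝓘(ℝ, ℝ)) (uncurry (Γ.openCollar b).toFun)

omit [Nonempty b.carrier] in
/-- The boundary contact form is smooth. [folklore] -/
theorem isSmoothForm_boundaryContactForm : IsSmoothForm (S.boundaryContactForm b) :=
  (liouvilleForm_pullback S b.isSmoothEmbedding.contMDiff).1

omit [Nonempty b.carrier] in
/-- **The boundary contact form vanishes nowhere**: at a boundary point `α` does not vanish on
`T∂W` (`exists_contactForm_ne_zero`), and `d(incl)` maps onto `T∂W`. [folklore] -/
theorem exists_boundaryContactForm_ne_zero (x : b.carrier) :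
    ∃ v : EuclideanSpace ℝ (Fin 3), S.boundaryContactForm b x ![v] ≠ 0 := by
  have hx : (𝓡∂ 4).IsBoundaryPoint (b.incl x) := b.incl_mem_boundary x
  obtain ⟨u, hu, hne⟩ := S.exists_contactForm_ne_zero hx
  obtain ⟨v, hv⟩ := exists_mfderiv_incl_eq b x hu
  refine ⟨v, ?_⟩
  show ((-dComplex S.J S.φ).pullback (𝓡 3) b.incl) x ![v] ≠ 0
  rw [(liouvilleForm_pullback S b.isSmoothEmbedding.contMDiff).2.1 x v, hv]
  exact hne

/-- The collar Liouville form is smooth at the points of `∂W × (0, ∞)`. [folklore] -/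
theorem smoothAt_collarLiouvilleForm (x : b.carrier) {s : ℝ} (hs : 0 < s) :
    (S.collarLiouvilleForm Γ b).SmoothAt (x, s) := by
  have hFev : ∀ᶠ q in 𝓝 (x, s), ContMDiffAt ((𝓡 3).prod 𝓘(ℝ, ℝ)) (𝓡∂ 4) ∞
      (uncurry (Γ.openCollar b).toFun) q := by
    have ho : IsOpen ((univ : Set b.carrier) ×ˢ Ioi (0 : ℝ)) := isOpen_univ.prod isOpen_Ioi
    filter_upwards [ho.mem_nhds ⟨mem_univ _, hs⟩] with q hq
    exact contMDiffAt_uncurry_openCollar Γ b q.1 hq.2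
  exact MForm.SmoothAt.pullback hFev ((isSmoothForm_iff_smoothAt _).1 (S.isSmoothForm_liouvilleForm) _)

omit [Nonempty b.carrier] in
/-- The flat slice covector of `β₀` does not vanish over the chart target: `b̂_u` restricted to
the slice is `β₀` at `chart⁻¹ (tail u)` composed with the invertible `D(chart⁻¹)`. [folklore] -/
theorem exists_flatSliceCovector_ne_zero (h₀ : b.carrier) {u : EuclideanSpace ℝ (Fin 4)}
    (hu : sliceTail u ∈ (extChartAt (𝓡 3) h₀).target) :
    ∃ w : EuclideanSpace ℝ (Fin 4), flatSliceCovector (S.boundaryContactForm b) h₀ u w ≠ 0 := by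
  set x' := (extChartAt (𝓡 3) h₀).symm (sliceTail u) with hx'
  obtain ⟨v, hv⟩ := S.exists_boundaryContactForm_ne_zero b x'
  set M₂ := mfderivWithin 𝓘(ℝ, EuclideanSpace ℝ (Fin 3)) (𝓡 3) (extChartAt (𝓡 3) h₀).symm
    (range (𝓡 3)) (sliceTail u) with hM₂
  have hM₂inv : M₂.IsInvertible := isInvertible_mfderivWithin_extChartAt_symm hu
  obtain ⟨a, ha⟩ := hM₂inv.surjective v
  refine ⟨BoundaryManifold.consCLE 3 (a, 0), ?_⟩
  rw [flatSliceCovector, ContinuousLinearMap.comp_apply, sliceTail_consCLE, alt1ToCLM_apply,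
    MForm.inChart_apply]
  have hvec : (fun i => mfderivWithin 𝓘(ℝ, EuclideanSpace ℝ (Fin 3)) (𝓡 3) (extChartAt (𝓡 3) h₀).symm
      (range (𝓡 3)) (sliceTail u) ((![a] : Fin 1 → EuclideanSpace ℝ (Fin 3)) i)) = ![v] := by
    funext i
    rw [show i = 0 from Subsingleton.elim i 0]
    simp only [Matrix.cons_val_zero]
    exact ha
  rw [hvec]
  exact hv

include hD in
/-- **The collar Liouville form, read flat, is a positive multiple of the flat slice covector
of `β₀`**: for `u` over the chart target with `u₀ > 0`,
`flatRep (CM^*λ) u = m · b̂_u` with `m > 0`. [cite: CieliebakEliashberg2012, §2 and §11.1] -/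
theorem exists_flatRep_collarLiouvilleForm_eq_smul (h₀ : b.carrier) {u : EuclideanSpace ℝ (Fin 4)}
    (hu : sliceTail u ∈ (extChartAt (𝓡 3) h₀).target) (hu0 : 0 < u 0) :
    ∃ m : ℝ, 0 < m ∧ flatRep (S.collarLiouvilleForm Γ b) h₀ u =
      m • covectorToOneForm (flatSliceCovector (S.boundaryContactForm b) h₀ u) := by
  set x' := (extChartAt (𝓡 3) h₀).symm (sliceTail u) with hx'
  obtain ⟨m, hm, hval⟩ := S.exists_liouvilleForm_pullback_openCollar_apply hD Γ b x' hu0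
  refine ⟨m, hm, ?_⟩
  set M₂ := mfderivWithin 𝓘(ℝ, EuclideanSpace ℝ (Fin 3)) (𝓡 3) (extChartAt (𝓡 3) h₀).symm
    (range (𝓡 3)) (sliceTail u) with hM₂
  -- the value of the flat representative on a vector `w 0`
  have hw : ∀ w : Fin 1 → EuclideanSpace ℝ (Fin 4),
      flatRep (S.collarLiouvilleForm Γ b) h₀ u w =
        m * S.boundaryContactForm b x' ![M₂ (sliceTail (w 0))] := fun w => by
    have hD0 : mfderiv 𝓘(ℝ, EuclideanSpace ℝ (Fin 4)) ((𝓡 3).prod 𝓘(ℝ, ℝ)) (seamChartInv h₀) u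
        (w 0) = (M₂ (sliceTail (w 0)), (w 0) 0) := by
      rw [(hasMFDerivAt_seamChartInv h₀ hu).mfderiv]
      rfl
    set φ : (EuclideanSpace ℝ (Fin 3) × ℝ) [⋀^Fin 1]→L[ℝ] ℝ :=
      (S.collarLiouvilleForm Γ b) (seamChartInv h₀ u) with hφ
    have hA := form_one_apply_eq φ
      (fun i => mfderiv 𝓘(ℝ, EuclideanSpace ℝ (Fin 4)) ((𝓡 3).prod 𝓘(ℝ, ℝ)) (seamChartInv h₀) u (w i))
    have hB := congrArg (fun X => φ ![X]) hD0
    exact (hA.trans hB).trans (hval (M₂ (sliceTail (w 0))) ((w 0) 0))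
  -- the value of the flat slice covector on `w 0`
  have hb : ∀ w₀ : EuclideanSpace ℝ (Fin 4),
      flatSliceCovector (S.boundaryContactForm b) h₀ u w₀ =
        S.boundaryContactForm b x' ![M₂ (sliceTail w₀)] := fun w₀ => by
    rw [flatSliceCovector, ContinuousLinearMap.comp_apply, alt1ToCLM_apply, MForm.inChart_apply]
    congr 1
    funext i
    rw [show i = 0 from Subsingleton.elim i 0]
    rfl
  ext w
  refine (hw w).trans ?_
  rw [← hb]
  rfl

include hD in
/-- **Locally, the collar Liouville form reads as a general fold primitive `m̂ b̂`** with a `C^∞`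
positive factor `m̂`: around every `u₀` over the chart target with `(u₀)₀ > 0` there is an open
set `O` on which `flatRep (CM^*λ) = genFoldPrimitive m̂ b̂`, `m̂ > 0`, `m̂` `C^∞`.
[cite: Baykur2006, proof of Thm. 6.1] -/
theorem exists_flatRep_collarLiouvilleForm_eq_genFoldPrimitive (h₀ : b.carrier)
    {u₀ : EuclideanSpace ℝ (Fin 4)} (hu₀ : sliceTail u₀ ∈ (extChartAt (𝓡 3) h₀).target)
    (hu₀0 : 0 < u₀ 0) :
    ∃ O : Set (EuclideanSpace ℝ (Fin 4)), IsOpen O ∧ u₀ ∈ O ∧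
      O ⊆ {u | sliceTail u ∈ (extChartAt (𝓡 3) h₀).target ∧ 0 < u 0} ∧
      ∃ mhat : EuclideanSpace ℝ (Fin 4) → ℝ, ContDiffOn ℝ ∞ mhat O ∧ (∀ u ∈ O, 0 < mhat u) ∧
        ∀ u ∈ O, flatRep (S.collarLiouvilleForm Γ b) h₀ u =
          genFoldPrimitive mhat (flatSliceCovector (S.boundaryContactForm b) h₀) u := by
  set bhat := flatSliceCovector (S.boundaryContactForm b) h₀ with hbhat
  obtain ⟨w₀, hw₀⟩ := S.exists_flatSliceCovector_ne_zero b h₀ hu₀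
  set O₁ : Set (EuclideanSpace ℝ (Fin 4)) :=
    {u | sliceTail u ∈ (extChartAt (𝓡 3) h₀).target ∧ 0 < u 0} with hO₁
  have hO₁ : IsOpen O₁ :=
    (isOpen_sliceTail_preimage_target (H := b.carrier) h₀).inter
      (isOpen_lt continuous_const ((EuclideanSpace.proj (0 : Fin 4)).continuous))
  have hb : ContDiffOn ℝ ∞ bhat O₁ :=
    (contDiffOn_flatSliceCovector (S.isSmoothForm_boundaryContactForm b) h₀).mono fun u hu => hu.1
  have hbw : ContinuousOn (fun u => bhat u w₀) O₁ :=
    (hb.continuousOn.clm_apply continuousOn_const)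
  set O : Set (EuclideanSpace ℝ (Fin 4)) := O₁ ∩ (fun u => bhat u w₀) ⁻¹' {r | r ≠ 0} with hOdef
  have hO : IsOpen O := hbw.isOpen_inter_preimage hO₁ isOpen_ne
  have hu₀O : u₀ ∈ O := ⟨⟨hu₀, hu₀0⟩, hw₀⟩
  -- the local factor
  set mhat : EuclideanSpace ℝ (Fin 4) → ℝ := fun u =>
    flatRep (S.collarLiouvilleForm Γ b) h₀ u ![w₀] / bhat u w₀ with hmhat
  have hℓsm : ∀ u ∈ O₁, @ContDiffAt ℝ _ (EuclideanSpace ℝ (Fin 4)) _ _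
      ((EuclideanSpace ℝ (Fin 4)) [⋀^Fin 1]→L[ℝ] ℝ) _ _ ∞
      (flatRep (S.collarLiouvilleForm Γ b) h₀) u := fun u hu => by
    have hsm : (S.collarLiouvilleForm Γ b).SmoothAt (seamChartInv h₀ u) :=
      S.smoothAt_collarLiouvilleForm Γ b _ hu.2
    exact (MForm.smoothAt_model_iff (flatRep (S.collarLiouvilleForm Γ b) h₀) u).1
      (smoothAt_flatRep h₀ hu.1 hsm)
  have hkey : ∀ u ∈ O, 0 < mhat u ∧
      flatRep (S.collarLiouvilleForm Γ b) h₀ u = genFoldPrimitive mhat bhat u := fun u hu => by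
    obtain ⟨m, hm, hval⟩ := S.exists_flatRep_collarLiouvilleForm_eq_smul hD Γ b h₀ hu.1.1 hu.1.2
    have hmu : mhat u = m := by
      have h := congrArg (fun φ : (EuclideanSpace ℝ (Fin 4)) [⋀^Fin 1]→L[ℝ] ℝ => φ ![w₀]) hval
      simp only [ContinuousAlternatingMap.smul_apply, covectorToOneForm_apply,
        Matrix.cons_val_zero, smul_eq_mul] at h
      show flatRep (S.collarLiouvilleForm Γ b) h₀ u ![w₀] / bhat u w₀ = m
      rw [div_eq_iff (show bhat u w₀ ≠ 0 from hu.2)]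
      exact h
    refine ⟨hmu ▸ hm, ?_⟩
    show flatRep (S.collarLiouvilleForm Γ b) h₀ u = mhat u • covectorToOneForm (bhat u)
    rw [hmu]
    exact hval
  refine ⟨O, hO, hu₀O, fun u hu => hu.1, mhat, ?_, fun u hu => (hkey u hu).1,
    fun u hu => (hkey u hu).2⟩
  intro u hu
  have h1 : ContDiffAt ℝ ∞ (fun u => flatRep (S.collarLiouvilleForm Γ b) h₀ u ![w₀]) u :=
    (contDiff_alt_one_eval ![w₀]).contDiffAt.comp u (hℓsm u hu.1)
  have h2 : ContDiffAt ℝ ∞ (fun u => bhat u w₀) u :=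
    ((hb u hu.1).contDiffAt (hO₁.mem_nhds hu.1)).clm_apply contDiffAt_const
  exact (h1.div h2 hu.2).contDiffWithinAt

end SteinStructure

end CollarFlat


/-! ### The derivative facts of the flat collar primitive

From the non-degeneracy of `CM^*ω` (`s > 0`) and the Pfaffian of the general fold model,
`Pf(d(m̂ b̂)) = m̂ · ∂₀m̂ · (b̂ ∧ db̂)(e₁, e₂, e₃)`: both `∂₀ m̂ ≠ 0` and the slice contact volume
`(b̂ ∧ db̂)(e₁, e₂, e₃) ≠ 0` on the open set where `CM^*λ` reads as `m̂ b̂`. -/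

section CollarFlatDeriv

namespace SteinStructure

variable {W : Type*} [TopologicalSpace W] [ChartedSpace (EuclideanHalfSpace 4) W]
  [IsManifold (𝓡∂ 4) ∞ W] [CompactSpace W] [T2Space W] (S : SteinStructure W)
  {c₀ c₁ : ℝ} {hc : c₀ < c₁} {hc₁ : c₁ < sSup (range S.φ)}
  {hreg : ∀ x, c₀ ≤ S.φ x → S.dφ x ≠ 0} {D : FlowoutInput 3 W}
  (hD : D = S.liouvilleFlowout hc hc₁ hreg) (Γ : D.Cover)
  (b : BoundaryData (𝓡∂ 4) W (𝓡 3)) [Nonempty b.carrier]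

omit [IsManifold (𝓡∂ 4) ∞ W] [CompactSpace W] [T2Space W] [Nonempty b.carrier] in
/-- The differential of the inverse product chart is injective. [folklore] -/
theorem injective_mfderiv_seamChartInv (h₀ : b.carrier) {u : EuclideanSpace ℝ (Fin 4)}
    (hu : sliceTail u ∈ (extChartAt (𝓡 3) h₀).target) :
    Injective (mfderiv 𝓘(ℝ, EuclideanSpace ℝ (Fin 4)) ((𝓡 3).prod 𝓘(ℝ, ℝ)) (seamChartInv h₀) u) := by
  set M₂ := mfderivWithin 𝓘(ℝ, EuclideanSpace ℝ (Fin 3)) (𝓡 3) (extChartAt (𝓡 3) h₀).symm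
    (range (𝓡 3)) (sliceTail u) with hM₂
  have hM₂inv : M₂.IsInvertible := isInvertible_mfderivWithin_extChartAt_symm hu
  rw [(hasMFDerivAt_seamChartInv h₀ hu).mfderiv]
  intro V₁ V₂ h
  have h1 : M₂ (sliceTail V₁) = M₂ (sliceTail V₂) := congrArg Prod.fst h
  have h2 : (EuclideanSpace.proj (0 : Fin 4) : EuclideanSpace ℝ (Fin 4) →L[ℝ] ℝ) V₁ =
      (EuclideanSpace.proj (0 : Fin 4) : EuclideanSpace ℝ (Fin 4) →L[ℝ] ℝ) V₂ := congrArg Prod.snd h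
  have h3 : sliceTail V₁ = sliceTail V₂ := hM₂inv.injective h1
  have key : ∀ V : EuclideanSpace ℝ (Fin 4), BoundaryManifold.consCLE 3
      (sliceTail V, (EuclideanSpace.proj (0 : Fin 4) : EuclideanSpace ℝ (Fin 4) →L[ℝ] ℝ) V) = V :=
    fun V => consCLE_sliceTail V
  have e1 := key V₁
  have e2 := key V₂
  rw [h3, h2] at e1
  exact e1.symm.trans e2

omit [IsManifold (𝓡∂ 4) ∞ W] [CompactSpace W] [T2Space W] [Nonempty b.carrier] in
/-- The differential of the inverse product chart is surjective. [folklore] -/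
theorem surjective_mfderiv_seamChartInv (h₀ : b.carrier) {u : EuclideanSpace ℝ (Fin 4)}
    (hu : sliceTail u ∈ (extChartAt (𝓡 3) h₀).target) :
    Surjective (mfderiv 𝓘(ℝ, EuclideanSpace ℝ (Fin 4)) ((𝓡 3).prod 𝓘(ℝ, ℝ)) (seamChartInv h₀) u) := by
  set DF : EuclideanSpace ℝ (Fin 4) →L[ℝ] (EuclideanSpace ℝ (Fin 3) × ℝ) :=
    mfderiv 𝓘(ℝ, EuclideanSpace ℝ (Fin 4)) ((𝓡 3).prod 𝓘(ℝ, ℝ)) (seamChartInv h₀) u with hDF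
  have hinj : Injective DF := injective_mfderiv_seamChartInv b h₀ hu
  have hdim : Module.finrank ℝ (EuclideanSpace ℝ (Fin 4)) =
      Module.finrank ℝ (EuclideanSpace ℝ (Fin 3) × ℝ) := by
    rw [Module.finrank_prod, finrank_euclideanSpace, finrank_euclideanSpace, Module.finrank_self]
    simp
  exact (LinearMap.injective_iff_surjective_of_finrank_eq_finrank hdim (f := DF.toLinearMap)).1 hinj

/-- **Non-degeneracy of the flat collar form**: for `u` over the chart target with `u₀ > 0`,
`d(flatRep (CM^*λ))_u` is non-degenerate. [folklore] -/
theorem mextDeriv_flatRep_collarLiouvilleForm_nondegenerate (h₀ : b.carrier)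
    {u : EuclideanSpace ℝ (Fin 4)} (hu : sliceTail u ∈ (extChartAt (𝓡 3) h₀).target)
    (hu0 : 0 < u 0) {V : EuclideanSpace ℝ (Fin 4)} (hV : V ≠ 0) :
    ∃ V' : EuclideanSpace ℝ (Fin 4),
      mextDeriv (flatRep (S.collarLiouvilleForm Γ b) h₀) u ![V, V'] ≠ 0 := by
  set DF : EuclideanSpace ℝ (Fin 4) →L[ℝ] (EuclideanSpace ℝ (Fin 3) × ℝ) :=
    mfderiv 𝓘(ℝ, EuclideanSpace ℝ (Fin 4)) ((𝓡 3).prod 𝓘(ℝ, ℝ)) (seamChartInv h₀) u with hDF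
  have hinj : Injective DF := injective_mfderiv_seamChartInv b h₀ hu
  have hsurj : Surjective DF := surjective_mfderiv_seamChartInv b h₀ hu
  have hDFV : DF V ≠ 0 := fun h => hV (hinj (h.trans (map_zero DF).symm))
  set x' := (extChartAt (𝓡 3) h₀).symm (sliceTail u) with hx'
  obtain ⟨V₁', hV₁'⟩ :=
    S.exists_mextDeriv_liouvilleForm_pullback_openCollar_ne_zero Γ b x' hu0 hDFV
  obtain ⟨V', hV'⟩ := hsurj V₁'
  refine ⟨V', ?_⟩
  have hsm : (S.collarLiouvilleForm Γ b).SmoothAt (seamChartInv h₀ u) :=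
    S.smoothAt_collarLiouvilleForm Γ b _ hu0
  rw [mextDeriv_flatRep h₀ hu hsm, flatRep_apply]
  have hvec : (fun i => mfderiv 𝓘(ℝ, EuclideanSpace ℝ (Fin 4)) ((𝓡 3).prod 𝓘(ℝ, ℝ)) (seamChartInv h₀) u
      ((![V, V'] : Fin 2 → EuclideanSpace ℝ (Fin 4)) i)) = ![DF V, DF V'] := by
    funext i
    fin_cases i <;> rfl
  refine (congrArg (fun w => mextDeriv (S.collarLiouvilleForm Γ b) (seamChartInv h₀ u) w)
    hvec).trans_ne ?_
  rw [← hV'] at hV₁'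
  exact hV₁'

include hD in
/-- **The derivative facts of the flat collar primitive.**  Around `u₀` (over the chart target,
`(u₀)₀ > 0`) there are an open set `O` and a `C^∞` positive `m̂` with
`flatRep (CM^*λ) = m̂ b̂` on `O`, and moreover `∂₀ m̂ ≠ 0` and `(b̂ ∧ db̂)(e₁,e₂,e₃) ≠ 0` on `O`:
the pulled-back Kähler form is non-degenerate there and its Pfaffian in the model is
`m̂ · ∂₀m̂ · (b̂ ∧ db̂)(e₁,e₂,e₃)` (`pfaffian_genContactFoldForm`).
[cite: Baykur2006, proof of Thm. 6.1] -/
theorem exists_collar_genFoldPrimitive_data (h₀ : b.carrier)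
    {u₀ : EuclideanSpace ℝ (Fin 4)} (hu₀ : sliceTail u₀ ∈ (extChartAt (𝓡 3) h₀).target)
    (hu₀0 : 0 < u₀ 0) :
    ∃ O : Set (EuclideanSpace ℝ (Fin 4)), IsOpen O ∧ u₀ ∈ O ∧
      O ⊆ {u | sliceTail u ∈ (extChartAt (𝓡 3) h₀).target ∧ 0 < u 0} ∧
      ∃ mhat : EuclideanSpace ℝ (Fin 4) → ℝ, ContDiffOn ℝ ∞ mhat O ∧ (∀ u ∈ O, 0 < mhat u) ∧
        (∀ u ∈ O, flatRep (S.collarLiouvilleForm Γ b) h₀ u =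
          genFoldPrimitive mhat (flatSliceCovector (S.boundaryContactForm b) h₀) u) ∧
        (∀ u ∈ O, fderiv ℝ mhat u (stdVec 0) ≠ 0) ∧
        (∀ u ∈ O, sliceContactVolume (flatSliceCovector (S.boundaryContactForm b) h₀ u)
          (fderiv ℝ (flatSliceCovector (S.boundaryContactForm b) h₀) u) ≠ 0) := by
  obtain ⟨O, hO, hu₀O, hOsub, mhat, hmhat, hpos, hrep⟩ :=
    S.exists_flatRep_collarLiouvilleForm_eq_genFoldPrimitive hD Γ b h₀ hu₀ hu₀0
  set bhat := flatSliceCovector (S.boundaryContactForm b) h₀ with hbhat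
  have hbO : ContDiffOn ℝ ∞ bhat O :=
    (contDiffOn_flatSliceCovector (S.isSmoothForm_boundaryContactForm b) h₀).mono
      fun u hu => (hOsub hu).1
  -- the Pfaffian of the model is non-zero on `O`, and factors
  have key : ∀ u ∈ O, mhat u * fderiv ℝ mhat u (stdVec 0) *
      sliceContactVolume (bhat u) (fderiv ℝ bhat u) ≠ 0 := by
    intro u hu
    have hΦd : HasFDerivAt mhat (fderiv ℝ mhat u) u :=
      ((hmhat u hu).contDiffAt (hO.mem_nhds hu)).differentiableAt (by simp) |>.hasFDerivAt
    have hbd : DifferentiableAt ℝ bhat u :=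
      ((hbO u hu).contDiffAt (hO.mem_nhds hu)).differentiableAt (by simp)
    have hb'1 : ∀ v, fderiv ℝ bhat u v (stdVec 0) = 0 := fun v => by
      have h0 : (fun y => bhat y (stdVec 0)) = fun _ => (0 : ℝ) := by
        funext y; exact flatSliceCovector_stdVec_zero _ h₀ y
      have h1 : fderiv ℝ (fun y => bhat y (stdVec 0)) u = 0 := by
        rw [h0]; exact fderiv_const_apply 0
      have h2 := fderiv_clm_apply hbd (differentiableAt_const (stdVec 0 : EuclideanSpace ℝ (Fin 4)))
      rw [h2, fderiv_const_apply, ContinuousLinearMap.comp_zero, zero_add] at h1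
      have h3 := congrArg (fun T : EuclideanSpace ℝ (Fin 4) →L[ℝ] ℝ => T v) h1
      simpa using h3
    have hPf := pfaffian_genContactFoldForm hΦd hbd.hasFDerivAt
      (flatSliceCovector_stdVec_zero _ h₀ u) (fderiv_flatSliceCovector_stdVec_zero _ h₀ u) hb'1
    rw [← hPf]
    -- `d(m̂ b̂)` at `u` is `d(flatRep (CM^*λ))` at `u`, which is non-degenerate
    have hev : (genFoldPrimitive mhat bhat : EuclideanSpace ℝ (Fin 4) →
        (EuclideanSpace ℝ (Fin 4)) [⋀^Fin 1]→L[ℝ] ℝ) =ᶠ[𝓝 u]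
        fun y => flatRep (S.collarLiouvilleForm Γ b) h₀ y := by
      filter_upwards [hO.mem_nhds hu] with y hy
      exact (hrep y hy).symm
    have heq : genContactFoldForm mhat bhat u =
        mextDeriv (flatRep (S.collarLiouvilleForm Γ b) h₀) u := by
      rw [mextDeriv_eq_extDeriv]
      exact hev.extDeriv_eq
    rw [heq, Ne, pfaffian_eq_zero_iff_altKer_ne_bot, not_not, Submodule.eq_bot_iff]
    intro V hVker
    by_contra hVne
    obtain ⟨V', hV'⟩ :=
      S.mextDeriv_flatRep_collarLiouvilleForm_nondegenerate Γ b h₀ (hOsub hu).1 (hOsub hu).2 hVne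
    exact hV' ((mem_altKer_iff _).1 hVker V')
  refine ⟨O, hO, hu₀O, hOsub, mhat, hmhat, hpos, hrep, fun u hu => ?_, fun u hu => ?_⟩
  · have h := key u hu
    exact fun h0 => h (by rw [h0, mul_zero, zero_mul])
  · have h := key u hu
    exact fun h0 => h (by rw [h0, mul_zero])

end SteinStructure

end CollarFlatDeriv


/-! ### The explicit conformal factor `exp ∫ γ̂` and its monotonicity

The factor by which the Liouville flow-out rescales the contact form is
`exp (∫₀ᵗ cutCoef (Fl z τ) dτ)` (`oneForm_apply_linearization_eq_exp_smul`); along the collar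
the coefficient `cutCoef = -χ(φ)/dφ(Y)` is negative (`χ = 1` on `{f < δ}`), so the factor
decreases strictly with the flow time. -/

section ExplicitFactor

namespace SteinStructure

variable {W : Type*} [TopologicalSpace W] [ChartedSpace (EuclideanHalfSpace 4) W]
  [IsManifold (𝓡∂ 4) ∞ W] [CompactSpace W] [T2Space W] (S : SteinStructure W)
  {c₀ c₁ : ℝ} {hc : c₀ < c₁} {hc₁ : c₁ < sSup (range S.φ)}
  {hreg : ∀ x, c₀ ≤ S.φ x → S.dφ x ≠ 0} {D : FlowoutInput 3 W}
  (hD : D = S.liouvilleFlowout hc hc₁ hreg)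

include hD in
/-- **The transport of the contact form with its explicit factor** (chart-box form): for `z` in
the domain of a box and `t ∈ [0, ε]`,
`λ(D(curve_t)_z v) = exp (∫₀ᵗ cutCoef (curve z τ) dτ) · λ_z(v)` — the proof of
`exists_pos_contactForm_mfderiv_curve` (`SteinLevelTransport.lean`) with the factor of
`oneForm_apply_linearization_eq_exp_smul` kept explicit. [cite: CieliebakEliashberg2012, §2] -/
theorem contactForm_mfderiv_curve_eq_exp_mul {y : W} (C : D.ChartBox y) {z : W} (hz : z ∈ C.dom)
    {t : ℝ} (ht : t ∈ Icc 0 C.box.ε) (v : EuclideanSpace ℝ (Fin 4)) :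
    S.contactForm (C.curve z t) (mfderiv (𝓡∂ 4) (𝓡∂ 4) (fun z' => C.curve z' t) z v) =
      Real.exp (∫ τ in (0 : ℝ)..t, S.cutCoef c₀ c₁ (C.curve z τ)) * S.contactForm z v := by
  obtain ⟨J, hJ0, hJode, hJd⟩ := C.exists_linearization_box
  obtain ⟨hΛ, -, hγ, hZ, hSu, h0, -, hcon, hdω⟩ := S.chart_hypotheses hD C
  have hzs : z ∈ (chartAt (EuclideanHalfSpace 4) y).source := by
    rw [← extChartAt_source (I := 𝓡∂ 4)]; exact hz.1
  have hqA : extChartAt (𝓡∂ 4) y z ∈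
      Literature.Analysis.ODE.halfSpace (halfSpaceCoord 3) ∩ ball (extChartAt (𝓡∂ 4) y y) C.box.r :=
    C.apply_mem_ball hz
  have hder := C.hasMFDerivAt_curve hJd hz ht
  have hxs : C.curve z t ∈ (chartAt (EuclideanHalfSpace 4) y).source :=
    C.curve_mem_source_of_mem_dom hz ht
  have hcx : extChartAt (𝓡∂ 4) y (C.curve z t) = C.box.flow (extChartAt (𝓡∂ 4) y z) t :=
    C.extChartAt_curve hz ht
  have hu : ∀ τ ∈ Icc 0 C.box.ε, HasDerivWithinAt (C.box.flow (extChartAt (𝓡∂ 4) y z))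
      (D.fieldIn y (C.box.flow (extChartAt (𝓡∂ 4) y z) τ)) (Icc 0 C.box.ε) τ := fun τ hτ =>
    C.box.hasDerivWithinAt_Icc (isHalfSpaceRetraction_modelRetraction 3)
      (FlowoutInput.extChartAt_mem_halfSpace (k := 3) y y) C.inward (C.apply_mem hz) hτ
  have hus : ∀ τ ∈ Icc 0 C.box.ε, C.box.flow (extChartAt (𝓡∂ 4) y z) τ ∈
      Literature.Analysis.ODE.halfSpace (halfSpaceCoord 3) ∩ ball (extChartAt (𝓡∂ 4) y y) C.R :=
    fun τ hτ => C.flow_mem_of_mem_dom hz hτ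
  have hd : ∀ q' ∈ Literature.Analysis.ODE.halfSpace (halfSpaceCoord 3) ∩ ball (extChartAt (𝓡∂ 4) y y) C.R,
      ∀ w, extDerivWithin ((-dComplex S.J S.φ).inChart y)
        (Literature.Analysis.ODE.halfSpace (halfSpaceCoord 3) ∩ ball (extChartAt (𝓡∂ 4) y y) C.R) q'
        ![D.fieldIn y q', w] =
        S.cutCoef c₀ c₁ ((extChartAt (𝓡∂ 4) y).symm q') • (-dComplex S.J S.φ).inChart y q' ![w] :=
    fun q' hq' w => by rw [hdω q' hq']; exact hcon q' hq' w
  have hγu : ContinuousOn (fun τ => S.cutCoef c₀ c₁ ((extChartAt (𝓡∂ 4) y).symm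
      (C.box.flow (extChartAt (𝓡∂ 4) y z) τ))) (Icc 0 C.box.ε) :=
    hγ.continuousOn.comp (fun τ hτ => (hu τ hτ).continuousWithinAt) fun τ hτ => hus τ hτ
  have hmul := Literature.Analysis.ODE.oneForm_apply_linearization_eq_exp_smul hΛ hZ hSu h0 hd hu hus
    (hJode _ hqA) hγu
    (tangentCoordChange (𝓡∂ 4) z y z v) t ht
  have hq0 : C.box.flow (extChartAt (𝓡∂ 4) y z) 0 = extChartAt (𝓡∂ 4) y z :=
    C.box.flow_zero _ (ball_subset_closedBall hqA.2)
  rw [hJ0 _ hqA, hq0, one_apply_E4, smul_eq_mul] at hmul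
  have hmf : mfderiv (𝓡∂ 4) (𝓡∂ 4) (fun z' => C.curve z' t) z v =
      tangentCoordChange (𝓡∂ 4) y (C.curve z t) (C.curve z t)
        (J (extChartAt (𝓡∂ 4) y z) t (tangentCoordChange (𝓡∂ 4) z y z v)) := by
    rw [hder.mfderiv]; rfl
  rw [hmf, ← S.inChart_liouvilleForm_apply y hxs, hcx, hmul, S.inChart_liouvilleForm_apply y hzs,
    tangentCoordChange_symm_apply hzs]
  rfl

omit [CompactSpace W] [T2Space W] in
/-- **The level stays below `δ` along the box flow curves**, so that `χ(φ) = 1` there: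
`f (curve z τ) < δ` for `z` in the domain and `τ ∈ [0, ε]`. [folklore] -/
theorem f_curve_lt_delta {y : W} (C : D.ChartBox y) {z : W} (hz : z ∈ C.dom)
    {τ : ℝ} (hτ : τ ∈ Icc 0 C.box.ε) : D.f (C.curve z τ) < D.δ := by
  have h1 := C.levelIn_lt _ (C.flow_mem_of_mem_dom hz hτ)
  have hsrc : C.curve z τ ∈ (extChartAt (𝓡∂ 4) y).source := by
    rw [extChartAt_source]; exact C.curve_mem_source_of_mem_dom hz hτ
  rw [← C.extChartAt_curve hz hτ, D.levelIn_apply hsrc] at h1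
  exact h1

include hD in
/-- **The coefficient is negative along the collar**: at a point with `f z < δ` (i.e.
`φ z > c₁`), `cutCoef z = -(dφ(Y))⁻¹ < 0`. [folklore] -/
theorem cutCoef_neg_of_f_lt {z : W} (hz : D.f z < D.δ) : S.cutCoef c₀ c₁ z < 0 := by
  subst hD
  simp only [liouvilleFlowout_f, liouvilleFlowout_δ] at hz
  have hφ : c₁ ≤ S.φ z := by linarith
  have hχ : Real.smoothTransition ((S.φ z - c₀) / (c₁ - c₀)) = 1 :=
    smoothTransition_rescale_of_ge hc hφ
  have hdφ : S.dφ z ≠ 0 := hreg z (by linarith)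
  have hpos : 0 < S.dφ z (S.liouvilleVF z) := S.dφ_liouvilleVF_pos hdφ
  show -(Real.smoothTransition ((S.φ z - c₀) / (c₁ - c₀)) * (S.dφ z (S.liouvilleVF z))⁻¹) < 0
  rw [hχ, one_mul, neg_lt_zero]
  exact inv_pos.2 hpos

end SteinStructure

end ExplicitFactor


section CollarFactor

namespace SteinStructure

variable {W : Type*} [TopologicalSpace W] [ChartedSpace (EuclideanHalfSpace 4) W]
  [IsManifold (𝓡∂ 4) ∞ W] [CompactSpace W] [T2Space W] (S : SteinStructure W)
  {c₀ c₁ : ℝ} {hc : c₀ < c₁} {hc₁ : c₁ < sSup (range S.φ)}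
  {hreg : ∀ x, c₀ ≤ S.φ x → S.dφ x ≠ 0} {D : FlowoutInput 3 W}
  (hD : D = S.liouvilleFlowout hc hc₁ hreg) (Γ : D.Cover)

include hD in
/-- **Transport along the flow-out with the explicit factor**: for `z` with `f z < a` and
`t ∈ [0, a]`, `Fl(·, t)` is differentiable at `z` and rescales the contact form by
`exp (∫₀ᵗ cutCoef (Fl z τ) dτ)`. [cite: CieliebakEliashberg2012, §2 and §11.1] -/
theorem exists_hasMFDerivAt_Fl_transport_exp {z : W} (hz : D.f z < Γ.a) {t : ℝ}
    (ht : t ∈ Icc 0 Γ.a) :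
    ∃ L : EuclideanSpace ℝ (Fin 4) →L[ℝ] EuclideanSpace ℝ (Fin 4),
      HasMFDerivAt (𝓡∂ 4) (𝓡∂ 4) (fun z' => Γ.Fl z' t) z L ∧
      ∀ v, S.contactForm (Γ.Fl z t) (L v) =
        Real.exp (∫ τ in (0 : ℝ)..t, S.cutCoef c₀ c₁ (Γ.Fl z τ)) * S.contactForm z v := by
  obtain ⟨hy, hzd⟩ := Γ.centre_spec hz.le
  set C := Γ.bx (Γ.centre z) hy with hC
  have htε : t ∈ Icc 0 C.box.ε := ⟨ht.1, ht.2.trans (Γ.a_le_ε _ hy)⟩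
  obtain ⟨J, -, -, hJd⟩ := C.exists_linearization_box
  have hder := C.hasMFDerivAt_curve hJd hzd htε
  have hev : (fun z' => Γ.Fl z' t) =ᶠ[𝓝 z] fun z' => C.curve z' t := by
    have ho : IsOpen ({z' | D.f z' < Γ.a} ∩ C.dom) :=
      (isOpen_lt D.f_smooth.continuous continuous_const).inter C.isOpen_dom
    filter_upwards [ho.mem_nhds ⟨hz, hzd⟩] with z' hz'
    exact Γ.Fl_eq_of_mem_dom hy hz'.1.le hz'.2 ⟨by linarith [D.f_nonneg z', ht.1], ht.2⟩
  have hFl : ∀ τ ∈ Icc 0 Γ.a, Γ.Fl z τ = C.curve z τ := fun τ hτ =>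
    Γ.Fl_eq_of_mem_dom hy hz.le hzd ⟨by linarith [D.f_nonneg z, hτ.1], hτ.2⟩
  refine ⟨_, hder.congr_of_eventuallyEq hev, fun v => ?_⟩
  have h := S.contactForm_mfderiv_curve_eq_exp_mul hD C hzd htε v
  rw [hder.mfderiv] at h
  have hint : ∫ τ in (0 : ℝ)..t, S.cutCoef c₀ c₁ (Γ.Fl z τ) =
      ∫ τ in (0 : ℝ)..t, S.cutCoef c₀ c₁ (C.curve z τ) := by
    refine intervalIntegral.integral_congr fun τ hτ => ?_
    rw [uIcc_of_le ht.1] at hτ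
    show S.cutCoef c₀ c₁ (Γ.Fl z τ) = S.cutCoef c₀ c₁ (C.curve z τ)
    rw [hFl τ ⟨hτ.1, hτ.2.trans ht.2⟩]
  rw [hFl t ht, hint]
  exact h

include hD in
/-- **The coefficient is negative along the flow-out**: `cutCoef (Fl z τ) < 0` for `f z < a`,
`τ ∈ [0, a]`. [folklore] -/
theorem cutCoef_Fl_neg {z : W} (hz : D.f z < Γ.a) {τ : ℝ} (hτ : τ ∈ Icc 0 Γ.a) :
    S.cutCoef c₀ c₁ (Γ.Fl z τ) < 0 := by
  obtain ⟨hy, hzd⟩ := Γ.centre_spec hz.le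
  set C := Γ.bx (Γ.centre z) hy with hC
  have hτε : τ ∈ Icc 0 C.box.ε := ⟨hτ.1, hτ.2.trans (Γ.a_le_ε _ hy)⟩
  rw [Γ.Fl_eq_of_mem_dom hy hz.le hzd ⟨by linarith [D.f_nonneg z, hτ.1], hτ.2⟩]
  exact S.cutCoef_neg_of_f_lt hD (f_curve_lt_delta C hzd hτε)

/-- The coefficient along the flow-out is continuous on `[0, a]` (for `f z ≤ a`). [folklore] -/
theorem continuousOn_cutCoef_Fl (hc' : c₀ < c₁) (hreg' : ∀ x, c₀ ≤ S.φ x → S.dφ x ≠ 0)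
    {z : W} (hz : D.f z ≤ Γ.a) :
    ContinuousOn (fun τ => S.cutCoef c₀ c₁ (Γ.Fl z τ)) (Icc 0 Γ.a) :=
  (S.contMDiff_cutCoef hc' hreg').continuous.comp_continuousOn
    ((Γ.isMIntegralCurveOn_Fl hz).continuousOn.mono
      (Icc_subset_Icc (by linarith [D.f_nonneg z]) le_rfl))

variable (b : BoundaryData (𝓡∂ 4) W (𝓡 3)) [Nonempty b.carrier]

/-- **The collar factor** `m(x, s) = exp (∫₀^{a s/(1+s)} cutCoef (Fl (incl x) τ) dτ)`, the
factor by which the Liouville collar rescales the contact form. [folklore] -/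
def collarFactor (c₀ c₁ : ℝ) (x : b.carrier) (s : ℝ) : ℝ :=
  Real.exp (∫ τ in (0 : ℝ)..collarStretch Γ.a s, S.cutCoef c₀ c₁ (Γ.Fl (b.incl x) τ))

omit [Nonempty b.carrier] in
/-- The collar factor is positive. [folklore] -/
theorem collarFactor_pos (c₀ c₁ : ℝ) (x : b.carrier) (s : ℝ) : 0 < S.collarFactor Γ b c₀ c₁ x s :=
  Real.exp_pos _

omit [CompactSpace W] [Nonempty b.carrier] in
/-- The stretching function is strictly increasing on `[0, ∞)`. [folklore] -/
theorem collarStretch_lt_collarStretch {a s s' : ℝ} (ha : 0 < a) (hs : 0 ≤ s) (hss' : s < s') :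
    collarStretch a s < collarStretch a s' := by
  unfold collarStretch
  rw [div_lt_div_iff₀ (by linarith) (by linarith)]
  nlinarith

omit [Nonempty b.carrier] in
include hD in
/-- **The collar factor decreases strictly along the collar** (`s ↦ m(x, s)` on `[0, ∞)`): the
coefficient is negative along the flow-out. [cite: CieliebakEliashberg2012, §2 and §11.1] -/
theorem collarFactor_lt_collarFactor (x : b.carrier) {s s' : ℝ} (hs : 0 ≤ s) (hss' : s < s') :
    S.collarFactor Γ b c₀ c₁ x s' < S.collarFactor Γ b c₀ c₁ x s := by
  have hz : D.f (b.incl x) < Γ.a := by rw [D.f_incl b x]; exact Γ.a_pos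
  have h1 : collarStretch Γ.a s < collarStretch Γ.a s' := collarStretch_lt_collarStretch Γ.a_pos hs hss'
  have h0 : 0 ≤ collarStretch Γ.a s := collarStretch_nonneg Γ.a_pos hs
  have h2 : collarStretch Γ.a s' < Γ.a := collarStretch_lt Γ.a_pos (hs.trans hss'.le)
  unfold collarFactor
  rw [Real.exp_lt_exp]
  have hcont := S.continuousOn_cutCoef_Fl Γ hc hreg hz.le
  have hint : IntervalIntegrable (fun τ => S.cutCoef c₀ c₁ (Γ.Fl (b.incl x) τ)) MeasureTheory.volume
      (collarStretch Γ.a s) (collarStretch Γ.a s') :=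
    (hcont.mono (Icc_subset_Icc h0 h2.le)).intervalIntegrable_of_Icc h1.le
  have hint0 : IntervalIntegrable (fun τ => S.cutCoef c₀ c₁ (Γ.Fl (b.incl x) τ)) MeasureTheory.volume
      0 (collarStretch Γ.a s) :=
    (hcont.mono (Icc_subset_Icc le_rfl (h1.le.trans h2.le))).intervalIntegrable_of_Icc h0
  have hsplit := (intervalIntegral.integral_add_adjacent_intervals hint0 hint).symm
  rw [hsplit]
  have hneg : ∫ τ in collarStretch Γ.a s..collarStretch Γ.a s', S.cutCoef c₀ c₁ (Γ.Fl (b.incl x) τ) < 0 := by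
    have hpos : 0 < ∫ τ in collarStretch Γ.a s..collarStretch Γ.a s',
        -S.cutCoef c₀ c₁ (Γ.Fl (b.incl x) τ) := by
      refine intervalIntegral.intervalIntegral_pos_of_pos_on hint.neg (fun τ hτ => ?_) h1
      have := S.cutCoef_Fl_neg hD Γ hz (τ := τ) ⟨h0.trans hτ.1.le, hτ.2.le.trans h2.le⟩
      linarith
    rw [intervalIntegral.integral_neg] at hpos
    linarith
  linarith

end SteinStructure

end CollarFactor


section CollarFactorFlat

namespace SteinStructure

variable {W : Type*} [TopologicalSpace W] [ChartedSpace (EuclideanHalfSpace 4) W]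
  [IsManifold (𝓡∂ 4) ∞ W] [CompactSpace W] [T2Space W] (S : SteinStructure W)
  {c₀ c₁ : ℝ} {hc : c₀ < c₁} {hc₁ : c₁ < sSup (range S.φ)}
  {hreg : ∀ x, c₀ ≤ S.φ x → S.dφ x ≠ 0} {D : FlowoutInput 3 W}
  (hD : D = S.liouvilleFlowout hc hc₁ hreg) (Γ : D.Cover)
  (b : BoundaryData (𝓡∂ 4) W (𝓡 3)) [Nonempty b.carrier]

include hD in
/-- **The collar Liouville form in terms of the collar factor**: for `s > 0`,
`(CM^*λ)_{(x,s)}(v, r) = m(x, s) · β₀_x(v)`. [cite: CieliebakEliashberg2012, §2 and §11.1] -/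
theorem collarLiouvilleForm_apply_eq (x : b.carrier) {s : ℝ} (hs : 0 < s)
    (v : EuclideanSpace ℝ (Fin 3)) (r : ℝ) :
    (S.collarLiouvilleForm Γ b) (x, s) ![(v, r)] =
      S.collarFactor Γ b c₀ c₁ x s * S.boundaryContactForm b x ![v] := by
  obtain ⟨m, hm, hval⟩ := S.exists_liouvilleForm_pullback_openCollar_apply hD Γ b x hs
  -- the slice differential with the explicit factor
  have hz : D.f (b.incl x) < Γ.a := by rw [D.f_incl b x]; exact Γ.a_pos
  have ht : collarStretch Γ.a s ∈ Icc 0 Γ.a := collarStretch_mem_Icc Γ.a_pos hs.le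
  obtain ⟨L, hL, hexp⟩ := S.exists_hasMFDerivAt_Fl_transport_exp hD Γ hz ht
  have hincl : HasMFDerivAt (𝓡 3) (𝓡∂ 4) b.incl x (mfderiv (𝓡 3) (𝓡∂ 4) b.incl x) :=
    (b.isSmoothEmbedding.contMDiff.mdifferentiableAt (by simp) (x := x)).hasMFDerivAt
  have hslice : HasMFDerivAt (𝓡 3) (𝓡∂ 4) (fun x' => uncurry (Γ.openCollar b).toFun (x', s)) x
      (L.comp (mfderiv (𝓡 3) (𝓡∂ 4) b.incl x)) := hL.comp x hincl
  have hdiff : MDifferentiableAt ((𝓡 3).prod 𝓘(ℝ, ℝ)) (𝓡∂ 4) (uncurry (Γ.openCollar b).toFun)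
      (x, s) := (contMDiffAt_uncurry_openCollar Γ b x hs).mdifferentiableAt (by simp)
  have hDF0 : ∀ w : EuclideanSpace ℝ (Fin 3),
      mfderiv ((𝓡 3).prod 𝓘(ℝ, ℝ)) (𝓡∂ 4) (uncurry (Γ.openCollar b).toFun) (x, s) (w, 0) =
        L (mfderiv (𝓡 3) (𝓡∂ 4) b.incl x w) := fun w => by
    rw [mfderiv_prod_eq_add_comp hdiff]
    show mfderiv (𝓡 3) (𝓡∂ 4) (fun z : b.carrier => uncurry (Γ.openCollar b).toFun (z, s)) x w +
      mfderiv 𝓘(ℝ, ℝ) (𝓡∂ 4) (fun s' : ℝ => uncurry (Γ.openCollar b).toFun (x, s')) s 0 = _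
    rw [hslice.mfderiv, map_zero, add_zero]
    rfl
  -- the value on `(w, 0)` computed with the explicit factor
  have hval' : ∀ w : EuclideanSpace ℝ (Fin 3), (S.collarLiouvilleForm Γ b) (x, s) ![(w, 0)] =
      S.collarFactor Γ b c₀ c₁ x s * S.boundaryContactForm b x ![w] := fun w => by
    have key1 : (S.collarLiouvilleForm Γ b) (x, s) ![(w, 0)] =
        S.contactForm ((Γ.openCollar b).toFun x s)
          (mfderiv ((𝓡 3).prod 𝓘(ℝ, ℝ)) (𝓡∂ 4) (uncurry (Γ.openCollar b).toFun) (x, s) (w, 0)) := by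
      show ((-dComplex S.J S.φ).pullback ((𝓡 3).prod 𝓘(ℝ, ℝ)) (uncurry (Γ.openCollar b).toFun))
        (x, s) ![(w, 0)] = _
      rw [MForm.pullback_apply, ← S.liouvilleForm_apply]
      congr 1
      funext i
      fin_cases i
      rfl
    have key2 := (liouvilleForm_pullback S b.isSmoothEmbedding.contMDiff).2.1 x w
    rw [key1, hDF0 w]
    show S.contactForm (Γ.Fl (b.incl x) (collarStretch Γ.a s)) (L (mfderiv (𝓡 3) (𝓡∂ 4) b.incl x w)) = _
    rw [hexp]
    show _ = S.collarFactor Γ b c₀ c₁ x s * ((-dComplex S.J S.φ).pullback (𝓡 3) b.incl) x ![w]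
    rw [key2]
    rfl
  -- identify `m` with the collar factor
  obtain ⟨v₀, hv₀⟩ := S.exists_boundaryContactForm_ne_zero b x
  have hm' : m = S.collarFactor Γ b c₀ c₁ x s := by
    have h1 := hval v₀ 0
    have h2 := hval' v₀
    have h3 : m * S.boundaryContactForm b x ![v₀] =
        S.collarFactor Γ b c₀ c₁ x s * S.boundaryContactForm b x ![v₀] := h1.symm.trans h2
    exact mul_right_cancel₀ hv₀ h3
  rw [← hm']
  exact hval v r

include hD in
/-- **The collar Liouville form read flat, with the explicit factor**: for `u` over the chart
target with `u₀ > 0`, `flatRep (CM^*λ) u = m(chart⁻¹ (tail u), u₀) · b̂_u`.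
[cite: CieliebakEliashberg2012, §2 and §11.1] -/
theorem flatRep_collarLiouvilleForm_eq (h₀ : b.carrier) {u : EuclideanSpace ℝ (Fin 4)}
    (hu : sliceTail u ∈ (extChartAt (𝓡 3) h₀).target) (hu0 : 0 < u 0) :
    flatRep (S.collarLiouvilleForm Γ b) h₀ u =
      S.collarFactor Γ b c₀ c₁ ((extChartAt (𝓡 3) h₀).symm (sliceTail u)) (u 0) •
        covectorToOneForm (flatSliceCovector (S.boundaryContactForm b) h₀ u) := by
  set x' := (extChartAt (𝓡 3) h₀).symm (sliceTail u) with hx'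
  set M₂ := mfderivWithin 𝓘(ℝ, EuclideanSpace ℝ (Fin 3)) (𝓡 3) (extChartAt (𝓡 3) h₀).symm
    (range (𝓡 3)) (sliceTail u) with hM₂
  have hw : ∀ w : Fin 1 → EuclideanSpace ℝ (Fin 4),
      flatRep (S.collarLiouvilleForm Γ b) h₀ u w =
        S.collarFactor Γ b c₀ c₁ x' (u 0) * S.boundaryContactForm b x' ![M₂ (sliceTail (w 0))] :=
    fun w => by
    have hD0 : mfderiv 𝓘(ℝ, EuclideanSpace ℝ (Fin 4)) ((𝓡 3).prod 𝓘(ℝ, ℝ)) (seamChartInv h₀) u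
        (w 0) = (M₂ (sliceTail (w 0)), (w 0) 0) := by
      rw [(hasMFDerivAt_seamChartInv h₀ hu).mfderiv]
      rfl
    set φ : (EuclideanSpace ℝ (Fin 3) × ℝ) [⋀^Fin 1]→L[ℝ] ℝ :=
      (S.collarLiouvilleForm Γ b) (seamChartInv h₀ u) with hφ
    have hA := form_one_apply_eq φ
      (fun i => mfderiv 𝓘(ℝ, EuclideanSpace ℝ (Fin 4)) ((𝓡 3).prod 𝓘(ℝ, ℝ)) (seamChartInv h₀) u (w i))
    have hB := congrArg (fun X => φ ![X]) hD0
    exact (hA.trans hB).trans (S.collarLiouvilleForm_apply_eq hD Γ b x' hu0 (M₂ (sliceTail (w 0))) ((w 0) 0))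
  have hb : ∀ w₀ : EuclideanSpace ℝ (Fin 4),
      flatSliceCovector (S.boundaryContactForm b) h₀ u w₀ =
        S.boundaryContactForm b x' ![M₂ (sliceTail w₀)] := fun w₀ => by
    rw [flatSliceCovector, ContinuousLinearMap.comp_apply, alt1ToCLM_apply, MForm.inChart_apply]
    congr 1
    funext i
    rw [show i = 0 from Subsingleton.elim i 0]
    rfl
  ext w
  refine (hw w).trans ?_
  rw [← hb]
  rfl

include hD in
/-- **The local factor is the collar factor**: on the open set `O` of
`exists_collar_genFoldPrimitive_data`, `m̂ u = m(chart⁻¹ (tail u), u₀)`. [folklore] -/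
theorem mhat_eq_collarFactor (h₀ : b.carrier) {u : EuclideanSpace ℝ (Fin 4)}
    (hu : sliceTail u ∈ (extChartAt (𝓡 3) h₀).target) (hu0 : 0 < u 0)
    {mhat : EuclideanSpace ℝ (Fin 4) → ℝ}
    (hrep : flatRep (S.collarLiouvilleForm Γ b) h₀ u =
      genFoldPrimitive mhat (flatSliceCovector (S.boundaryContactForm b) h₀) u) :
    mhat u = S.collarFactor Γ b c₀ c₁ ((extChartAt (𝓡 3) h₀).symm (sliceTail u)) (u 0) := by
  obtain ⟨w₀, hw₀⟩ := S.exists_flatSliceCovector_ne_zero b h₀ hu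
  have h := hrep.symm.trans (S.flatRep_collarLiouvilleForm_eq hD Γ b h₀ hu hu0)
  have h' := congrArg (fun φ : (EuclideanSpace ℝ (Fin 4)) [⋀^Fin 1]→L[ℝ] ℝ => φ ![w₀]) h
  simp only [genFoldPrimitive, ContinuousAlternatingMap.smul_apply, covectorToOneForm_apply,
    Matrix.cons_val_zero, smul_eq_mul] at h'
  exact mul_right_cancel₀ hw₀ h'

omit [CompactSpace W] [Nonempty b.carrier] in
/-- Translating along the collar direction does not change the tail and shifts `u₀`.
[folklore] -/
theorem sliceTail_add_smul_stdVec (u : EuclideanSpace ℝ (Fin 4)) (r : ℝ) :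
    sliceTail (u + r • stdVec 0) = sliceTail u ∧ (u + r • stdVec 0) 0 = u 0 + r := by
  refine ⟨by rw [map_add, map_smul, sliceTail_stdVec_zero, smul_zero, add_zero], ?_⟩
  simp [stdVec]

/-- **The sign of `∂₀ m̂`**: if `m̂` is differentiable at `u`, agrees near `u` along the collar
direction with the (strictly decreasing) collar factor, and `∂₀ m̂(u) ≠ 0`, then
`∂₀ m̂(u) < 0`. [folklore] -/
theorem fderiv_stdVec_zero_neg_of_antitone {mhat : EuclideanSpace ℝ (Fin 4) → ℝ}
    {u : EuclideanSpace ℝ (Fin 4)} (hd : DifferentiableAt ℝ mhat u)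
    (hanti : ∀ᶠ r in 𝓝[>] (0 : ℝ), mhat (u + r • stdVec 0) ≤ mhat u)
    (hne : fderiv ℝ mhat u (stdVec 0) ≠ 0) : fderiv ℝ mhat u (stdVec 0) < 0 := by
  have h1 : HasDerivAt (fun r : ℝ => mhat (u + r • stdVec 0)) (fderiv ℝ mhat u (stdVec 0)) 0 := by
    have hl : HasDerivAt (fun r : ℝ => u + r • stdVec 0) (stdVec 0) 0 := by
      simpa using ((hasDerivAt_id (0 : ℝ)).smul_const (stdVec 0 : EuclideanSpace ℝ (Fin 4))).const_add u
    have h0 : HasFDerivAt mhat (fderiv ℝ mhat u) (u + (0 : ℝ) • stdVec 0) := by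
      rw [zero_smul, add_zero]; exact hd.hasFDerivAt
    exact h0.comp_hasDerivAt 0 hl
  have h2 : Tendsto (slope (fun r : ℝ => mhat (u + r • stdVec 0)) 0) (𝓝[>] (0 : ℝ))
      (𝓝 (fderiv ℝ mhat u (stdVec 0))) :=
    (hasDerivAt_iff_tendsto_slope.1 h1).mono_left (nhdsWithin_mono _ fun r hr => ne_of_gt hr)
  have h3 : ∀ᶠ r in 𝓝[>] (0 : ℝ), slope (fun r : ℝ => mhat (u + r • stdVec 0)) 0 r ≤ 0 := by
    filter_upwards [hanti, self_mem_nhdsWithin] with r hr hr0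
    rw [slope_def_field]
    simp only [zero_smul, add_zero, sub_zero]
    exact div_nonpos_of_nonpos_of_nonneg (by linarith) (le_of_lt hr0)
  have h4 : fderiv ℝ mhat u (stdVec 0) ≤ 0 := le_of_tendsto h2 h3
  exact lt_of_le_of_ne h4 hne

end SteinStructure

end CollarFactorFlat


/-! ### The flat collar factor, globally over a chart

`flatCollarFactor h₀ u = m(chart⁻¹ (tail u), u₀)`: over `U⁺ = {tail u ∈ chart target, u₀ > 0}`
it is `C^∞`, positive, at most `1`, strictly decreasing in `u₀` with `∂₀ < 0`, and
`flatRep (CM^*λ) = genFoldPrimitive (flatCollarFactor) b̂` there; the slice contact volume of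
`b̂` is non-zero over the whole chart target. -/

section FlatCollarFactor

/-- **Smoothness of a proportionality factor**: if, on an open set `U` over the chart target,
the flat representative of a `1`-form `α` (smooth at the corresponding points) is `f · b̂` for the
flat slice covector `b̂` of a smooth nowhere-zero `1`-form `β`, then `f` is `C^∞` on `U` (locally
`f = ℓ(w₀)/b̂(w₀)`). [folklore] -/
theorem contDiffOn_factor_of_flatRep_eq {H : Type*} [TopologicalSpace H]
    [ChartedSpace (EuclideanSpace ℝ (Fin 3)) H] [IsManifold (𝓡 3) ∞ H]
    {α : MForm ((𝓡 3).prod 𝓘(ℝ, ℝ)) (H × ℝ) ℝ 1} {β : MForm (𝓡 3) H ℝ 1} (hβ : IsSmoothForm β)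
    (hβ0 : ∀ x, ∃ v : EuclideanSpace ℝ (Fin 3), β x ![v] ≠ 0) (h₀ : H)
    {U : Set (EuclideanSpace ℝ (Fin 4))} (hU : IsOpen U)
    (hUsub : U ⊆ {u | sliceTail u ∈ (extChartAt (𝓡 3) h₀).target})
    (hα : ∀ u ∈ U, α.SmoothAt (seamChartInv h₀ u)) {f : EuclideanSpace ℝ (Fin 4) → ℝ}
    (hf : ∀ u ∈ U, flatRep α h₀ u = f u • covectorToOneForm (flatSliceCovector β h₀ u)) :
    ContDiffOn ℝ ∞ f U := by
  intro u₀ hu₀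
  -- a vector on which `b̂_{u₀}` does not vanish
  have hex : ∃ w : EuclideanSpace ℝ (Fin 4), flatSliceCovector β h₀ u₀ w ≠ 0 := by
    set x' := (extChartAt (𝓡 3) h₀).symm (sliceTail u₀) with hx'
    obtain ⟨v, hv⟩ := hβ0 x'
    set M₂ := mfderivWithin 𝓘(ℝ, EuclideanSpace ℝ (Fin 3)) (𝓡 3) (extChartAt (𝓡 3) h₀).symm
      (range (𝓡 3)) (sliceTail u₀) with hM₂
    have hM₂inv : M₂.IsInvertible := isInvertible_mfderivWithin_extChartAt_symm (hUsub hu₀)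
    obtain ⟨a, ha⟩ := hM₂inv.surjective v
    refine ⟨BoundaryManifold.consCLE 3 (a, 0), ?_⟩
    rw [flatSliceCovector, ContinuousLinearMap.comp_apply, sliceTail_consCLE, alt1ToCLM_apply,
      MForm.inChart_apply]
    have hvec : (fun i => mfderivWithin 𝓘(ℝ, EuclideanSpace ℝ (Fin 3)) (𝓡 3) (extChartAt (𝓡 3) h₀).symm
        (range (𝓡 3)) (sliceTail u₀) ((![a] : Fin 1 → EuclideanSpace ℝ (Fin 3)) i)) = ![v] := by
      funext i
      rw [show i = 0 from Subsingleton.elim i 0]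
      simp only [Matrix.cons_val_zero]
      exact ha
    rw [hvec]
    exact hv
  obtain ⟨w₀, hw₀⟩ := hex
  have hb : ContDiffOn ℝ ∞ (flatSliceCovector β h₀) U :=
    (contDiffOn_flatSliceCovector hβ h₀).mono hUsub
  have hbw : ContinuousOn (fun u => flatSliceCovector β h₀ u w₀) U :=
    hb.continuousOn.clm_apply continuousOn_const
  set O : Set (EuclideanSpace ℝ (Fin 4)) := U ∩ (fun u => flatSliceCovector β h₀ u w₀) ⁻¹' {r | r ≠ 0}
    with hOdef
  have hO : IsOpen O := hbw.isOpen_inter_preimage hU isOpen_ne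
  have hu₀O : u₀ ∈ O := ⟨hu₀, hw₀⟩
  -- on `O`, `f = ℓ(w₀) / b̂(w₀)`
  have hq : ∀ u ∈ O, f u = flatRep α h₀ u ![w₀] / flatSliceCovector β h₀ u w₀ := fun u hu => by
    have h := congrArg (fun φ : (EuclideanSpace ℝ (Fin 4)) [⋀^Fin 1]→L[ℝ] ℝ => φ ![w₀]) (hf u hu.1)
    simp only [ContinuousAlternatingMap.smul_apply, covectorToOneForm_apply, Matrix.cons_val_zero,
      smul_eq_mul] at h
    rw [eq_div_iff (show flatSliceCovector β h₀ u w₀ ≠ 0 from hu.2)]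
    exact h.symm
  have hsm : ∀ u ∈ O, @ContDiffAt ℝ _ (EuclideanSpace ℝ (Fin 4)) _ _
      ((EuclideanSpace ℝ (Fin 4)) [⋀^Fin 1]→L[ℝ] ℝ) _ _ ∞ (flatRep α h₀) u := fun u hu =>
    (MForm.smoothAt_model_iff (flatRep α h₀) u).1 (smoothAt_flatRep h₀ (hUsub hu.1) (hα u hu.1))
  have hcd : ContDiffOn ℝ ∞ (fun u => flatRep α h₀ u ![w₀] / flatSliceCovector β h₀ u w₀) O := by
    intro u hu
    have h1 : ContDiffAt ℝ ∞ (fun u => flatRep α h₀ u ![w₀]) u :=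
      (contDiff_alt_one_eval ![w₀]).contDiffAt.comp u (hsm u hu)
    have h2 : ContDiffAt ℝ ∞ (fun u => flatSliceCovector β h₀ u w₀) u :=
      ((hb u hu.1).contDiffAt (hU.mem_nhds hu.1)).clm_apply contDiffAt_const
    exact (h1.div h2 hu.2).contDiffWithinAt
  have hfO : ContDiffOn ℝ ∞ f O := hcd.congr fun u hu => hq u hu
  exact ((hfO u₀ hu₀O).contDiffAt (hO.mem_nhds hu₀O)).contDiffWithinAt

/-- The flat representative of the slice form `π^*β` is the flat slice covector. [folklore] -/
theorem flatRep_sliceForm {H : Type*} [TopologicalSpace H]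
    [ChartedSpace (EuclideanSpace ℝ (Fin 3)) H] [IsManifold (𝓡 3) ∞ H]
    (β : MForm (𝓡 3) H ℝ 1) (h₀ : H) {u : EuclideanSpace ℝ (Fin 4)}
    (hu : sliceTail u ∈ (extChartAt (𝓡 3) h₀).target) :
    flatRep (sliceForm β) h₀ u = covectorToOneForm (flatSliceCovector β h₀ u) := by
  set M₂ := mfderivWithin 𝓘(ℝ, EuclideanSpace ℝ (Fin 3)) (𝓡 3) (extChartAt (𝓡 3) h₀).symm
    (range (𝓡 3)) (sliceTail u) with hM₂
  have hw : ∀ w : Fin 1 → EuclideanSpace ℝ (Fin 4), flatRep (sliceForm β) h₀ u w =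
      β ((extChartAt (𝓡 3) h₀).symm (sliceTail u)) ![M₂ (sliceTail (w 0))] := fun w => by
    have hD0 : mfderiv 𝓘(ℝ, EuclideanSpace ℝ (Fin 4)) ((𝓡 3).prod 𝓘(ℝ, ℝ)) (seamChartInv h₀) u
        (w 0) = (M₂ (sliceTail (w 0)), (w 0) 0) := by
      rw [(hasMFDerivAt_seamChartInv h₀ hu).mfderiv]
      rfl
    set φ : (EuclideanSpace ℝ (Fin 3) × ℝ) [⋀^Fin 1]→L[ℝ] ℝ := (sliceForm β) (seamChartInv h₀ u)
      with hφ
    have hA := form_one_apply_eq φ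
      (fun i => mfderiv 𝓘(ℝ, EuclideanSpace ℝ (Fin 4)) ((𝓡 3).prod 𝓘(ℝ, ℝ)) (seamChartInv h₀) u (w i))
    have hB := congrArg (fun X => φ ![X]) hD0
    refine (hA.trans hB).trans ?_
    show β ((extChartAt (𝓡 3) h₀).symm (sliceTail u)) (fun i => ((![(M₂ (sliceTail (w 0)), (w 0) 0)] :
      Fin 1 → EuclideanSpace ℝ (Fin 3) × ℝ) i).1) = _
    congr 1
    funext i
    rw [show i = 0 from Subsingleton.elim i 0]
    rfl
  have hb : ∀ w₀ : EuclideanSpace ℝ (Fin 4), flatSliceCovector β h₀ u w₀ =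
      β ((extChartAt (𝓡 3) h₀).symm (sliceTail u)) ![M₂ (sliceTail w₀)] := fun w₀ => by
    rw [flatSliceCovector, ContinuousLinearMap.comp_apply, alt1ToCLM_apply, MForm.inChart_apply]
    congr 1
    funext i
    rw [show i = 0 from Subsingleton.elim i 0]
    rfl
  ext w
  refine (hw w).trans ?_
  rw [← hb]
  rfl

/-- The slice contact volume of `b̂` is invariant under translation in the collar direction
(`b̂` is). [folklore] -/
theorem sliceContactVolume_flatSliceCovector_add_smul {H : Type*} [TopologicalSpace H]
    [ChartedSpace (EuclideanSpace ℝ (Fin 3)) H] (β : MForm (𝓡 3) H ℝ 1) (h₀ : H)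
    (u : EuclideanSpace ℝ (Fin 4)) (r : ℝ) :
    sliceContactVolume (flatSliceCovector β h₀ (u + r • stdVec 0))
        (fderiv ℝ (flatSliceCovector β h₀) (u + r • stdVec 0)) =
      sliceContactVolume (flatSliceCovector β h₀ u) (fderiv ℝ (flatSliceCovector β h₀) u) := by
  have h1 : flatSliceCovector β h₀ (u + r • stdVec 0) = flatSliceCovector β h₀ u :=
    flatSliceCovector_add_smul β h₀ u r
  have h2 : fderiv ℝ (flatSliceCovector β h₀) (u + r • stdVec 0) = fderiv ℝ (flatSliceCovector β h₀) u := by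
    have hcomp : (fun v => flatSliceCovector β h₀ (v + r • stdVec 0)) = flatSliceCovector β h₀ := by
      funext v; exact flatSliceCovector_add_smul β h₀ v r
    rw [← fderiv_comp_add_right (r • stdVec 0), hcomp]
  rw [h1, h2]

namespace SteinStructure

variable {W : Type*} [TopologicalSpace W] [ChartedSpace (EuclideanHalfSpace 4) W]
  [IsManifold (𝓡∂ 4) ∞ W] [CompactSpace W] [T2Space W] (S : SteinStructure W)
  {c₀ c₁ : ℝ} {hc : c₀ < c₁} {hc₁ : c₁ < sSup (range S.φ)}
  {hreg : ∀ x, c₀ ≤ S.φ x → S.dφ x ≠ 0} {D : FlowoutInput 3 W}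
  (hD : D = S.liouvilleFlowout hc hc₁ hreg) (Γ : D.Cover)
  (b : BoundaryData (𝓡∂ 4) W (𝓡 3)) [Nonempty b.carrier]

/-- **The flat collar factor** over the chart at `h₀`: `u ↦ m(chart⁻¹ (tail u), u₀)`.
[folklore] -/
def flatCollarFactor (c₀ c₁ : ℝ) (h₀ : b.carrier) (u : EuclideanSpace ℝ (Fin 4)) : ℝ :=
  S.collarFactor Γ b c₀ c₁ ((extChartAt (𝓡 3) h₀).symm (sliceTail u)) (u 0)

omit [Nonempty b.carrier] in
/-- The flat collar factor is positive. [folklore] -/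
theorem flatCollarFactor_pos (c₀ c₁ : ℝ) (h₀ : b.carrier) (u : EuclideanSpace ℝ (Fin 4)) :
    0 < S.flatCollarFactor Γ b c₀ c₁ h₀ u :=
  S.collarFactor_pos Γ b c₀ c₁ _ _

omit [Nonempty b.carrier] in
include hD in
/-- The flat collar factor is at most `1` for `u₀ ≥ 0` (it is `1` at `u₀ = 0` and decreases).
[folklore] -/
theorem flatCollarFactor_le_one (h₀ : b.carrier) {u : EuclideanSpace ℝ (Fin 4)} (hu0 : 0 ≤ u 0) :
    S.flatCollarFactor Γ b c₀ c₁ h₀ u ≤ 1 := by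
  have h0 : S.collarFactor Γ b c₀ c₁ ((extChartAt (𝓡 3) h₀).symm (sliceTail u)) 0 = 1 := by
    simp [collarFactor, collarStretch_zero]
  rcases hu0.eq_or_lt with h | h
  · show S.collarFactor Γ b c₀ c₁ _ (u 0) ≤ 1
    rw [← h, h0]
  · have := S.collarFactor_lt_collarFactor hD Γ b ((extChartAt (𝓡 3) h₀).symm (sliceTail u)) le_rfl h
    rw [h0] at this
    exact this.le

omit [Nonempty b.carrier] in
include hD in
/-- The flat collar factor decreases strictly in the collar direction (`u₀ ≥ 0`, `r > 0`).
[folklore] -/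
theorem flatCollarFactor_add_smul_lt (h₀ : b.carrier) {u : EuclideanSpace ℝ (Fin 4)} (hu0 : 0 ≤ u 0)
    {r : ℝ} (hr : 0 < r) :
    S.flatCollarFactor Γ b c₀ c₁ h₀ (u + r • stdVec 0) < S.flatCollarFactor Γ b c₀ c₁ h₀ u := by
  obtain ⟨h1, h2⟩ := sliceTail_add_smul_stdVec u r
  unfold flatCollarFactor
  rw [h1, h2]
  exact S.collarFactor_lt_collarFactor hD Γ b _ hu0 (by linarith)

include hD in
/-- **`flatRep (CM^*λ) = genFoldPrimitive (flatCollarFactor) b̂`** over `U⁺`. [folklore] -/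
theorem flatRep_collarLiouvilleForm_eq_genFoldPrimitive (h₀ : b.carrier)
    {u : EuclideanSpace ℝ (Fin 4)} (hu : sliceTail u ∈ (extChartAt (𝓡 3) h₀).target)
    (hu0 : 0 < u 0) :
    flatRep (S.collarLiouvilleForm Γ b) h₀ u =
      genFoldPrimitive (S.flatCollarFactor Γ b c₀ c₁ h₀)
        (flatSliceCovector (S.boundaryContactForm b) h₀) u :=
  S.flatRep_collarLiouvilleForm_eq hD Γ b h₀ hu hu0

include hD in
/-- **The flat collar factor is `C^∞` over `U⁺`.** [folklore] -/
theorem contDiffOn_flatCollarFactor (h₀ : b.carrier) :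
    ContDiffOn ℝ ∞ (S.flatCollarFactor Γ b c₀ c₁ h₀)
      {u | sliceTail u ∈ (extChartAt (𝓡 3) h₀).target ∧ 0 < u 0} := by
  have hU : IsOpen {u : EuclideanSpace ℝ (Fin 4) | sliceTail u ∈ (extChartAt (𝓡 3) h₀).target ∧ 0 < u 0} :=
    (isOpen_sliceTail_preimage_target (H := b.carrier) h₀).inter
      (isOpen_lt continuous_const ((EuclideanSpace.proj (0 : Fin 4)).continuous))
  refine contDiffOn_factor_of_flatRep_eq (S.isSmoothForm_boundaryContactForm b)
    (S.exists_boundaryContactForm_ne_zero b) h₀ hU (fun u hu => hu.1)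
    (fun u hu => S.smoothAt_collarLiouvilleForm Γ b _ hu.2) fun u hu => ?_
  exact S.flatRep_collarLiouvilleForm_eq hD Γ b h₀ hu.1 hu.2

include hD in
/-- **`∂₀ (flatCollarFactor) < 0` over `U⁺`** (strict decrease, and `∂₀ ≠ 0` from the
non-degeneracy of the collar form). [cite: Baykur2006, proof of Thm. 6.1] -/
theorem fderiv_flatCollarFactor_stdVec_zero_neg (h₀ : b.carrier)
    {u : EuclideanSpace ℝ (Fin 4)} (hu : sliceTail u ∈ (extChartAt (𝓡 3) h₀).target)
    (hu0 : 0 < u 0) :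
    fderiv ℝ (S.flatCollarFactor Γ b c₀ c₁ h₀) u (stdVec 0) < 0 := by
  obtain ⟨O, hO, huO, hOsub, mhat, hmhat, -, hrep, hd0, -⟩ :=
    S.exists_collar_genFoldPrimitive_data hD Γ b h₀ hu hu0
  -- `mhat = flatCollarFactor` on `O`
  have heq : ∀ u' ∈ O, mhat u' = S.flatCollarFactor Γ b c₀ c₁ h₀ u' := fun u' hu' =>
    S.mhat_eq_collarFactor hD Γ b h₀ (hOsub hu').1 (hOsub hu').2 (hrep u' hu')
  have hev : mhat =ᶠ[𝓝 u] S.flatCollarFactor Γ b c₀ c₁ h₀ := by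
    filter_upwards [hO.mem_nhds huO] with u' hu'
    exact heq u' hu'
  have hfd : fderiv ℝ (S.flatCollarFactor Γ b c₀ c₁ h₀) u = fderiv ℝ mhat u := (hev.fderiv_eq).symm
  rw [hfd]
  have hd : DifferentiableAt ℝ mhat u :=
    ((hmhat u huO).contDiffAt (hO.mem_nhds huO)).differentiableAt (by simp)
  refine fderiv_stdVec_zero_neg_of_antitone hd ?_ (hd0 u huO)
  -- along the collar direction `mhat` agrees with the decreasing collar factor
  have hline : Tendsto (fun r : ℝ => u + r • stdVec 0) (𝓝[>] (0 : ℝ)) (𝓝 u) := by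
    have : Tendsto (fun r : ℝ => u + r • stdVec 0) (𝓝 (0 : ℝ)) (𝓝 (u + (0 : ℝ) • stdVec 0)) :=
      ((continuous_const.add (continuous_id.smul continuous_const)).tendsto 0)
    rw [zero_smul, add_zero] at this
    exact this.mono_left nhdsWithin_le_nhds
  have hmem : ∀ᶠ r in 𝓝[>] (0 : ℝ), u + r • stdVec 0 ∈ O := hline (hO.mem_nhds huO)
  filter_upwards [hmem, self_mem_nhdsWithin] with r hr hr0
  rw [heq _ hr, heq _ huO]
  exact (S.flatCollarFactor_add_smul_lt hD Γ b h₀ hu0.le hr0).le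

include Γ hD in
/-- **The slice contact volume of `b̂` is non-zero over the whole chart target** (it does not
depend on `u₀`; at `u₀ > 0` it is a factor of the non-zero Pfaffian of the collar form, whose
existence uses the cover `Γ`). [folklore] -/
theorem sliceContactVolume_flatSliceCovector_ne_zero (h₀ : b.carrier)
    {u : EuclideanSpace ℝ (Fin 4)} (hu : sliceTail u ∈ (extChartAt (𝓡 3) h₀).target) :
    sliceContactVolume (flatSliceCovector (S.boundaryContactForm b) h₀ u)
      (fderiv ℝ (flatSliceCovector (S.boundaryContactForm b) h₀) u) ≠ 0 := by
  -- move to `u₀ = 1 > 0`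
  set u' := u + (1 - u 0) • stdVec 0 with hu'
  obtain ⟨h1, h2⟩ := sliceTail_add_smul_stdVec u (1 - u 0)
  have hu'0 : 0 < u' 0 := by rw [hu', h2]; linarith
  have hu't : sliceTail u' ∈ (extChartAt (𝓡 3) h₀).target := by rw [hu', h1]; exact hu
  obtain ⟨O, -, huO, -, -, -, -, -, -, hvol⟩ :=
    S.exists_collar_genFoldPrimitive_data hD Γ b h₀ hu't hu'0
  have h := hvol u' huO
  rwa [hu', sliceContactVolume_flatSliceCovector_add_smul] at h

end SteinStructure

end FlatCollarFactor


/-! ### Time reversal on the seam piece and its flat counterpart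

The second piece of the gluing enters the seam piece with the collar parameter reversed
(`jN (CN x s) = σ (x, -s)`); flat, this is the linear reflection `u ↦ u - 2u₀e₀` of `ℝ⁴`, which
preserves the slices and the slice covector fields. -/

section Reflection

variable {H : Type*} [TopologicalSpace H] [ChartedSpace (EuclideanSpace ℝ (Fin 3)) H]

/-- Time reversal `(x, s) ↦ (x, -s)` on the seam piece. [folklore] -/
def seamFlip (p : H × ℝ) : H × ℝ := (p.1, -p.2)

omit [TopologicalSpace H] [ChartedSpace (EuclideanSpace ℝ (Fin 3)) H] in
/-- Unfolding `seamFlip`. [folklore] -/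
@[simp] theorem seamFlip_apply (p : H × ℝ) : seamFlip p = (p.1, -p.2) := rfl

/-- The flat time reversal `u ↦ u - 2 u₀ e₀` (negate the collar coordinate). [folklore] -/
def flatFlip : EuclideanSpace ℝ (Fin 4) →L[ℝ] EuclideanSpace ℝ (Fin 4) :=
  ContinuousLinearMap.id ℝ _ -
    (2 : ℝ) • (EuclideanSpace.proj (0 : Fin 4) : EuclideanSpace ℝ (Fin 4) →L[ℝ] ℝ).smulRight (stdVec 0)

/-- Unfolding `flatFlip`. [folklore] -/
theorem flatFlip_apply (u : EuclideanSpace ℝ (Fin 4)) : flatFlip u = u - (2 * u 0) • stdVec 0 := by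
  simp [flatFlip, smul_smul]

/-- `flatFlip u = u + (-2 u₀) • e₀`. [folklore] -/
theorem flatFlip_eq_add_smul (u : EuclideanSpace ℝ (Fin 4)) :
    flatFlip u = u + (-(2 * u 0)) • stdVec 0 := by
  rw [flatFlip_apply, sub_eq_add_neg, neg_smul]

/-- The reflection preserves the tail. [folklore] -/
@[simp] theorem sliceTail_flatFlip (u : EuclideanSpace ℝ (Fin 4)) : sliceTail (flatFlip u) = sliceTail u := by
  rw [flatFlip_eq_add_smul]
  exact (SteinStructure.sliceTail_add_smul_stdVec u _).1

/-- The reflection negates the collar coordinate. [folklore] -/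
@[simp] theorem flatFlip_apply_zero (u : EuclideanSpace ℝ (Fin 4)) : flatFlip u 0 = -u 0 := by
  rw [flatFlip_eq_add_smul, (SteinStructure.sliceTail_add_smul_stdVec u _).2]
  ring

/-- The reflection negates `e₀`. [folklore] -/
@[simp] theorem flatFlip_stdVec_zero : flatFlip (stdVec 0) = -stdVec 0 := by
  rw [flatFlip_apply]
  have : (stdVec 0 : EuclideanSpace ℝ (Fin 4)) 0 = 1 := by simp [stdVec]
  rw [this]
  simp [two_smul]

/-- `flatFlip (u + r e₀) = flatFlip u - r e₀`. [folklore] -/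
theorem flatFlip_add_smul (u : EuclideanSpace ℝ (Fin 4)) (r : ℝ) :
    flatFlip (u + r • stdVec 0) = flatFlip u + (-r) • stdVec 0 := by
  rw [map_add, map_smul, flatFlip_stdVec_zero, smul_neg, neg_smul]

/-- The inverse product chart intertwines the two reversals: `κ⁻¹ ∘ R₀ = ν ∘ κ⁻¹`. [folklore] -/
theorem seamChartInv_flatFlip (h₀ : H) (u : EuclideanSpace ℝ (Fin 4)) :
    seamChartInv h₀ (flatFlip u) = seamFlip (seamChartInv h₀ u) := by
  simp only [seamChartInv, sliceTail_flatFlip, flatFlip_apply_zero, seamFlip_apply]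

/-- As functions, `κ⁻¹ ∘ R₀ = ν ∘ κ⁻¹`. [folklore] -/
theorem seamChartInv_comp_flatFlip (h₀ : H) :
    (seamChartInv h₀ ∘ fun u => flatFlip u) = (seamFlip ∘ seamChartInv h₀) := by
  funext u
  exact seamChartInv_flatFlip h₀ u

/-- The slice covector field is invariant under the reflection. [folklore] -/
theorem flatSliceCovector_flatFlip (β : MForm (𝓡 3) H ℝ 1) (h₀ : H) (u : EuclideanSpace ℝ (Fin 4)) :
    flatSliceCovector β h₀ (flatFlip u) = flatSliceCovector β h₀ u := by
  simp only [flatSliceCovector, sliceTail_flatFlip]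

/-- The slice covectors kill the reflection's correction: `b̂_u (R₀ w) = b̂_u (w)`. [folklore] -/
theorem flatSliceCovector_apply_flatFlip (β : MForm (𝓡 3) H ℝ 1) (h₀ : H)
    (u w : EuclideanSpace ℝ (Fin 4)) :
    flatSliceCovector β h₀ u (flatFlip w) = flatSliceCovector β h₀ u w := by
  simp only [flatSliceCovector, ContinuousLinearMap.comp_apply, sliceTail_flatFlip]

/-- Time reversal is smooth. [folklore] -/
theorem contMDiff_seamFlip :
    ContMDiff ((𝓡 3).prod 𝓘(ℝ, ℝ)) ((𝓡 3).prod 𝓘(ℝ, ℝ)) ∞ (seamFlip : H × ℝ → H × ℝ) :=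
  contMDiff_fst.prodMk (contDiff_neg.contMDiff.comp contMDiff_snd)

variable [IsManifold (𝓡 3) ∞ H]

/-- **The flat representative of a time-reversed form is the reflection pull-back of the flat
representative**: `flatRep (ν^*α) = R₀^*(flatRep α)` over the chart target. [folklore] -/
theorem flatRep_pullback_seamFlip {k : ℕ} (α : MForm ((𝓡 3).prod 𝓘(ℝ, ℝ)) (H × ℝ) ℝ k) (h₀ : H)
    {u : EuclideanSpace ℝ (Fin 4)} (hu : sliceTail u ∈ (extChartAt (𝓡 3) h₀).target) :
    flatRep (α.pullback ((𝓡 3).prod 𝓘(ℝ, ℝ)) seamFlip) h₀ u =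
      ((flatRep α h₀).pullback 𝓘(ℝ, EuclideanSpace ℝ (Fin 4)) (fun u => flatFlip u)) u := by
  have hu' : sliceTail (flatFlip u) ∈ (extChartAt (𝓡 3) h₀).target := by rwa [sliceTail_flatFlip]
  have hκ : MDifferentiableAt 𝓘(ℝ, EuclideanSpace ℝ (Fin 4)) ((𝓡 3).prod 𝓘(ℝ, ℝ)) (seamChartInv h₀) u :=
    (hasMFDerivAt_seamChartInv h₀ hu).mdifferentiableAt
  have hκ' : MDifferentiableAt 𝓘(ℝ, EuclideanSpace ℝ (Fin 4)) ((𝓡 3).prod 𝓘(ℝ, ℝ)) (seamChartInv h₀)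
      (flatFlip u) := (hasMFDerivAt_seamChartInv h₀ hu').mdifferentiableAt
  have hν : MDifferentiableAt ((𝓡 3).prod 𝓘(ℝ, ℝ)) ((𝓡 3).prod 𝓘(ℝ, ℝ)) (seamFlip : H × ℝ → H × ℝ)
      (seamChartInv h₀ u) := contMDiff_seamFlip.mdifferentiableAt (by simp)
  have hR : HasMFDerivAt 𝓘(ℝ, EuclideanSpace ℝ (Fin 4)) 𝓘(ℝ, EuclideanSpace ℝ (Fin 4))
      (fun u => flatFlip u) u flatFlip := hasMFDerivAt_iff_hasFDerivAt.2 flatFlip.hasFDerivAt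
  -- the two composites have the same differential
  have h1 : mfderiv 𝓘(ℝ, EuclideanSpace ℝ (Fin 4)) ((𝓡 3).prod 𝓘(ℝ, ℝ)) (seamFlip ∘ seamChartInv h₀) u =
      (mfderiv ((𝓡 3).prod 𝓘(ℝ, ℝ)) ((𝓡 3).prod 𝓘(ℝ, ℝ)) seamFlip (seamChartInv h₀ u)).comp
        (mfderiv 𝓘(ℝ, EuclideanSpace ℝ (Fin 4)) ((𝓡 3).prod 𝓘(ℝ, ℝ)) (seamChartInv h₀) u) :=
    mfderiv_comp u hν hκ
  have h2 : mfderiv 𝓘(ℝ, EuclideanSpace ℝ (Fin 4)) ((𝓡 3).prod 𝓘(ℝ, ℝ)) (seamChartInv h₀ ∘ fun u => flatFlip u) u =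
      (mfderiv 𝓘(ℝ, EuclideanSpace ℝ (Fin 4)) ((𝓡 3).prod 𝓘(ℝ, ℝ)) (seamChartInv h₀) (flatFlip u)).comp
        flatFlip := by
    rw [mfderiv_comp u hκ' hR.mdifferentiableAt, hR.mfderiv]
    rfl
  have h12 : (mfderiv ((𝓡 3).prod 𝓘(ℝ, ℝ)) ((𝓡 3).prod 𝓘(ℝ, ℝ)) seamFlip (seamChartInv h₀ u)).comp
        (mfderiv 𝓘(ℝ, EuclideanSpace ℝ (Fin 4)) ((𝓡 3).prod 𝓘(ℝ, ℝ)) (seamChartInv h₀) u) =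
      (mfderiv 𝓘(ℝ, EuclideanSpace ℝ (Fin 4)) ((𝓡 3).prod 𝓘(ℝ, ℝ)) (seamChartInv h₀) (flatFlip u)).comp
        flatFlip := by
    rw [← h1, ← h2, seamChartInv_comp_flatFlip]
  ext V
  show (α.pullback ((𝓡 3).prod 𝓘(ℝ, ℝ)) seamFlip) (seamChartInv h₀ u)
      (fun i => mfderiv 𝓘(ℝ, EuclideanSpace ℝ (Fin 4)) ((𝓡 3).prod 𝓘(ℝ, ℝ)) (seamChartInv h₀) u (V i)) =
    flatRep α h₀ (flatFlip u)
      (fun i => mfderiv 𝓘(ℝ, EuclideanSpace ℝ (Fin 4)) 𝓘(ℝ, EuclideanSpace ℝ (Fin 4)) (fun u => flatFlip u) u (V i))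
  rw [MForm.pullback_apply, flatRep_apply, hR.mfderiv,
    MForm.apply_congr_point α (seamChartInv_flatFlip h₀ u).symm]
  congr 1
  funext i
  have := congrArg (fun T : EuclideanSpace ℝ (Fin 4) →L[ℝ] (EuclideanSpace ℝ (Fin 3) × ℝ) => T (V i)) h12
  exact this

end Reflection


/-! ### The time-reversed, sign-corrected collar form of the second piece, read flat

For the second Stein piece (boundary datum with the SAME carrier `H`, inclusion `incl₂ ∘ ψ`),
the form entering the seam piece for `s < 0` is `ε · ν^*(CN^*λ₂)` with `ν` the time reversal and
`ε = ±1` the sign making `ε g > 0`, `g` the conformal factor `incl'^*λ₂ = g · β₁` relative to the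
first piece's boundary contact form `β₁`.  Read flat over `U⁻ = {tail u ∈ chart target, u₀ < 0}`
it is `n̂ b̂₁` with `n̂ u = ε g · m₂(R₀ u)` positive, bounded, `C^∞`, and `∂₀ n̂ > 0`. -/

section FlippedCollar

namespace SteinStructure

variable {W : Type*} [TopologicalSpace W] [ChartedSpace (EuclideanHalfSpace 4) W]
  [IsManifold (𝓡∂ 4) ∞ W] [CompactSpace W] [T2Space W] (S : SteinStructure W)
  {c₀ c₁ : ℝ} {hc : c₀ < c₁} {hc₁ : c₁ < sSup (range S.φ)}
  {hreg : ∀ x, c₀ ≤ S.φ x → S.dφ x ≠ 0} {D : FlowoutInput 3 W}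
  (hD : D = S.liouvilleFlowout hc hc₁ hreg) (Γ : D.Cover)
  (b : BoundaryData (𝓡∂ 4) W (𝓡 3)) [Nonempty b.carrier]

/-- The time-reversed, sign-corrected collar form `ε · ν^*(CN^*λ)` on the seam piece.
[cite: Baykur2006, proof of Thm. 6.1] -/
def flippedCollarForm (ε : b.carrier → ℝ) : MForm ((𝓡 3).prod 𝓘(ℝ, ℝ)) (b.carrier × ℝ) ℝ 1 :=
  (fun p : b.carrier × ℝ => ε p.1) • (S.collarLiouvilleForm Γ b).pullback ((𝓡 3).prod 𝓘(ℝ, ℝ)) seamFlip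

/-- The flat factor of the flipped collar form: `n̂ u = ε(x') g(x') m(x', -u₀)`,
`x' = chart⁻¹ (tail u)`. [folklore] -/
def flatFlippedFactor (c₀ c₁ : ℝ) (g ε : b.carrier → ℝ) (h₀ : b.carrier)
    (u : EuclideanSpace ℝ (Fin 4)) : ℝ :=
  ε ((extChartAt (𝓡 3) h₀).symm (sliceTail u)) * g ((extChartAt (𝓡 3) h₀).symm (sliceTail u)) *
    S.flatCollarFactor Γ b c₀ c₁ h₀ (flatFlip u)

omit [IsManifold (𝓡∂ 4) ∞ W] [CompactSpace W] [T2Space W] [Nonempty b.carrier] in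
/-- A conformal relation `β = g · β₁` passes to the flat slice covectors. [folklore] -/
theorem flatSliceCovector_eq_smul_of_conformal {β β₁ : MForm (𝓡 3) b.carrier ℝ 1}
    {g : b.carrier → ℝ} (hg : ∀ (x : b.carrier) (w : Fin 1 → EuclideanSpace ℝ (Fin 3)), β x w = g x * β₁ x w)
    (h₀ : b.carrier) (u : EuclideanSpace ℝ (Fin 4)) :
    flatSliceCovector β h₀ u =
      g ((extChartAt (𝓡 3) h₀).symm (sliceTail u)) • flatSliceCovector β₁ h₀ u := by
  ext w
  rw [FunLike.coe_smul, Pi.smul_apply, flatSliceCovector, flatSliceCovector,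
    ContinuousLinearMap.comp_apply, ContinuousLinearMap.comp_apply, alt1ToCLM_apply,
    alt1ToCLM_apply, MForm.inChart_apply, MForm.inChart_apply, smul_eq_mul]
  exact hg _ _

include hD in
/-- **The flipped collar form read flat is `n̂ b̂₁`** over `U⁻`. [cite: Baykur2006, proof of Thm. 6.1] -/
theorem flatRep_flippedCollarForm_eq {β₁ : MForm (𝓡 3) b.carrier ℝ 1} {g : b.carrier → ℝ}
    (hg : ∀ (x : b.carrier) (w : Fin 1 → EuclideanSpace ℝ (Fin 3)),
      S.boundaryContactForm b x w = g x * β₁ x w)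
    (ε : b.carrier → ℝ) (h₀ : b.carrier) {u : EuclideanSpace ℝ (Fin 4)}
    (hu : sliceTail u ∈ (extChartAt (𝓡 3) h₀).target) (hu0 : u 0 < 0) :
    flatRep (S.flippedCollarForm Γ b ε) h₀ u =
      genFoldPrimitive (S.flatFlippedFactor Γ b c₀ c₁ g ε h₀) (flatSliceCovector β₁ h₀) u := by
  set x' := (extChartAt (𝓡 3) h₀).symm (sliceTail u) with hx'
  have hu' : sliceTail (flatFlip u) ∈ (extChartAt (𝓡 3) h₀).target := by rwa [sliceTail_flatFlip]
  have hu'0 : 0 < flatFlip u 0 := by rw [flatFlip_apply_zero]; linarith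
  have hR : HasMFDerivAt 𝓘(ℝ, EuclideanSpace ℝ (Fin 4)) 𝓘(ℝ, EuclideanSpace ℝ (Fin 4))
      (fun u => flatFlip u) u flatFlip := hasMFDerivAt_iff_hasFDerivAt.2 flatFlip.hasFDerivAt
  -- the flat representative of the reversed collar form
  have hrefl := flatRep_pullback_seamFlip (S.collarLiouvilleForm Γ b) h₀ hu
  have hcol := S.flatRep_collarLiouvilleForm_eq hD Γ b h₀ hu' hu'0
  have hconf := flatSliceCovector_eq_smul_of_conformal b hg h₀ u
  -- evaluate on a vector
  ext w
  have h1 : flatRep (S.flippedCollarForm Γ b ε) h₀ u w =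
      ε x' * flatRep ((S.collarLiouvilleForm Γ b).pullback ((𝓡 3).prod 𝓘(ℝ, ℝ)) seamFlip) h₀ u w := rfl
  rw [h1, hrefl, MForm.pullback_apply, hR.mfderiv, hcol]
  rw [sliceTail_flatFlip, flatSliceCovector_flatFlip]
  show ε x' * (S.collarFactor Γ b c₀ c₁ x' (flatFlip u 0) *
      flatSliceCovector (S.boundaryContactForm b) h₀ u (flatFlip (w 0))) =
    S.flatFlippedFactor Γ b c₀ c₁ g ε h₀ u * flatSliceCovector β₁ h₀ u (w 0)
  rw [flatSliceCovector_apply_flatFlip, hconf, FunLike.coe_smul, Pi.smul_apply, smul_eq_mul]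
  show ε x' * (S.collarFactor Γ b c₀ c₁ x' (flatFlip u 0) * (g x' * flatSliceCovector β₁ h₀ u (w 0))) =
    ε x' * g x' * S.collarFactor Γ b c₀ c₁ ((extChartAt (𝓡 3) h₀).symm (sliceTail (flatFlip u)))
      (flatFlip u 0) * flatSliceCovector β₁ h₀ u (w 0)
  rw [sliceTail_flatFlip]
  ring

omit [Nonempty b.carrier] in
/-- The flat factor of the flipped collar is positive when `ε g > 0`. [folklore] -/
theorem flatFlippedFactor_pos {g ε : b.carrier → ℝ} (hεg : ∀ x, 0 < ε x * g x) (h₀ : b.carrier)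
    (u : EuclideanSpace ℝ (Fin 4)) : 0 < S.flatFlippedFactor Γ b c₀ c₁ g ε h₀ u :=
  mul_pos (hεg _) (S.flatCollarFactor_pos Γ b c₀ c₁ h₀ _)

omit [Nonempty b.carrier] in
include hD in
/-- The flat factor of the flipped collar is bounded by a bound of `ε g`, for `u₀ ≤ 0`.
[folklore] -/
theorem flatFlippedFactor_le {g ε : b.carrier → ℝ} (hεg : ∀ x, 0 < ε x * g x) {G : ℝ}
    (hG : ∀ x, ε x * g x ≤ G) (h₀ : b.carrier) {u : EuclideanSpace ℝ (Fin 4)} (hu0 : u 0 ≤ 0) :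
    S.flatFlippedFactor Γ b c₀ c₁ g ε h₀ u ≤ G := by
  have h1 : S.flatCollarFactor Γ b c₀ c₁ h₀ (flatFlip u) ≤ 1 :=
    S.flatCollarFactor_le_one hD Γ b h₀ (by rw [flatFlip_apply_zero]; linarith)
  have h2 := S.flatCollarFactor_pos Γ b c₀ c₁ h₀ (flatFlip u)
  unfold flatFlippedFactor
  nlinarith [hεg ((extChartAt (𝓡 3) h₀).symm (sliceTail u)), hG ((extChartAt (𝓡 3) h₀).symm (sliceTail u))]

/-- The flipped collar form is smooth at the points of `H × (-∞, 0)` (for smooth `ε`).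
[folklore] -/
theorem smoothAt_flippedCollarForm {ε : b.carrier → ℝ} (hε : ContMDiff (𝓡 3) 𝓘(ℝ) ∞ ε)
    (x : b.carrier) {s : ℝ} (hs : s < 0) : (S.flippedCollarForm Γ b ε).SmoothAt (x, s) := by
  have h1 : ContMDiffAt ((𝓡 3).prod 𝓘(ℝ, ℝ)) 𝓘(ℝ) ∞ (fun p : b.carrier × ℝ => ε p.1) (x, s) :=
    (hε x).comp (x, s) contMDiffAt_fst
  have h2 : ((S.collarLiouvilleForm Γ b).pullback ((𝓡 3).prod 𝓘(ℝ, ℝ)) seamFlip).SmoothAt (x, s) :=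
    MForm.SmoothAt.pullback (Eventually.of_forall fun q => contMDiff_seamFlip q)
      (S.smoothAt_collarLiouvilleForm Γ b x (neg_pos.2 hs))
  exact MForm.SmoothAt.fun_smul h1 h2

include hD in
/-- **The flat factor of the flipped collar is `C^∞` over `U⁻`** (for smooth `ε`, smooth
nowhere-zero `β₁` with `incl'^*λ = g β₁`). [folklore] -/
theorem contDiffOn_flatFlippedFactor {β₁ : MForm (𝓡 3) b.carrier ℝ 1} (hβ₁ : IsSmoothForm β₁)
    (hβ₁0 : ∀ x, ∃ v : EuclideanSpace ℝ (Fin 3), β₁ x ![v] ≠ 0) {g : b.carrier → ℝ}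
    (hg : ∀ (x : b.carrier) (w : Fin 1 → EuclideanSpace ℝ (Fin 3)),
      S.boundaryContactForm b x w = g x * β₁ x w)
    {ε : b.carrier → ℝ} (hε : ContMDiff (𝓡 3) 𝓘(ℝ) ∞ ε) (h₀ : b.carrier) :
    ContDiffOn ℝ ∞ (S.flatFlippedFactor Γ b c₀ c₁ g ε h₀)
      {u | sliceTail u ∈ (extChartAt (𝓡 3) h₀).target ∧ u 0 < 0} := by
  have hU : IsOpen {u : EuclideanSpace ℝ (Fin 4) | sliceTail u ∈ (extChartAt (𝓡 3) h₀).target ∧ u 0 < 0} :=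
    (isOpen_sliceTail_preimage_target (H := b.carrier) h₀).inter
      (isOpen_lt ((EuclideanSpace.proj (0 : Fin 4)).continuous) continuous_const)
  refine contDiffOn_factor_of_flatRep_eq hβ₁ hβ₁0 h₀ hU (fun u hu => hu.1)
    (fun u hu => S.smoothAt_flippedCollarForm Γ b hε _ hu.2) fun u hu => ?_
  exact S.flatRep_flippedCollarForm_eq hD Γ b hg ε h₀ hu.1 hu.2

include hD in
/-- **`∂₀ n̂ > 0` over `U⁻`**: along the collar direction `n̂(u + r e₀) = εg · m(R₀u - r e₀)`
increases (`∂₀ m < 0` at `R₀ u ∈ U⁺`). [cite: Baykur2006, proof of Thm. 6.1] -/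
theorem fderiv_flatFlippedFactor_stdVec_zero_pos {β₁ : MForm (𝓡 3) b.carrier ℝ 1}
    (hβ₁ : IsSmoothForm β₁) (hβ₁0 : ∀ x, ∃ v : EuclideanSpace ℝ (Fin 3), β₁ x ![v] ≠ 0)
    {g : b.carrier → ℝ}
    (hg : ∀ (x : b.carrier) (w : Fin 1 → EuclideanSpace ℝ (Fin 3)),
      S.boundaryContactForm b x w = g x * β₁ x w)
    {ε : b.carrier → ℝ} (hε : ContMDiff (𝓡 3) 𝓘(ℝ) ∞ ε) (hεg : ∀ x, 0 < ε x * g x)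
    (h₀ : b.carrier) {u : EuclideanSpace ℝ (Fin 4)}
    (hu : sliceTail u ∈ (extChartAt (𝓡 3) h₀).target) (hu0 : u 0 < 0) :
    0 < fderiv ℝ (S.flatFlippedFactor Γ b c₀ c₁ g ε h₀) u (stdVec 0) := by
  set x' := (extChartAt (𝓡 3) h₀).symm (sliceTail u) with hx'
  set F₂ := S.flatCollarFactor Γ b c₀ c₁ h₀ with hF₂
  have hu' : sliceTail (flatFlip u) ∈ (extChartAt (𝓡 3) h₀).target := by rwa [sliceTail_flatFlip]
  have hu'0 : 0 < flatFlip u 0 := by rw [flatFlip_apply_zero]; linarith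
  -- differentiability of the two factors
  have hU : IsOpen {u : EuclideanSpace ℝ (Fin 4) | sliceTail u ∈ (extChartAt (𝓡 3) h₀).target ∧ u 0 < 0} :=
    (isOpen_sliceTail_preimage_target (H := b.carrier) h₀).inter
      (isOpen_lt ((EuclideanSpace.proj (0 : Fin 4)).continuous) continuous_const)
  have hd : DifferentiableAt ℝ (S.flatFlippedFactor Γ b c₀ c₁ g ε h₀) u :=
    ((S.contDiffOn_flatFlippedFactor hD Γ b hβ₁ hβ₁0 hg hε h₀ u ⟨hu, hu0⟩).contDiffAt
      (hU.mem_nhds ⟨hu, hu0⟩)).differentiableAt (by simp)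
  have hU' : IsOpen {u : EuclideanSpace ℝ (Fin 4) | sliceTail u ∈ (extChartAt (𝓡 3) h₀).target ∧ 0 < u 0} :=
    (isOpen_sliceTail_preimage_target (H := b.carrier) h₀).inter
      (isOpen_lt continuous_const ((EuclideanSpace.proj (0 : Fin 4)).continuous))
  have hdF : DifferentiableAt ℝ F₂ (flatFlip u) :=
    ((S.contDiffOn_flatCollarFactor hD Γ b h₀ (flatFlip u) ⟨hu', hu'0⟩).contDiffAt
      (hU'.mem_nhds ⟨hu', hu'0⟩)).differentiableAt (by simp)
  -- the restriction to the collar line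
  have hline : ∀ r : ℝ, S.flatFlippedFactor Γ b c₀ c₁ g ε h₀ (u + r • stdVec 0) =
      ε x' * g x' * F₂ (flatFlip u + (-r) • stdVec 0) := fun r => by
    unfold flatFlippedFactor
    rw [(sliceTail_add_smul_stdVec u r).1, flatFlip_add_smul]
  have h1 : HasDerivAt (fun r : ℝ => S.flatFlippedFactor Γ b c₀ c₁ g ε h₀ (u + r • stdVec 0))
      (fderiv ℝ (S.flatFlippedFactor Γ b c₀ c₁ g ε h₀) u (stdVec 0)) 0 := by
    have hl : HasDerivAt (fun r : ℝ => u + r • stdVec 0) (stdVec 0) 0 := by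
      simpa using ((hasDerivAt_id (0 : ℝ)).smul_const (stdVec 0 : EuclideanSpace ℝ (Fin 4))).const_add u
    have h0 : HasFDerivAt (S.flatFlippedFactor Γ b c₀ c₁ g ε h₀)
        (fderiv ℝ (S.flatFlippedFactor Γ b c₀ c₁ g ε h₀) u) (u + (0 : ℝ) • stdVec 0) := by
      rw [zero_smul, add_zero]; exact hd.hasFDerivAt
    exact h0.comp_hasDerivAt 0 hl
  have h2 : HasDerivAt (fun r : ℝ => S.flatFlippedFactor Γ b c₀ c₁ g ε h₀ (u + r • stdVec 0))
      (ε x' * g x' * (fderiv ℝ F₂ (flatFlip u) (-(stdVec 0)))) 0 := by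
    have hl : HasDerivAt (fun r : ℝ => flatFlip u + (-r) • stdVec 0) (-(stdVec 0)) 0 := by
      have := ((hasDerivAt_id (0 : ℝ)).neg.smul_const (stdVec 0 : EuclideanSpace ℝ (Fin 4))).const_add
        (flatFlip u)
      simpa using this
    have h0 : HasFDerivAt F₂ (fderiv ℝ F₂ (flatFlip u)) (flatFlip u + (-(0 : ℝ)) • stdVec 0) := by
      rw [neg_zero, zero_smul, add_zero]; exact hdF.hasFDerivAt
    have h3 := (h0.comp_hasDerivAt 0 hl).const_mul (ε x' * g x')
    simp only [Function.comp_def] at h3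
    refine HasDerivAt.congr_of_eventuallyEq h3 (Eventually.of_forall fun r => hline r)
  have heq := h1.unique h2
  rw [heq, map_neg, mul_neg]
  have hneg := S.fderiv_flatCollarFactor_stdVec_zero_neg hD Γ b h₀ hu' hu'0
  nlinarith [hεg x', hneg]

end SteinStructure

end FlippedCollar


/-! ### The cut-offs and the profile `Φ̂ = ρ₊ F₁ + ρ₀ (K - u₀²) + ρ₋ F₂`, flat

Pure real analysis on `ℝ⁴`: with `ρ₊(t) = χ((t - δ)/δ)` (`χ` = `Real.smoothTransition`; `0` for
`t ≤ δ`, `1` for `t ≥ 2δ`), `ρ₋(t) = ρ₊(-t)` and `ρ₀ = 1 - ρ₊ - ρ₋`, the profile interpolating a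
decreasing positive `F₁ ≤ B` on `{u₀ > 0}`, an increasing positive `F₂ ≤ B` on `{u₀ < 0}` and the
cap `K - u₀²` (`K > B + 4δ²`) is `C^∞`, positive, has `∂₀ Φ̂ < 0` for `u₀ > 0`, `> 0` for `u₀ < 0`,
and at `u₀ = 0`: `∂₀Φ̂ = 0`, `Φ̂ = K`, `∂₀∂₀Φ̂ = -2` (Baykur's `t² + 1`, up to orientation). -/

section Profile

/-- The cut-off `ρ₊(t) = χ((t - δ)/δ)`: `0` for `t ≤ δ`, `1` for `t ≥ 2δ`. [folklore] -/
def cutPlus (δ t : ℝ) : ℝ := Real.smoothTransition ((t - δ) / δ)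

/-- `ρ₊ = 0` on `(-∞, δ]`. [folklore] -/
theorem cutPlus_of_le {δ t : ℝ} (hδ : 0 < δ) (ht : t ≤ δ) : cutPlus δ t = 0 :=
  Real.smoothTransition.zero_of_nonpos (div_nonpos_of_nonpos_of_nonneg (by linarith) hδ.le)

/-- `ρ₊ = 1` on `[2δ, ∞)`. [folklore] -/
theorem cutPlus_of_ge {δ t : ℝ} (hδ : 0 < δ) (ht : 2 * δ ≤ t) : cutPlus δ t = 1 :=
  Real.smoothTransition.one_of_one_le ((one_le_div hδ).2 (by linarith))

/-- `0 ≤ ρ₊`. [folklore] -/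
theorem cutPlus_nonneg (δ t : ℝ) : 0 ≤ cutPlus δ t := Real.smoothTransition.nonneg _

/-- `ρ₊ ≤ 1`. [folklore] -/
theorem cutPlus_le_one (δ t : ℝ) : cutPlus δ t ≤ 1 := Real.smoothTransition.le_one _

/-- `ρ₊` is `C^∞` (for `δ ≠ 0`). [folklore] -/
theorem contDiff_cutPlus (δ : ℝ) : ContDiff ℝ ∞ (cutPlus δ) :=
  (Real.smoothTransition.contDiff (n := ⊤)).comp ((contDiff_id.sub contDiff_const).div_const δ)

/-- `ρ₊` is monotone (for `δ > 0`). [folklore] -/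
theorem monotone_cutPlus {δ : ℝ} (hδ : 0 < δ) : Monotone (cutPlus δ) := fun a b hab =>
  Real.smoothTransition.monotone (div_le_div_of_nonneg_right (by linarith) hδ.le)

/-- `ρ₊' ≥ 0`. [folklore] -/
theorem deriv_cutPlus_nonneg {δ : ℝ} (hδ : 0 < δ) (t : ℝ) : 0 ≤ deriv (cutPlus δ) t :=
  (monotone_cutPlus hδ).deriv_nonneg

/-- `ρ₊' = 0` on `(-∞, δ)` (it is locally constant there). [folklore] -/
theorem deriv_cutPlus_of_lt {δ t : ℝ} (hδ : 0 < δ) (ht : t < δ) : deriv (cutPlus δ) t = 0 := by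
  have hev : cutPlus δ =ᶠ[𝓝 t] fun _ => (0 : ℝ) := by
    filter_upwards [(isOpen_lt continuous_id continuous_const).mem_nhds ht] with t' ht'
    exact cutPlus_of_le hδ (le_of_lt ht')
  rw [hev.deriv_eq, deriv_const]

/-- `ρ₊' = 0` on `(2δ, ∞)`. [folklore] -/
theorem deriv_cutPlus_of_gt {δ t : ℝ} (hδ : 0 < δ) (ht : 2 * δ < t) : deriv (cutPlus δ) t = 0 := by
  have hev : cutPlus δ =ᶠ[𝓝 t] fun _ => (1 : ℝ) := by
    filter_upwards [(isOpen_lt continuous_const continuous_id).mem_nhds ht] with t' ht'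
    exact cutPlus_of_ge hδ (le_of_lt ht')
  rw [hev.deriv_eq, deriv_const]

/-- **The flat profile** `Φ̂ u = ρ₊(u₀) F₁ u + (1 - ρ₊(u₀) - ρ₊(-u₀)) (K - u₀²) + ρ₊(-u₀) F₂ u`.
[cite: Baykur2006, proof of Thm. 6.1] -/
def gluedProfile (δ K : ℝ) (F₁ F₂ : EuclideanSpace ℝ (Fin 4) → ℝ) (u : EuclideanSpace ℝ (Fin 4)) : ℝ :=
  cutPlus δ (u 0) * F₁ u + (1 - cutPlus δ (u 0) - cutPlus δ (-(u 0))) * (K - (u 0) ^ 2) +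
    cutPlus δ (-(u 0)) * F₂ u

/-- The profile near the seam `{|u₀| < δ}` is the cap `K - u₀²`. [folklore] -/
theorem gluedProfile_of_abs_lt {δ K : ℝ} (hδ : 0 < δ) {F₁ F₂ : EuclideanSpace ℝ (Fin 4) → ℝ}
    {u : EuclideanSpace ℝ (Fin 4)} (hu : |u 0| < δ) : gluedProfile δ K F₁ F₂ u = K - (u 0) ^ 2 := by
  have h1 : cutPlus δ (u 0) = 0 := cutPlus_of_le hδ (by linarith [le_abs_self (u 0)])
  have h2 : cutPlus δ (-(u 0)) = 0 := cutPlus_of_le hδ (by linarith [neg_abs_le (u 0)])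
  simp [gluedProfile, h1, h2]

/-- The profile on `{u₀ > -δ}`: the `F₂`-term is absent. [folklore] -/
theorem gluedProfile_of_neg_lt {δ K : ℝ} (hδ : 0 < δ) {F₁ F₂ : EuclideanSpace ℝ (Fin 4) → ℝ}
    {u : EuclideanSpace ℝ (Fin 4)} (hu : -δ < u 0) :
    gluedProfile δ K F₁ F₂ u = cutPlus δ (u 0) * F₁ u + (1 - cutPlus δ (u 0)) * (K - (u 0) ^ 2) := by
  have h2 : cutPlus δ (-(u 0)) = 0 := cutPlus_of_le hδ (by linarith)
  simp [gluedProfile, h2]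

/-- The profile on `{u₀ < δ}`: the `F₁`-term is absent. [folklore] -/
theorem gluedProfile_of_lt {δ K : ℝ} (hδ : 0 < δ) {F₁ F₂ : EuclideanSpace ℝ (Fin 4) → ℝ}
    {u : EuclideanSpace ℝ (Fin 4)} (hu : u 0 < δ) :
    gluedProfile δ K F₁ F₂ u = (1 - cutPlus δ (-(u 0))) * (K - (u 0) ^ 2) + cutPlus δ (-(u 0)) * F₂ u := by
  have h1 : cutPlus δ (u 0) = 0 := cutPlus_of_le hδ hu.le
  simp [gluedProfile, h1]

/-- The coordinate `u₀` as a `C^∞` function. [folklore] -/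
theorem contDiff_coord_zero : ContDiff ℝ ∞ fun u : EuclideanSpace ℝ (Fin 4) => u 0 :=
  (EuclideanSpace.proj (0 : Fin 4) : EuclideanSpace ℝ (Fin 4) →L[ℝ] ℝ).contDiff

/-- **The profile is `C^∞`** over an open slab `{tail u ∈ T}` when `F₁`, `F₂` are `C^∞` on its
halves `{u₀ > 0}`, `{u₀ < 0}`. [folklore] -/
theorem contDiffOn_gluedProfile {δ K : ℝ} (hδ : 0 < δ) {F₁ F₂ : EuclideanSpace ℝ (Fin 4) → ℝ}
    {T : Set (EuclideanSpace ℝ (Fin 3))} (hT : IsOpen T)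
    (hF₁ : ContDiffOn ℝ ∞ F₁ {u | sliceTail u ∈ T ∧ 0 < u 0})
    (hF₂ : ContDiffOn ℝ ∞ F₂ {u | sliceTail u ∈ T ∧ u 0 < 0}) :
    ContDiffOn ℝ ∞ (gluedProfile δ K F₁ F₂) {u | sliceTail u ∈ T} := by
  have hρ : ContDiff ℝ ∞ fun u : EuclideanSpace ℝ (Fin 4) => cutPlus δ (u 0) :=
    (contDiff_cutPlus δ).comp contDiff_coord_zero
  have hρm : ContDiff ℝ ∞ fun u : EuclideanSpace ℝ (Fin 4) => cutPlus δ (-(u 0)) :=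
    (contDiff_cutPlus δ).comp contDiff_coord_zero.neg
  have hcap : ContDiff ℝ ∞ fun u : EuclideanSpace ℝ (Fin 4) => K - (u 0) ^ 2 :=
    contDiff_const.sub (contDiff_coord_zero.pow 2)
  -- the `F₁`-term is `C^∞` everywhere on the slab
  have hT4 : IsOpen {u : EuclideanSpace ℝ (Fin 4) | sliceTail u ∈ T} := hT.preimage sliceTail.continuous
  have h1 : ContDiffOn ℝ ∞ (fun u => cutPlus δ (u 0) * F₁ u) {u | sliceTail u ∈ T} := by
    intro u hu
    rcases lt_or_ge 0 (u 0) with hpos | hnp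
    · have hU : IsOpen {u : EuclideanSpace ℝ (Fin 4) | sliceTail u ∈ T ∧ 0 < u 0} :=
        hT4.inter (isOpen_lt continuous_const ((EuclideanSpace.proj (0 : Fin 4)).continuous))
      have hF : ContDiffAt ℝ ∞ F₁ u := (hF₁ u ⟨hu, hpos⟩).contDiffAt (hU.mem_nhds ⟨hu, hpos⟩)
      exact (hρ.contDiffAt.mul hF).contDiffWithinAt
    · -- locally zero on `{u₀ < δ}`
      have hev : (fun u : EuclideanSpace ℝ (Fin 4) => cutPlus δ (u 0) * F₁ u) =ᶠ[𝓝 u] fun _ => 0 := by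
        have ho : IsOpen {u : EuclideanSpace ℝ (Fin 4) | u 0 < δ} :=
          isOpen_lt ((EuclideanSpace.proj (0 : Fin 4)).continuous) continuous_const
        filter_upwards [ho.mem_nhds (show u 0 < δ by linarith)] with u' hu'
        rw [cutPlus_of_le hδ (le_of_lt hu'), zero_mul]
      exact ((contDiffAt_const (c := (0 : ℝ))).congr_of_eventuallyEq hev).contDiffWithinAt
  have h3 : ContDiffOn ℝ ∞ (fun u => cutPlus δ (-(u 0)) * F₂ u) {u | sliceTail u ∈ T} := by
    intro u hu
    rcases lt_or_ge (u 0) 0 with hneg | hnn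
    · have hU : IsOpen {u : EuclideanSpace ℝ (Fin 4) | sliceTail u ∈ T ∧ u 0 < 0} :=
        hT4.inter (isOpen_lt ((EuclideanSpace.proj (0 : Fin 4)).continuous) continuous_const)
      have hF : ContDiffAt ℝ ∞ F₂ u := (hF₂ u ⟨hu, hneg⟩).contDiffAt (hU.mem_nhds ⟨hu, hneg⟩)
      exact (hρm.contDiffAt.mul hF).contDiffWithinAt
    · have hev : (fun u : EuclideanSpace ℝ (Fin 4) => cutPlus δ (-(u 0)) * F₂ u) =ᶠ[𝓝 u] fun _ => 0 := by
        have ho : IsOpen {u : EuclideanSpace ℝ (Fin 4) | -δ < u 0} :=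
          isOpen_lt continuous_const ((EuclideanSpace.proj (0 : Fin 4)).continuous)
        filter_upwards [ho.mem_nhds (show -δ < u 0 by linarith)] with u' hu'
        rw [cutPlus_of_le hδ (by linarith), zero_mul]
      exact ((contDiffAt_const (c := (0 : ℝ))).congr_of_eventuallyEq hev).contDiffWithinAt
  have h2 : ContDiff ℝ ∞ fun u : EuclideanSpace ℝ (Fin 4) =>
      (1 - cutPlus δ (u 0) - cutPlus δ (-(u 0))) * (K - (u 0) ^ 2) :=
    ((contDiff_const.sub hρ).sub hρm).mul hcap
  exact (h1.add h2.contDiffOn).add h3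

/-- **The profile at the seam**: at `u₀ = 0`, `∂₀Φ̂ = 0`, `Φ̂ = K` and `∂₀∂₀Φ̂ = -2`.
[cite: Baykur2006, proof of Thm. 6.1] -/
theorem gluedProfile_seam {δ K : ℝ} (hδ : 0 < δ) {F₁ F₂ : EuclideanSpace ℝ (Fin 4) → ℝ}
    {u : EuclideanSpace ℝ (Fin 4)} (hu0 : u 0 = 0) :
    fderiv ℝ (gluedProfile δ K F₁ F₂) u (stdVec 0) = 0 ∧ gluedProfile δ K F₁ F₂ u = K ∧
      fderiv ℝ (fun y => fderiv ℝ (gluedProfile δ K F₁ F₂) y (stdVec 0)) u (stdVec 0) = -2 := by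
  -- near `u` the profile is the cap
  have ho : IsOpen {y : EuclideanSpace ℝ (Fin 4) | |y 0| < δ} :=
    isOpen_lt (continuous_abs.comp ((EuclideanSpace.proj (0 : Fin 4)).continuous)) continuous_const
  have hmem : ∀ y ∈ {y : EuclideanSpace ℝ (Fin 4) | |y 0| < δ},
      gluedProfile δ K F₁ F₂ y = K - (y 0) ^ 2 := fun y hy => gluedProfile_of_abs_lt hδ hy
  have hu : u ∈ {y : EuclideanSpace ℝ (Fin 4) | |y 0| < δ} := by
    show |u 0| < δ; rw [hu0, abs_zero]; exact hδ
  set P : EuclideanSpace ℝ (Fin 4) →L[ℝ] ℝ := EuclideanSpace.proj (0 : Fin 4) with hP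
  have he0 : P (stdVec 0) = 1 := by simp [hP, stdVec]
  -- derivative of the cap
  have hcapd : ∀ y : EuclideanSpace ℝ (Fin 4),
      HasFDerivAt (fun y : EuclideanSpace ℝ (Fin 4) => K - (y 0) ^ 2) (-((2 * y 0) • P)) y := fun y => by
    have h1 : HasFDerivAt (fun y : EuclideanSpace ℝ (Fin 4) => y 0) P y := P.hasFDerivAt
    have h2 : HasFDerivAt (fun y : EuclideanSpace ℝ (Fin 4) => (y 0) ^ 2) ((2 * y 0) • P) y := by
      simpa using h1.pow 2
    exact h2.const_sub K
  have hfd : ∀ y ∈ {y : EuclideanSpace ℝ (Fin 4) | |y 0| < δ},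
      fderiv ℝ (gluedProfile δ K F₁ F₂) y = -((2 * y 0) • P) := fun y hy => by
    have hev : gluedProfile δ K F₁ F₂ =ᶠ[𝓝 y] fun y => K - (y 0) ^ 2 := by
      filter_upwards [ho.mem_nhds hy] with y' hy'
      exact hmem y' hy'
    rw [hev.fderiv_eq, (hcapd y).fderiv]
  have happ : ∀ y : EuclideanSpace ℝ (Fin 4), (-((2 * y 0) • P)) (stdVec 0) = -(2 * y 0) := fun y => by
    show -((2 * y 0) • P (stdVec 0)) = _
    rw [he0, smul_eq_mul, mul_one]
  refine ⟨?_, ?_, ?_⟩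
  · rw [hfd u hu, happ, hu0]; ring
  · rw [hmem u hu, hu0]; ring
  · have hev : (fun y => fderiv ℝ (gluedProfile δ K F₁ F₂) y (stdVec 0)) =ᶠ[𝓝 u]
        fun y => -(2 * y 0) := by
      filter_upwards [ho.mem_nhds hu] with y hy
      rw [hfd y hy, happ]
    rw [hev.fderiv_eq]
    have h1 : HasFDerivAt (fun y : EuclideanSpace ℝ (Fin 4) => -(2 * y 0)) (-((2 : ℝ) • P)) u :=
      (P.hasFDerivAt.const_mul 2).neg
    rw [h1.fderiv]
    show -((2 : ℝ) • P (stdVec 0)) = -2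
    rw [he0, smul_eq_mul, mul_one]

/-- **The profile off the seam, `u₀ > 0`**: `Φ̂ > 0` and `∂₀Φ̂ < 0`, provided `F₁` is positive,
`≤ B`, differentiable with `∂₀F₁ < 0` at `u`, and `K > B + 4δ²`. [cite: Baykur2006, proof of Thm. 6.1] -/
theorem gluedProfile_pos_side {δ K B : ℝ} (hδ : 0 < δ) (hK : B + 4 * δ ^ 2 < K)
    {F₁ F₂ : EuclideanSpace ℝ (Fin 4) → ℝ} {u : EuclideanSpace ℝ (Fin 4)} (hu0 : 0 < u 0)
    (hF₁d : DifferentiableAt ℝ F₁ u) (hF₁pos : 0 < F₁ u) (hF₁le : F₁ u ≤ B)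
    (hF₁' : fderiv ℝ F₁ u (stdVec 0) < 0)
    (hΦd : DifferentiableAt ℝ (gluedProfile δ K F₁ F₂) u) :
    0 < gluedProfile δ K F₁ F₂ u ∧ fderiv ℝ (gluedProfile δ K F₁ F₂) u (stdVec 0) < 0 := by
  have hB : 0 < B := lt_of_lt_of_le hF₁pos hF₁le
  set t := u 0 with ht
  set ρ := cutPlus δ t with hρ
  have hρ0 : 0 ≤ ρ := cutPlus_nonneg δ t
  have hρ1 : ρ ≤ 1 := cutPlus_le_one δ t
  -- value
  have hval : gluedProfile δ K F₁ F₂ u = ρ * F₁ u + (1 - ρ) * (K - t ^ 2) :=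
    gluedProfile_of_neg_lt hδ (by linarith)
  have hcap : ρ < 1 → 0 < K - t ^ 2 := fun h => by
    have ht2 : t < 2 * δ := by
      by_contra hge
      exact (lt_irrefl (1 : ℝ)) (lt_of_le_of_lt (le_of_eq (cutPlus_of_ge hδ (not_lt.1 hge)).symm) h)
    nlinarith
  refine ⟨?_, ?_⟩
  · rw [hval]
    rcases hρ1.lt_or_eq with h | h
    · nlinarith [hcap h]
    · rw [h]; simpa using hF₁pos
  · -- derivative along the collar line
    have hline : ∀ r : ℝ, -t < r → gluedProfile δ K F₁ F₂ (u + r • stdVec 0) =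
        cutPlus δ (t + r) * F₁ (u + r • stdVec 0) + (1 - cutPlus δ (t + r)) * (K - (t + r) ^ 2) :=
      fun r hr => by
      have h0 : (u + r • stdVec 0) 0 = t + r := (SteinStructure.sliceTail_add_smul_stdVec u r).2
      rw [gluedProfile_of_neg_lt hδ (by rw [h0]; linarith), h0]
    have hev : (fun r : ℝ => gluedProfile δ K F₁ F₂ (u + r • stdVec 0)) =ᶠ[𝓝 0]
        fun r => cutPlus δ (t + r) * F₁ (u + r • stdVec 0) + (1 - cutPlus δ (t + r)) * (K - (t + r) ^ 2) := by
      filter_upwards [(isOpen_lt continuous_const continuous_id).mem_nhds (show -t < (0 : ℝ) by linarith)]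
        with r hr
      exact hline r hr
    -- the derivative of the right-hand side at `0`
    have hρd : HasDerivAt (fun r : ℝ => cutPlus δ (t + r)) (deriv (cutPlus δ) t) 0 := by
      have h : HasDerivAt (cutPlus δ) (deriv (cutPlus δ) t) (t + 0) := by
        rw [add_zero]; exact ((contDiff_cutPlus δ).differentiable (by simp) t).hasDerivAt
      exact h.comp_const_add t 0
    have hF₁l : HasDerivAt (fun r : ℝ => F₁ (u + r • stdVec 0)) (fderiv ℝ F₁ u (stdVec 0)) 0 := by
      have hl : HasDerivAt (fun r : ℝ => u + r • stdVec 0) (stdVec 0) 0 := by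
        simpa using ((hasDerivAt_id (0 : ℝ)).smul_const (stdVec 0 : EuclideanSpace ℝ (Fin 4))).const_add u
      have h0 : HasFDerivAt F₁ (fderiv ℝ F₁ u) (u + (0 : ℝ) • stdVec 0) := by
        rw [zero_smul, add_zero]; exact hF₁d.hasFDerivAt
      exact h0.comp_hasDerivAt 0 hl
    have hcapl : HasDerivAt (fun r : ℝ => K - (t + r) ^ 2) (-(2 * t)) 0 := by
      have h2 : HasDerivAt (fun r : ℝ => t + r) 1 0 := by simpa using (hasDerivAt_id (0 : ℝ)).const_add t
      have := (h2.pow 2).const_sub K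
      simpa using this
    have hrhs : HasDerivAt (fun r : ℝ => cutPlus δ (t + r) * F₁ (u + r • stdVec 0) +
        (1 - cutPlus δ (t + r)) * (K - (t + r) ^ 2))
        (deriv (cutPlus δ) t * F₁ u + cutPlus δ t * fderiv ℝ F₁ u (stdVec 0) +
          (-deriv (cutPlus δ) t * (K - t ^ 2) + (1 - cutPlus δ t) * -(2 * t))) 0 := by
      have h1 := hρd.mul hF₁l
      have h2 := (hρd.const_sub 1).mul hcapl
      have h := h1.add h2
      simp only [zero_smul, add_zero] at h
      exact h
    have hlhs : HasDerivAt (fun r : ℝ => gluedProfile δ K F₁ F₂ (u + r • stdVec 0))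
        (fderiv ℝ (gluedProfile δ K F₁ F₂) u (stdVec 0)) 0 := by
      have hl : HasDerivAt (fun r : ℝ => u + r • stdVec 0) (stdVec 0) 0 := by
        simpa using ((hasDerivAt_id (0 : ℝ)).smul_const (stdVec 0 : EuclideanSpace ℝ (Fin 4))).const_add u
      have h0 : HasFDerivAt (gluedProfile δ K F₁ F₂) (fderiv ℝ (gluedProfile δ K F₁ F₂) u)
          (u + (0 : ℝ) • stdVec 0) := by
        rw [zero_smul, add_zero]; exact hΦd.hasFDerivAt
      exact h0.comp_hasDerivAt 0 hl
    have heq := hlhs.unique (hrhs.congr_of_eventuallyEq hev)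
    rw [heq, ← hρ]
    -- sign analysis
    have hρ' : 0 ≤ deriv (cutPlus δ) t := deriv_cutPlus_nonneg hδ t
    have hterm1 : deriv (cutPlus δ) t * (F₁ u - K + t ^ 2) ≤ 0 := by
      rcases lt_or_ge (2 * δ) t with hgt | hle
      · rw [deriv_cutPlus_of_gt hδ hgt]; simp
      · have : F₁ u - K + t ^ 2 < 0 := by nlinarith
        nlinarith
    have hterm2 : ρ * fderiv ℝ F₁ u (stdVec 0) ≤ 0 := mul_nonpos_of_nonneg_of_nonpos hρ0 hF₁'.le
    have hterm3 : (1 - ρ) * (-(2 * t)) ≤ 0 := by nlinarith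
    rcases hρ0.lt_or_eq with hpos | hzero
    · have : ρ * fderiv ℝ F₁ u (stdVec 0) < 0 := mul_neg_of_pos_of_neg hpos hF₁'
      nlinarith
    · rw [← hzero]
      have : (1 - (0 : ℝ)) * (-(2 * t)) < 0 := by nlinarith
      nlinarith

/-- **The profile off the seam, `u₀ < 0`**: `Φ̂ > 0` and `∂₀Φ̂ > 0`, provided `F₂` is positive,
`≤ B`, differentiable with `∂₀F₂ > 0` at `u`, and `K > B + 4δ²`. [cite: Baykur2006, proof of Thm. 6.1] -/
theorem gluedProfile_neg_side {δ K B : ℝ} (hδ : 0 < δ) (hK : B + 4 * δ ^ 2 < K)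
    {F₁ F₂ : EuclideanSpace ℝ (Fin 4) → ℝ} {u : EuclideanSpace ℝ (Fin 4)} (hu0 : u 0 < 0)
    (hF₂d : DifferentiableAt ℝ F₂ u) (hF₂pos : 0 < F₂ u) (hF₂le : F₂ u ≤ B)
    (hF₂' : 0 < fderiv ℝ F₂ u (stdVec 0))
    (hΦd : DifferentiableAt ℝ (gluedProfile δ K F₁ F₂) u) :
    0 < gluedProfile δ K F₁ F₂ u ∧ 0 < fderiv ℝ (gluedProfile δ K F₁ F₂) u (stdVec 0) := by
  have hB : 0 < B := lt_of_lt_of_le hF₂pos hF₂le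
  set t := u 0 with ht
  set ρ := cutPlus δ (-t) with hρ
  have hρ0 : 0 ≤ ρ := cutPlus_nonneg δ (-t)
  have hρ1 : ρ ≤ 1 := cutPlus_le_one δ (-t)
  have hval : gluedProfile δ K F₁ F₂ u = (1 - ρ) * (K - t ^ 2) + ρ * F₂ u :=
    gluedProfile_of_lt hδ (by linarith)
  have hcap : ρ < 1 → 0 < K - t ^ 2 := fun h => by
    have ht2 : -t < 2 * δ := by
      by_contra hge
      exact (lt_irrefl (1 : ℝ)) (lt_of_le_of_lt (le_of_eq (cutPlus_of_ge hδ (not_lt.1 hge)).symm) h)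
    nlinarith
  refine ⟨?_, ?_⟩
  · rw [hval]
    rcases hρ1.lt_or_eq with h | h
    · nlinarith [hcap h]
    · rw [h]; simpa using hF₂pos
  · have hline : ∀ r : ℝ, r < -t → gluedProfile δ K F₁ F₂ (u + r • stdVec 0) =
        (1 - cutPlus δ (-(t + r))) * (K - (t + r) ^ 2) + cutPlus δ (-(t + r)) * F₂ (u + r • stdVec 0) :=
      fun r hr => by
      have h0 : (u + r • stdVec 0) 0 = t + r := (SteinStructure.sliceTail_add_smul_stdVec u r).2
      rw [gluedProfile_of_lt hδ (by rw [h0]; linarith), h0]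
    have hev : (fun r : ℝ => gluedProfile δ K F₁ F₂ (u + r • stdVec 0)) =ᶠ[𝓝 0]
        fun r => (1 - cutPlus δ (-(t + r))) * (K - (t + r) ^ 2) + cutPlus δ (-(t + r)) * F₂ (u + r • stdVec 0) := by
      filter_upwards [(isOpen_lt continuous_id continuous_const).mem_nhds (show (0 : ℝ) < -t by linarith)]
        with r hr
      exact hline r hr
    have hρd : HasDerivAt (fun r : ℝ => cutPlus δ (-(t + r))) (-deriv (cutPlus δ) (-t)) 0 := by
      have h : HasDerivAt (cutPlus δ) (deriv (cutPlus δ) (-t)) (-(t + 0)) := by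
        rw [add_zero]; exact ((contDiff_cutPlus δ).differentiable (by simp) (-t)).hasDerivAt
      have h2 : HasDerivAt (fun r : ℝ => -(t + r)) (-1) 0 :=
        ((hasDerivAt_id' (0 : ℝ)).const_add t).neg
      have h3 := h.comp 0 h2
      have heqf : (cutPlus δ ∘ fun r : ℝ => -(t + r)) = fun r => cutPlus δ (-(t + r)) := rfl
      rw [heqf, mul_neg_one] at h3
      exact h3
    have hF₂l : HasDerivAt (fun r : ℝ => F₂ (u + r • stdVec 0)) (fderiv ℝ F₂ u (stdVec 0)) 0 := by
      have hl : HasDerivAt (fun r : ℝ => u + r • stdVec 0) (stdVec 0) 0 := by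
        simpa using ((hasDerivAt_id (0 : ℝ)).smul_const (stdVec 0 : EuclideanSpace ℝ (Fin 4))).const_add u
      have h0 : HasFDerivAt F₂ (fderiv ℝ F₂ u) (u + (0 : ℝ) • stdVec 0) := by
        rw [zero_smul, add_zero]; exact hF₂d.hasFDerivAt
      exact h0.comp_hasDerivAt 0 hl
    have hcapl : HasDerivAt (fun r : ℝ => K - (t + r) ^ 2) (-(2 * t)) 0 := by
      have h2 : HasDerivAt (fun r : ℝ => t + r) 1 0 := by simpa using (hasDerivAt_id (0 : ℝ)).const_add t
      have := (h2.pow 2).const_sub K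
      simpa using this
    have hrhs : HasDerivAt (fun r : ℝ => (1 - cutPlus δ (-(t + r))) * (K - (t + r) ^ 2) +
        cutPlus δ (-(t + r)) * F₂ (u + r • stdVec 0))
        (- -deriv (cutPlus δ) (-t) * (K - t ^ 2) + (1 - cutPlus δ (-t)) * -(2 * t) +
          (-deriv (cutPlus δ) (-t) * F₂ u + cutPlus δ (-t) * fderiv ℝ F₂ u (stdVec 0))) 0 := by
      have h1 := (hρd.const_sub 1).mul hcapl
      have h2 := hρd.mul hF₂l
      have h := h1.add h2
      simp only [zero_smul, add_zero] at h
      exact h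
    have hlhs : HasDerivAt (fun r : ℝ => gluedProfile δ K F₁ F₂ (u + r • stdVec 0))
        (fderiv ℝ (gluedProfile δ K F₁ F₂) u (stdVec 0)) 0 := by
      have hl : HasDerivAt (fun r : ℝ => u + r • stdVec 0) (stdVec 0) 0 := by
        simpa using ((hasDerivAt_id (0 : ℝ)).smul_const (stdVec 0 : EuclideanSpace ℝ (Fin 4))).const_add u
      have h0 : HasFDerivAt (gluedProfile δ K F₁ F₂) (fderiv ℝ (gluedProfile δ K F₁ F₂) u)
          (u + (0 : ℝ) • stdVec 0) := by
        rw [zero_smul, add_zero]; exact hΦd.hasFDerivAt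
      exact h0.comp_hasDerivAt 0 hl
    have heq := hlhs.unique (hrhs.congr_of_eventuallyEq hev)
    rw [heq, ← hρ]
    have hρ' : 0 ≤ deriv (cutPlus δ) (-t) := deriv_cutPlus_nonneg hδ (-t)
    have hterm1 : 0 ≤ deriv (cutPlus δ) (-t) * (K - t ^ 2 - F₂ u) := by
      rcases lt_or_ge (2 * δ) (-t) with hgt | hle
      · rw [deriv_cutPlus_of_gt hδ hgt]; simp
      · have : 0 < K - t ^ 2 - F₂ u := by nlinarith
        nlinarith
    have hterm2 : 0 ≤ ρ * fderiv ℝ F₂ u (stdVec 0) := mul_nonneg hρ0 hF₂'.le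
    have hterm3 : 0 ≤ (1 - ρ) * (-(2 * t)) := by nlinarith
    rcases hρ0.lt_or_eq with hpos | hzero
    · have : 0 < ρ * fderiv ℝ F₂ u (stdVec 0) := mul_pos hpos hF₂'
      nlinarith
    · rw [← hzero]
      have : 0 < (1 - (0 : ℝ)) * (-(2 * t)) := by nlinarith
      nlinarith

end Profile

end Literature.Geometry.Symplectic

end
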